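import Mathlib.Algebra.MonoidAlgebra.Module
import Mathlib.GroupTheory.Perm.Fin
import Mathlib.GroupTheory.Perm.Support
import Mathlib.GroupTheory.Perm.Sign
import Mathlib.LinearAlgebra.Eigenspace.Triangularizable
import Mathlib.LinearAlgebra.Eigenspace.Pi
import Mathlib.LinearAlgebra.Projection
import Mathlib.FieldTheory.IsAlgClosed.AlgebraicClosure
import Mathlib.Algebra.CharP.Algebra
import Mathlib.RingTheory.Finiteness.Finsupp
import Mathlib.RingTheory.Nilpotent.Basic
import Mathlib.Tactic.Module
import Mathlib.Tactic.LinearCombination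
import Mathlib.Tactic.NoncommRing
import Literature.RepresentationTheory.FiniteGroups.KLRGradedCellularBasis
import Literature.RepresentationTheory.FiniteGroups.VershikKerovMaxDegreeProofs
import HarnessLib

/-!
# Towards `KLRGradedCellularBasis_holds`: first steps of the Hu–Mathas proof (inline lemmas)

Topic `Literature/RepresentationTheory/FiniteGroups`; "Proofs" sibling of `KLRGradedCellularBasis.lean`,
which vendors the named fact `KLRGradedCellularBasis` (Hu–Mathas 2010, Main Theorem, level one and
degenerate: `𝔽_p[S_n]` has a basis `β` indexed by the same-shape pairs of standard tableaux
`TableauPair n`, multiplicative in (residue content, Brundan–Kleshchev–Wang degree)). The fact is a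
THEORY-sized result (Brundan–Kleshchev's graded isomorphism `𝔽_pS_n ≅ R_n^{Λ₀}`, arXiv:0808.2032,
Thm 1.1 = Hu–Mathas Thm 24; Hu–Mathas §4–5); this file holds the PROVED first steps of the printed
argument, bottom-up (D-0026: inline lemmas, no new named facts):

* `card_tableauPair` — **the index set has `n!` elements**: `#TableauPair n = ∑_{μ ⊢ n} (f^μ)² = n!`
  (Hu–Mathas 2010, proof of Thm 55 / §3.3: the `ψ_{𝔰𝔱}` are as many as `dim H_n^Λ`; here level one,
  `dim 𝔽_pS_n = n!`, via the tree's Burnside identity `sum_sq_numStandardTableaux`);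
  `tableauPairEquivPerm` / `basisTableauPair` — hence `k[S_n]` has an (UNGRADED) basis indexed by
  `TableauPair n`: the dimension-count half of the basis theorem;
* `le_span_image_of_basis_mem`, `basis_mul_mem_span_of_gradedBlocks`,
  `KLRGradedCellularBasis_of_gradedBlocks`, `KLRGradedCellularBasis_iff_gradedBlocks` — **the last
  step, and the exact structural content of the fact**: `KLRGradedCellularBasis` is EQUIVALENT to
  "`𝔽_p[S_n]` carries an independent family of subspaces `N (α, e)` (content `α`, degree `e ∈ ℤ`),
  multiplicative in `e` within a content and orthogonal across contents, with a basis indexed by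
  `TableauPair n` adapted to it in the prescribed bidegrees" — which is what Brundan–Kleshchev
  (graded blocks, Hu–Mathas Thm 24) and Hu–Mathas (the homogeneous `ψ`-basis, Main Theorem) supply;
  `basis_map_mul_mem_span` transports the property along an algebra isomorphism;
* `jucysMurphy`, `jucysMurphy_eq_zero`, `jucysMurphy_succ`, `jucysMurphy_succ_mul_swap`,
  `of_swap_mul_self`, `of_swap_mul_jucysMurphy_of_ne`, `commute_jucysMurphy` — **the Jucys–Murphy
  elements `L_i = ∑_{j<i} (j i)` of `k[S_n]` satisfy the defining relations of the level-one
  degenerate cyclotomic Hecke algebra `H_n^{Λ₀}`** (Hu–Mathas 2010, §3.2, Def. 21 at `q = 1`,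
  `𝐐 = (0)`: `L_1 = 0`, `L_r L_s = L_s L_r`, `T_r² = 1`, `T_r L_r + 1 = L_{r+1} T_r`,
  `T_r L_s = L_s T_r` for `s ≠ r, r+1`), the starting point of both Brundan–Kleshchev's KLR
  generators (`e(𝐢)` = joint generalized eigenspaces of the `L_r`, `y_r = ∑_𝐢 (L_r - i_r) e(𝐢)`)
  and Hu–Mathas's construction; commutativity is proved through the class sums
  `X_m = ∑_{j<i<m} (j i) = L_0 + ⋯ + L_{m-1}` (`transpositionSum`), central for `S_m`
  (`of_mul_transpositionSum`), and `L_i = X_{i+1} - X_i`.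

* `exists_int_eq_of_jucysMurphy_mul_eq_smul`, `exists_int_of_hasEigenvalue_jucysMurphy` —
  **Jucys's theorem: over an algebraically closed field the eigenvalues of `L_i` on `K[S_n]` are
  integers `c`, `|c| ≤ i`** (the Okounkov–Vershik rank-two argument), hence in characteristic `p`
  they lie in the prime field `I = ℤ/pℤ` (Hu–Mathas 2010, §3.2, the paragraph defining `e(𝐢)`);
  `aeval_jucysMurphy_jmAnnihilator` — **`∏_{c=-i}^{i} (L_i - c)^{n!} = 0` in `k[S_n]` for every
  commutative ring `k`** (descended through `ℤ[S_n] ↪ ℚ̄[S_n]`), and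
  `iSup_maxGenEigenspace_jucysMurphy_eq_top` — over a field, the generalized eigenspaces of `L_i`
  for these integer eigenvalues exhaust `k[S_n]` (the decomposition `M = ⊕_𝐢 M_𝐢` behind `e(𝐢)`,
  one `L_i` at a time).

* `jointEigenspace`, `iSup_jointEigenspace_eq_top`, `iSupIndep_jointEigenspace`,
  `jointEigenspace_eq_bot`, `klrIdempotent`, `klrIdempotent_mul_self`,
  `klrIdempotent_mul_klrIdempotent_of_ne`, `sum_residueSeqs_klrIdempotent`,
  `jucysMurphy_mul_klrIdempotent` — **the joint generalized eigenspaces `M_𝐢` of the `L_r` on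
  `k[S_n]` and the KLR idempotents `e(𝐢)`** (Hu–Mathas 2010, §3.2): `k[S_n] = ⊕_𝐢 M_𝐢`, the
  `M_𝐢` are right ideals, vanish off integer sequences, `e(𝐢)` = component of `1`, pairwise
  orthogonal idempotents summing to `1`, `M_𝐢 = {v | e(𝐢)v = v}`, `L_t e(𝐢) = e(𝐢) L_t`;
* `mem_maxGenEigenspace_add_of_commute`, `mem_maxGenEigenspace_mul_of_commute` (linear algebra)
  and `of_swap_mul_mem_sup_jointEigenspace` — **`s_r M_𝐢 ⊆ M_𝐢 ⊕ M_{s_r 𝐢}`** for the simple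
  transpositions, through the `s_r`-invariant joint eigenspace of `L_t` (`t ≠ r, r+1`),
  `L_r + L_{r+1}`, `L_r L_{r+1}` (`symmEigenspace`): the mechanism that makes the residue-content
  classes two-sided ideals.

* `contentSpace`, `mul_mem_contentSpace`, `mul_mem_contentSpace_left`,
  `mul_eq_zero_of_mem_contentSpace`, `iSup_contentSpace_eq_top`, `contentIdempotent`,
  `sum_contentIdempotent`, `contentIdempotent_comm`, `mem_contentSpace_iff` — **the residue-content
  classes `k[S_n]_α = ⊕_{cont 𝐢 = α} M_𝐢 = e_α k[S_n]` are two-sided ideals with central,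
  pairwise orthogonal idempotents `e_α = ∑_{cont 𝐢 = α} e(𝐢)` summing to `1`, and
  `k[S_n]_α k[S_n]_{α'} = 0` for `α ≠ α'`** (Hu–Mathas 2010, §3.1–3.2: `R_n^Λ = ⊕_α e_α R_n^Λ`) —
  the "orthogonal across contents" input of `KLRGradedCellularBasis_of_gradedBlocks`, obtained
  here WITHOUT Murphy's basis or Nakayama's conjecture (the simple transpositions generate `S_n`,
  `Equiv.Perm.mclosure_swap_castSucc_succ`);
* `residueSeq`, `seqContent_residueSeq`, `TableauPair.content_eq_seqContent_fst/snd` — the residue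
  sequence of a standard tableau and **`TableauPair.content = cont (𝐢^T)`**, linking the fact's
  block label to the content classes.

* `bkNilpotent`, `bkNilpotent_mul_klrIdempotent`, `jucysMurphy_eq_bkNilpotent_add`,
  `bkNilpotent_pow_factorial` — **Brundan–Kleshchev's elements `y_r = ∑_𝐢 (L_r - i_r) e(𝐢)` are
  nilpotent (`y_r^{n!} = 0`) and `L_r = y_r + ∑_𝐢 i_r e(𝐢)`** (Hu–Mathas 2010, §3.2 and the
  inverse map of Thm 24 at `q = 1`): the degree-`2` KLR generators of `𝔽_p S_n`.

* `bkIntertwiner`, `bkIntertwiner_mul_jucysMurphy_left/right/of_ne`, `bkIntertwiner_mul_self`,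
  `bkIntertwiner_mul_mem_jointEigenspace`, `bkIntertwiner_mul_klrIdempotent` — **the intertwiners
  `Φ_r = s_r (L_r - L_{r+1}) + 1`: `Φ_r L_r = L_{r+1} Φ_r`, `Φ_r L_{r+1} = L_r Φ_r`,
  `Φ_r² = 1 - (L_r - L_{r+1})²`, `Φ_r M_𝐢 ⊆ M_{s_r 𝐢}`, `Φ_r e(𝐢) = e(s_r 𝐢) Φ_r`** (the shape of
  the KLR relation `ψ_r e(𝐢) = e(s_r 𝐢) ψ_r`); `bkNilpotent_eq_zero` (cyclotomic relation `y_1 = 0`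
  at level one), `commute_bkNilpotent` (`y_r y_t = y_t y_r`); `bkIntertwiner_mul_jucysMurphy`,
  `bkIntertwiner_mul_sum_smul_klrIdempotent`, `bkIntertwiner_mul_bkNilpotent` —
  **`Φ_r L_t = L_{s_r t} Φ_r`, `Φ_r D_t = D_{s_r t} Φ_r` (`D_t = ∑_𝐢 i_t e(𝐢)`), `Φ_r y_t = y_{s_r t} Φ_r`;**
  `isUnit_algebraMap_add_bkNilpotent_sub`, `jucysMurphy_sub_mul_klrIdempotent`,
  `exists_mul_jucysMurphy_sub_mul_klrIdempotent` — `(L_r - L_t) e(𝐢) = ((i_r - i_t) + (y_r - y_t)) e(𝐢)`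
  with `(i_r - i_t) + (y_r - y_t)` a unit for `i_r ≠ i_t` (Brundan–Kleshchev §3.1: "`x_{r,s}^{-1} e(𝐢)`
  makes sense");
* `bkDiffUnit`, `bkPhi`, `bkPhi_mul_klrIdempotent`, `bkPhi_mul_klrIdempotent_eq`,
  `bkPhi_mul_jucysMurphy_succ_mul_klrIdempotent` — **Brundan–Kleshchev's intertwiners
  `φ_r = s_r + ∑_{i_r≠i_{r+1}} x_{r,r+1}^{-1}e(𝐢) + ∑_{i_r=i_{r+1}} e(𝐢)` (BK 2009 (3.3)) with
  Lemma 3.1 (EI0) `φ_r e(𝐢) = e(s_r𝐢) φ_r` and (EI3) `φ_r x_{r+1} e(𝐢) = x_r φ_r e(𝐢)` /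
  `= (x_r φ_r + 1 - x_{r,r+1}) e(𝐢)`;** `bkPhi_mul_jucysMurphy_of_ne` (EI1),
  `jucysMurphy_succ_mul_bkPhi_mul_klrIdempotent` (EI4), `bkPhi_mul_bkPhi_mul_klrIdempotent` (EI5:
  `φ_r² e(𝐢) = (1 - x_{r,r+1}^{-2}) e(𝐢)` / `= 2 φ_r e(𝐢)`), `bkPhi_comm_of_far` (EI2:
  `φ_r φ_t = φ_t φ_r`, `|r - t| > 1`; on the way `of_swap_mul_sum_smul_klrIdempotent_comm`,
  `commute_of_swap_bkNilpotent`: `s_r` commutes with `D_t`, `y_t` for `t ∉ {r, r+1}`);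
* `braid_of_degenerateHecke_relations`, `bkIntertwiner_braid` — **the braid relation
  `θ_r θ_{r+1} θ_r = θ_{r+1} θ_r θ_{r+1}`** (Brundan–Kleshchev (3.5)), from the degenerate affine
  Hecke relations by an explicit normal-form computation;
* `bkPhi_triple_mul_klrIdempotent_eq` (`φ_a φ_b φ_c e(𝐢) = X_a(s_b s_c 𝐢) X_b(s_c 𝐢) X_c(𝐢) e(𝐢)`),
  `bkPhi_braid_of_eq_eq`, `bkPhi_braid_of_ne` — **(EI6) of BK Lemma 3.1 in the cases
  `i_r = i_{r+1} = i_{r+2}` (`φ_rφ_{r+1}φ_r e = (φ_{r+1}φ_rφ_{r+1} + φ_r - φ_{r+1}) e`) and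
  `i_r, i_{r+1}, i_{r+2}` pairwise distinct (`φ_rφ_{r+1}φ_r e = φ_{r+1}φ_rφ_{r+1} e`).**

What remains for `KLRGradedCellularBasis_holds` (recorded in the unit's notes, not here): the
`ℤ`-grading of each `e_α 𝔽_p[S_n]` with a `TableauPair`-indexed adapted basis in the
Brundan–Kleshchev–Wang degrees — i.e. the remaining cases (`i_r = i_{r+1} ≠ i_{r+2}`,
`i_r ≠ i_{r+1} = i_{r+2}`, `i_r = i_{r+2} ≠ i_{r+1}`) of the braid relation (EI6) of BK Lemma 3.1,
the elements `ψ_r = φ_r q_r(𝐢)⁻¹ e(𝐢)` (BK (3.12)–(3.21)), BK Theorems 3.2, 3.3 and §3.5 (the graded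
isomorphism with the graded presented algebra `R_α^Λ`, arXiv:0808.2032 Thm 1.1), Murphy's standard
basis and its triangularity (Hu–Mathas Thm 26, (3.x)), seminormal forms, and Hu–Mathas §4–5
(Thm 40, 49, 55). See the unit's BLUEPRINT.md.

## References

* J. Hu, A. Mathas, *Graded cellular bases for the cyclotomic Khovanov–Lauda–Rouquier algebras of
  type A*, Adv. Math. 225 (2010) 598–642, arXiv:0907.2985, Main Theorem, Def. 34, Thm 24, Thm 55.
  [HuMathas2010]
-/

noncomputable section

open scoped BigOperators

namespace Literature.RepresentationTheory.FiniteGroups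

open Literature.NumberTheory.DiophantineGeometry (StdFilling numStandardTableaux
  numStandardTableaux_eq_card_stdFilling)

/-! ### The index set `TableauPair n` has `n!` elements -/

/-- **`#TableauPair n = n!`**: the same-shape pairs of standard Young tableaux with `n` cells number
`∑_{μ ⊢ n} (f^μ)² = n!` (Burnside / RSK count; Hu–Mathas 2010, §3.3 and proof of Thm 55: the
standard and `ψ` bases are indexed by these pairs and `dim 𝔽_pS_n = n!`). From the tree's
`sum_sq_numStandardTableaux` and `numStandardTableaux_eq_card_stdFilling`.
[cite: HuMathas2010, Thm 55 (proof) and §3.3] -/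
theorem card_tableauPair (n : ℕ) : Fintype.card (TableauPair n) = n.factorial := by
  classical
  rw [← sum_sq_numStandardTableaux n, Fintype.card_sigma]
  refine Finset.sum_congr rfl fun μ _ => ?_
  rw [Fintype.card_prod, numStandardTableaux_eq_card_stdFilling, Nat.card_eq_fintype_card, sq]

/-- `#TableauPair n = #S_n`. [folklore] -/
theorem card_tableauPair_eq_card_perm (n : ℕ) :
    Fintype.card (TableauPair n) = Fintype.card (Equiv.Perm (Fin n)) := by
  rw [card_tableauPair, Fintype.card_perm, Fintype.card_fin]

/-- A bijection `TableauPair n ≃ S_n` (from the equality of cardinalities `n! = n!`; not canonical —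
the Robinson–Schensted correspondence would be a canonical one). [folklore] -/
def tableauPairEquivPerm (n : ℕ) : TableauPair n ≃ Equiv.Perm (Fin n) :=
  Fintype.equivOfCardEq (card_tableauPair_eq_card_perm n)

/-- **The ungraded skeleton of the Hu–Mathas basis theorem**: for any commutative ring `k`, the group
algebra `k[S_n]` has a basis indexed by the same-shape pairs of standard tableaux `TableauPair n`
(the group basis reindexed along `tableauPairEquivPerm`; dimension count `#TableauPair n = n!`,
Hu–Mathas 2010, proof of Thm 55). [cite: HuMathas2010, Thm 55 (proof)] -/
def basisTableauPair (k : Type*) [CommRing k] (n : ℕ) :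
    Module.Basis (TableauPair n) k (MonoidAlgebra k (Equiv.Perm (Fin n))) :=
  (MonoidAlgebra.basis (Equiv.Perm (Fin n)) k).reindex (tableauPairEquivPerm n).symm

/-- The basis vector `basisTableauPair k n i` is the group element `tableauPairEquivPerm n i`.
[folklore] -/
theorem basisTableauPair_apply (k : Type*) [CommRing k] (n : ℕ) (i : TableauPair n) :
    basisTableauPair k n i = MonoidAlgebra.of k _ (tableauPairEquivPerm n i) := by
  rw [basisTableauPair, Module.Basis.reindex_apply, Equiv.symm_symm, MonoidAlgebra.basis_apply,
    MonoidAlgebra.of_apply]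

/-- In particular `𝔽_p[S_n]` has SOME basis indexed by `TableauPair n` (the fact
`KLRGradedCellularBasis` asks for one that is moreover multiplicative in content and degree).
[folklore] -/
theorem nonempty_basis_tableauPair (p n : ℕ) [Fact p.Prime] :
    Nonempty (Module.Basis (TableauPair n) (ZMod p) (MonoidAlgebra (ZMod p) (Equiv.Perm (Fin n)))) :=
  ⟨basisTableauPair (ZMod p) n⟩


/-! ### The last step of the proof: from graded blocks with an adapted basis to the fact

Hu–Mathas's `{ψ_{𝔰𝔱}}` is a homogeneous basis of the graded algebra `R_n^Λ = ⊕_α R_α^Λ`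
(`R_α R_α' = 0` for `α ≠ α'`), `ψ_{𝔰𝔱} ∈ R_α` for the content `α` of the shape, of degree
`deg 𝔰 + deg 𝔱`; the recorded consequence is that products expand in the basis vectors of the
right content and degree. The linear algebra of that last step, proved in general. -/

section AdaptedBasis

variable {R M ι κ : Type*} [CommRing R] [AddCommGroup M] [Module R M] [Fintype ι]

/-- **A basis adapted to an independent family of submodules spans each member**: if every basis
vector `b i` lies in the member `N (f i)` of an independent family `N`, then
`N a ⊆ span {b i : f i = a}` (write `x ∈ N a` in the basis and split the sum according to `f`; the
part indexed by `f i ≠ a` lies in `N a ∩ ⨆_{c ≠ a} N c = 0`). [folklore] -/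
theorem le_span_image_of_basis_mem (b : Module.Basis ι R M) (N : κ → Submodule R M)
    (hN : iSupIndep N) (f : ι → κ) (hb : ∀ i, b i ∈ N (f i)) (a : κ) :
    N a ≤ Submodule.span R (b '' {i | f i = a}) := by
  classical
  intro x hx
  set y := ∑ i ∈ Finset.univ.filter (fun i => f i = a), b.repr x i • b i with hy
  set z := ∑ i ∈ Finset.univ.filter (fun i => ¬ f i = a), b.repr x i • b i with hz
  have hxyz : x = y + z := by
    rw [hy, hz, Finset.sum_filter_add_sum_filter_not, b.sum_repr]
  have hy_span : y ∈ Submodule.span R (b '' {i | f i = a}) := by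
    refine Submodule.sum_mem _ fun i hi => Submodule.smul_mem _ _ (Submodule.subset_span ?_)
    exact ⟨i, (Finset.mem_filter.1 hi).2, rfl⟩
  have hy_N : y ∈ N a := by
    refine Submodule.sum_mem _ fun i hi => Submodule.smul_mem _ _ ?_
    have h := hb i
    rwa [(Finset.mem_filter.1 hi).2] at h
  have hz_sup : z ∈ ⨆ (c) (_ : c ≠ a), N c := by
    refine Submodule.sum_mem _ fun i hi => Submodule.smul_mem _ _ ?_
    have hne : f i ≠ a := (Finset.mem_filter.1 hi).2
    exact Submodule.mem_iSup_of_mem (f i) (Submodule.mem_iSup_of_mem hne (hb i))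
  have hz_N : z ∈ N a := by
    have h : z = x - y := by rw [hxyz]; abel
    rw [h]
    exact Submodule.sub_mem _ hx hy_N
  have hz0 : z = 0 := (Submodule.disjoint_def.1 (iSupIndep_def.1 hN a)) z hz_N hz_sup
  rw [hxyz, hz0, add_zero]
  exact hy_span

omit [Fintype ι] in
/-- Conversely, the spans of the parts of a basis along any map `f : ι → κ` form an independent
family (to which the basis is adapted). [folklore] -/
theorem iSupIndep_span_image_fiber (b : Module.Basis ι R M) (f : ι → κ) :
    iSupIndep fun a => Submodule.span R (b '' {i | f i = a}) := by
  classical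
  rw [iSupIndep_def]
  intro a
  have h : (⨆ (c) (_ : c ≠ a), Submodule.span R (b '' {i | f i = c})) =
      Submodule.span R (b '' {i | f i ≠ a}) := by
    apply le_antisymm
    · refine iSup₂_le fun c hc => Submodule.span_mono (Set.image_mono ?_)
      intro i hi
      simp only [Set.mem_setOf_eq] at hi ⊢
      exact hi ▸ hc
    · refine Submodule.span_le.2 ?_
      rintro _ ⟨i, hi, rfl⟩
      exact Submodule.mem_iSup_of_mem (f i)
        (Submodule.mem_iSup_of_mem hi (Submodule.subset_span ⟨i, rfl, rfl⟩))
  rw [h]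
  exact b.linearIndependent.disjoint_span_image (Set.disjoint_left.2 fun i hi hi' => hi' hi)

end AdaptedBasis

section GradedBlocks

variable {K A ι C : Type*} [CommRing K] [Ring A] [Algebra K A] [Fintype ι]

/-- **Products of an adapted basis of a block-graded algebra.** Let `N (a, e)` (`a` a "content",
`e ∈ ℤ` a degree) be an independent family of subspaces of an algebra `A`, multiplicative within a
content (`N(a,e) N(a,e') ⊆ N(a,e+e')`) and orthogonal across contents (`N(a,e) N(a',e') = 0`,
`a ≠ a'`), and `β` a basis with `β k ∈ N (c k, d k)`. Then `β i β j` lies in the span of the `β k`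
with `c k = c i = c j` and `d k = d i + d j` — the shape of `KLRGradedCellularBasis` (Hu–Mathas
2010, Main Theorem ⇒ the recorded consequence). [folklore] -/
theorem basis_mul_mem_span_of_gradedBlocks (β : Module.Basis ι K A) (c : ι → C) (d : ι → ℤ)
    (N : C × ℤ → Submodule K A) (hN : iSupIndep N) (hβ : ∀ k, β k ∈ N (c k, d k))
    (hmul : ∀ (a : C) (e e' : ℤ) (x y : A), x ∈ N (a, e) → y ∈ N (a, e') → x * y ∈ N (a, e + e'))
    (hzero : ∀ (a : C) (e : ℤ) (a' : C) (e' : ℤ) (x y : A),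
      a ≠ a' → x ∈ N (a, e) → y ∈ N (a', e') → x * y = 0)
    (i j : ι) :
    β i * β j ∈ Submodule.span K (β '' {k | c k = c i ∧ c k = c j ∧ d k = d i + d j}) := by
  classical
  by_cases hc : c i = c j
  · have hj : β j ∈ N (c i, d j) := hc ▸ hβ j
    have hmem : β i * β j ∈ N (c i, d i + d j) := hmul _ _ _ _ _ (hβ i) hj
    have h := le_span_image_of_basis_mem β N hN (fun k => (c k, d k)) hβ (c i, d i + d j) hmem
    refine Submodule.span_mono (Set.image_mono ?_) h
    intro k hk
    simp only [Set.mem_setOf_eq, Prod.mk.injEq] at hk ⊢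
    exact ⟨hk.1, hk.1.trans hc, hk.2⟩
  · rw [hzero _ _ _ _ _ _ hc (hβ i) (hβ j)]
    exact Submodule.zero_mem _

omit [Fintype ι] in
/-- **Transport along an algebra isomorphism**: the multiplicativity-in-(content, degree) of a basis
is carried by `e : A ≃ₐ B` to the image basis (used to move the Hu–Mathas basis of `R_n^{Λ₀}` to
`𝔽_p[S_n]` along the Brundan–Kleshchev isomorphism, Hu–Mathas 2010, Thm 24). [folklore] -/
theorem basis_map_mul_mem_span {B : Type*} [Ring B] [Algebra K B] (β : Module.Basis ι K A)
    (S : ι → ι → Set ι) (h : ∀ i j, β i * β j ∈ Submodule.span K (β '' S i j)) (e : A ≃ₐ[K] B)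
    (i j : ι) :
    β.map e.toLinearEquiv i * β.map e.toLinearEquiv j ∈
      Submodule.span K (β.map e.toLinearEquiv '' S i j) := by
  have himg : (β.map e.toLinearEquiv : ι → B) '' S i j = e.toLinearEquiv '' (β '' S i j) := by
    rw [← Set.image_comp]; rfl
  rw [himg, Module.Basis.map_apply, Module.Basis.map_apply]
  have hprod : e.toLinearEquiv (β i) * e.toLinearEquiv (β j) = e.toLinearEquiv (β i * β j) :=
    (map_mul e _ _).symm
  rw [hprod]
  exact Submodule.apply_mem_span_image_of_mem_span (e.toLinearEquiv : A →ₗ[K] B) (h i j)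

end GradedBlocks

/-- **Reduction of the fact to its structural content.** `KLRGradedCellularBasis` follows from (and,
by `KLRGradedCellularBasis_iff_gradedBlocks`, is equivalent to): for every prime `p` and every `n`,
`𝔽_p[S_n]` carries an independent family of subspaces `N (α, e)` (content `α`, degree `e ∈ ℤ`),
multiplicative in the degree within a content and orthogonal across contents, together with a basis
indexed by `TableauPair n` whose vector `β k` lies in `N (content k, degree k)` — which is what
Brundan–Kleshchev (the blocks `e_α 𝔽_pS_n` are `ℤ`-graded algebras, Hu–Mathas Thm 24) and Hu–Mathas
(the homogeneous basis `ψ_{𝔰𝔱}` of degree `deg 𝔰 + deg 𝔱`, Main Theorem / Thm 55) provide.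
[cite: HuMathas2010, Main Theorem and Thm 24] -/
theorem KLRGradedCellularBasis_of_gradedBlocks
    (H : ∀ (p : ℕ) [Fact p.Prime] (n : ℕ),
      ∃ (β : Module.Basis (TableauPair n) (ZMod p) (MonoidAlgebra (ZMod p) (Equiv.Perm (Fin n))))
        (N : (ZMod p → ℕ) × ℤ → Submodule (ZMod p) (MonoidAlgebra (ZMod p) (Equiv.Perm (Fin n)))),
        iSupIndep N ∧
        (∀ k, β k ∈ N (TableauPair.content p k, TableauPair.degree p k)) ∧
        (∀ (a : ZMod p → ℕ) (e e' : ℤ) (x y : MonoidAlgebra (ZMod p) (Equiv.Perm (Fin n))),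
          x ∈ N (a, e) → y ∈ N (a, e') → x * y ∈ N (a, e + e')) ∧
        (∀ (a : ZMod p → ℕ) (e : ℤ) (a' : ZMod p → ℕ) (e' : ℤ)
          (x y : MonoidAlgebra (ZMod p) (Equiv.Perm (Fin n))),
          a ≠ a' → x ∈ N (a, e) → y ∈ N (a', e') → x * y = 0)) :
    KLRGradedCellularBasis := by
  intro p _ n
  obtain ⟨β, N, hN, hβ, hmul, hzero⟩ := H p n
  exact ⟨β, fun i j => basis_mul_mem_span_of_gradedBlocks β _ _ N hN hβ hmul hzero i j⟩

/-- The reduction `KLRGradedCellularBasis_of_gradedBlocks` loses nothing: a basis as in the fact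
yields the graded blocks as the spans `N (α, e) = span {β k : content k = α, degree k = e}`.
[folklore] -/
theorem KLRGradedCellularBasis_iff_gradedBlocks :
    KLRGradedCellularBasis ↔
    ∀ (p : ℕ) [Fact p.Prime] (n : ℕ),
      ∃ (β : Module.Basis (TableauPair n) (ZMod p) (MonoidAlgebra (ZMod p) (Equiv.Perm (Fin n))))
        (N : (ZMod p → ℕ) × ℤ → Submodule (ZMod p) (MonoidAlgebra (ZMod p) (Equiv.Perm (Fin n)))),
        iSupIndep N ∧
        (∀ k, β k ∈ N (TableauPair.content p k, TableauPair.degree p k)) ∧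
        (∀ (a : ZMod p → ℕ) (e e' : ℤ) (x y : MonoidAlgebra (ZMod p) (Equiv.Perm (Fin n))),
          x ∈ N (a, e) → y ∈ N (a, e') → x * y ∈ N (a, e + e')) ∧
        (∀ (a : ZMod p → ℕ) (e : ℤ) (a' : ZMod p → ℕ) (e' : ℤ)
          (x y : MonoidAlgebra (ZMod p) (Equiv.Perm (Fin n))),
          a ≠ a' → x ∈ N (a, e) → y ∈ N (a', e') → x * y = 0) := by
  classical
  refine ⟨fun H p _ n => ?_, KLRGradedCellularBasis_of_gradedBlocks⟩
  obtain ⟨β, hβ⟩ := H p n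
  -- the pieces: spans of the basis vectors of a given (content, degree)
  let f : TableauPair n → (ZMod p → ℕ) × ℤ := fun k => (TableauPair.content p k, TableauPair.degree p k)
  let N : (ZMod p → ℕ) × ℤ → Submodule (ZMod p) (MonoidAlgebra (ZMod p) (Equiv.Perm (Fin n))) :=
    fun ae => Submodule.span (ZMod p) (β '' {k | f k = ae})
  -- products of basis vectors of bidegrees (a,e), (a',e')
  have key : ∀ i j : TableauPair n,
      β i * β j ∈ (if TableauPair.content p i = TableauPair.content p j then
        N (TableauPair.content p i, TableauPair.degree p i + TableauPair.degree p j) else ⊥) := by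
    intro i j
    split_ifs with hc
    · refine Submodule.span_mono (Set.image_mono ?_) (hβ i j)
      intro k hk
      simp only [Set.mem_setOf_eq, f, Prod.mk.injEq] at hk ⊢
      exact ⟨hk.1, hk.2.2⟩
    · have h0 : {k : TableauPair n | TableauPair.content p k = TableauPair.content p i ∧
          TableauPair.content p k = TableauPair.content p j ∧
          TableauPair.degree p k = TableauPair.degree p i + TableauPair.degree p j} = ∅ := by
        ext k
        simp only [Set.mem_setOf_eq, Set.mem_empty_iff_false, iff_false, not_and]
        intro h1 h2
        exact absurd (h1.symm.trans h2) hc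
      have h := hβ i j
      rwa [h0, Set.image_empty, Submodule.span_empty] at h
  -- bilinear extension: x ∈ N(a,e), y ∈ N(a',e') ⇒ x*y in the right piece
  have ext2 : ∀ (a : ZMod p → ℕ) (e : ℤ) (a' : ZMod p → ℕ) (e' : ℤ)
      (P : Submodule (ZMod p) (MonoidAlgebra (ZMod p) (Equiv.Perm (Fin n)))),
      (∀ i j : TableauPair n, f i = (a, e) → f j = (a', e') → β i * β j ∈ P) →
      ∀ x y, x ∈ N (a, e) → y ∈ N (a', e') → x * y ∈ P := by
    intro a e a' e' P hP x y hx hy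
    refine Submodule.span_induction (p := fun x _ => x * y ∈ P) ?_ ?_ ?_ ?_ hx
    · rintro _ ⟨i, hi, rfl⟩
      refine Submodule.span_induction (p := fun y _ => β i * y ∈ P) ?_ ?_ ?_ ?_ hy
      · rintro _ ⟨j, hj, rfl⟩
        exact hP i j hi hj
      · rw [mul_zero]; exact Submodule.zero_mem _
      · intro u v _ _ hu hv
        rw [mul_add]; exact Submodule.add_mem _ hu hv
      · intro r u _ hu
        rw [mul_smul_comm]; exact Submodule.smul_mem _ _ hu
    · rw [zero_mul]; exact Submodule.zero_mem _
    · intro u v _ _ hu hv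
      rw [add_mul]; exact Submodule.add_mem _ hu hv
    · intro r u _ hu
      rw [smul_mul_assoc]; exact Submodule.smul_mem _ _ hu
  refine ⟨β, N, iSupIndep_span_image_fiber β f, fun k => Submodule.subset_span ⟨k, rfl, rfl⟩,
    fun a e e' x y hx hy => ext2 a e a e' _ (fun i j hi hj => ?_) x y hx hy,
    fun a e a' e' x y hne hx hy => ?_⟩
  · simp only [f, Prod.mk.injEq] at hi hj
    have h := key i j
    rw [if_pos (hi.1.trans hj.1.symm), hi.1, hi.2, hj.2] at h
    exact h
  · have h := ext2 a e a' e' ⊥ (fun i j hi hj => ?_) x y hx hy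
    · exact (Submodule.mem_bot _).1 h
    · simp only [f, Prod.mk.injEq] at hi hj
      have h := key i j
      rw [if_neg (by rw [hi.1, hj.1]; exact hne)] at h
      exact h


/-! ### The Jucys–Murphy elements of `k[S_n]` (Hu–Mathas §3.2, level one, degenerate case)

The degenerate (`q = 1`) cyclotomic Hecke algebra `H_n(1, 𝐐)` is generated by
`L_1, …, L_n, T_1, …, T_{n-1}` subject to the relations of Hu–Mathas 2010, §3.2, Definition 21:
`(L_1 - Q_1)⋯(L_1 - Q_ℓ) = 0`, `L_r L_s = L_s L_r`, `T_r² = 1`, `T_r L_r + 1 = L_{r+1} T_r`, the braid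
relations, `T_r L_s = L_s T_r` (`s ≠ r, r+1`), `T_r T_s = T_s T_r` (`|r - s| > 1`); for `Λ = Λ₀`
(level one, `𝐐 = (0)`) this is `k S_n` with `T_r = s_r` and `L_r` the Jucys–Murphy elements, and
ALL these relations are verified below (the braid/commutation relations of the `s_r` hold in `S_n`). Everything in Brundan–Kleshchev's and Hu–Mathas's constructions
(the idempotents `e(𝐢)` = generalized eigenspaces of the `L_r`, the nilpotents `y_r`, the blocks)
starts from these commuting elements; we record them (0-based: `L ⟨0, _⟩ = 0`). -/

section JucysMurphy

open Equiv

variable (k : Type*) [CommRing k] {n : ℕ}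

/-- The **Jucys–Murphy element** `L_i = ∑_{j < i} (j i) ∈ k[S_n]` (0-based indices, so `L_0 = 0`,
`L_1 = (0 1)`, `L_2 = (0 2) + (1 2)`, …): the image of the generator `L_{i+1}` of the level-one
degenerate cyclotomic Hecke algebra `H_n^{Λ₀} = k S_n` (Hu–Mathas 2010, §3.2, Def. 21; Jucys 1974,
Murphy 1981). [cite: HuMathas2010, §3.2 Def. 21] -/
def jucysMurphy (i : Fin n) : MonoidAlgebra k (Perm (Fin n)) :=
  ∑ j ∈ Finset.univ.filter (fun j : Fin n => j < i), MonoidAlgebra.of k _ (swap j i)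

/-- `L_0 = 0` (the cyclotomic relation `L_1 = 0` of `H_n^{Λ₀}`, Hu–Mathas 2010, §3.2 Def. 21).
[cite: HuMathas2010, §3.2 Def. 21] -/
theorem jucysMurphy_eq_zero {i : Fin n} (h : (i : ℕ) = 0) : jucysMurphy k i = 0 := by
  have hempty : Finset.univ.filter (fun j : Fin n => j < i) = ∅ := by
    ext j
    simp only [Finset.mem_filter, Finset.mem_univ, true_and, Finset.notMem_empty, iff_false,
      Fin.lt_def, h]
    exact Nat.not_lt_zero _
  rw [jucysMurphy, hempty, Finset.sum_empty]

/-- **The recursion `L_{i+1} = s_i L_i s_i + s_i`** (`s_i = (i, i+1)`): the defining relation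
`L_{r+1} = T_r L_r T_r + T_r` of the degenerate cyclotomic Hecke algebra holds for the
Jucys–Murphy elements of `k[S_n]` (Hu–Mathas 2010, §3.2, the line after Remark 22:
`L_{i+1} = q⁻¹ T_i L_i T_i + δ_{q1} T_i`). [cite: HuMathas2010, §3.2 Def. 21] -/
theorem jucysMurphy_succ {i i' : Fin n} (h : (i' : ℕ) = i + 1) :
    jucysMurphy k i' =
      MonoidAlgebra.of k _ (swap i i') * jucysMurphy k i * MonoidAlgebra.of k _ (swap i i') +
        MonoidAlgebra.of k _ (swap i i') := by
  have hfilter : Finset.univ.filter (fun m : Fin n => m < i') =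
      insert i (Finset.univ.filter (fun m : Fin n => m < i)) := by
    ext m
    simp only [Finset.mem_filter, Finset.mem_univ, true_and, Finset.mem_insert,
      Fin.lt_def, Fin.ext_iff]
    omega
  have hnot : i ∉ Finset.univ.filter (fun m : Fin n => m < i) := by simp
  rw [jucysMurphy, hfilter, Finset.sum_insert hnot, add_comm, jucysMurphy, Finset.mul_sum,
    Finset.sum_mul]
  congr 1
  refine Finset.sum_congr rfl fun m hm => ?_
  have hmi : m < i := (Finset.mem_filter.1 hm).2
  have hmi' : m ≠ i' := by
    intro e
    rw [Fin.lt_def] at hmi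
    rw [Fin.ext_iff] at e
    omega
  rw [← map_mul, ← map_mul, swap_mul_swap_mul_swap (ne_of_lt hmi) hmi', swap_comm]

/-- A permutation fixing every `x ≥ m` maps `{x < m}` into itself. [folklore] -/
theorem perm_apply_val_lt_of_fix {σ : Perm (Fin n)} {m : ℕ}
    (hσ : ∀ x : Fin n, m ≤ (x : ℕ) → σ x = x) {a : Fin n} (ha : (a : ℕ) < m) :
    ((σ a : Fin n) : ℕ) < m := by
  rcases lt_or_ge ((σ a : Fin n) : ℕ) m with h | hge
  · exact h
  · have h2 : σ a = a := σ.injective (hσ _ hge)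
    rw [h2] at hge
    omega

/-- If `σ` fixes every `x ≥ m` then so does `σ⁻¹`. [folklore] -/
theorem perm_inv_fix_of_fix {σ : Perm (Fin n)} {m : ℕ}
    (hσ : ∀ x : Fin n, m ≤ (x : ℕ) → σ x = x) (x : Fin n) (hx : m ≤ (x : ℕ)) : σ⁻¹ x = x := by
  conv_lhs => rw [← hσ x hx]
  exact σ.symm_apply_apply x

/-- The transpositions `(j i)`, `j < i < m`, of `S_n` (those of the parabolic subgroup `S_m`), as a
finite set of permutations. [folklore] -/
def transpositionsBelow (n m : ℕ) : Finset (Perm (Fin n)) :=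
  ((Finset.univ ×ˢ Finset.univ).filter
      (fun q : Fin n × Fin n => q.2 < q.1 ∧ (q.1 : ℕ) < m)).image fun q => swap q.2 q.1

/-- Membership in `transpositionsBelow`. [folklore] -/
theorem mem_transpositionsBelow {m : ℕ} {τ : Perm (Fin n)} :
    τ ∈ transpositionsBelow n m ↔ ∃ i j : Fin n, j < i ∧ (i : ℕ) < m ∧ τ = swap j i := by
  simp only [transpositionsBelow, Finset.mem_image, Finset.mem_filter, Finset.mem_product,
    Finset.mem_univ, true_and, Prod.exists]
  constructor
  · rintro ⟨i, j, ⟨hji, him⟩, rfl⟩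
    exact ⟨i, j, hji, him, rfl⟩
  · rintro ⟨i, j, hji, him, rfl⟩
    exact ⟨i, j, ⟨hji, him⟩, rfl⟩

/-- Conjugation by a permutation fixing every `x ≥ m` permutes the transpositions of `S_m`.
[folklore] -/
theorem conj_mem_transpositionsBelow {m : ℕ} {σ : Perm (Fin n)}
    (hσ : ∀ x : Fin n, m ≤ (x : ℕ) → σ x = x) {τ : Perm (Fin n)}
    (hτ : τ ∈ transpositionsBelow n m) : σ * τ * σ⁻¹ ∈ transpositionsBelow n m := by
  obtain ⟨i, j, hji, him, rfl⟩ := mem_transpositionsBelow.1 hτ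
  rw [← swap_apply_apply]
  have him' := perm_apply_val_lt_of_fix hσ him
  have hjm' := perm_apply_val_lt_of_fix hσ (lt_trans (Fin.lt_def.1 hji) him)
  rcases lt_or_gt_of_ne (σ.injective.ne (ne_of_lt hji)) with h | h
  · exact mem_transpositionsBelow.2 ⟨σ i, σ j, h, him', rfl⟩
  · exact mem_transpositionsBelow.2 ⟨σ j, σ i, h, hjm', swap_comm _ _⟩

/-- Sorted transpositions are equal only when their entries are. [folklore] -/
theorem swap_eq_swap_of_lt {a b c d : Fin n} (hab : a < b) (hcd : c < d)
    (h : swap a b = swap c d) : a = c ∧ b = d := by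
  have h1 : swap c d a = b := by rw [← h, swap_apply_left]
  by_cases hac : a = c
  · subst hac
    rw [swap_apply_left] at h1
    exact ⟨rfl, h1.symm⟩
  · by_cases had : a = d
    · subst had
      rw [swap_apply_right] at h1
      subst h1
      exact absurd (hab.trans hcd) (lt_irrefl _)
    · rw [swap_apply_of_ne_of_ne hac had] at h1
      exact absurd h1 (ne_of_lt hab)

/-- **The class sum of the transpositions of `S_m` inside `k[S_n]`**, `X_m = ∑_{j < i < m} (j i)`.
[folklore] -/
def transpositionSum (m : ℕ) : MonoidAlgebra k (Perm (Fin n)) :=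
  ∑ τ ∈ transpositionsBelow n m, MonoidAlgebra.of k _ τ

/-- `X_m = L_0 + L_1 + ⋯ + L_{m-1}`: the class sum of transpositions of `S_m` is the sum of the
first `m` Jucys–Murphy elements (Jucys 1974 / Murphy 1981). [folklore] -/
theorem sum_jucysMurphy_eq_transpositionSum (m : ℕ) :
    ∑ i ∈ Finset.univ.filter (fun i : Fin n => (i : ℕ) < m), jucysMurphy k i =
      transpositionSum k m := by
  have hinj : Set.InjOn (fun q : Fin n × Fin n => swap q.2 q.1)
      ↑((Finset.univ ×ˢ Finset.univ).filter
        (fun q : Fin n × Fin n => q.2 < q.1 ∧ (q.1 : ℕ) < m)) := by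
    rintro ⟨i, j⟩ hq ⟨i', j'⟩ hq' h
    rw [Finset.coe_filter, Set.mem_setOf_eq] at hq hq'
    obtain ⟨h1, h2⟩ := swap_eq_swap_of_lt hq.2.1 hq'.2.1 h
    exact Prod.ext h2 h1
  rw [transpositionSum, transpositionsBelow, Finset.sum_image hinj]
  simp only [jucysMurphy]
  symm
  refine Finset.sum_finset_product'
    (f := fun i j => MonoidAlgebra.of k (Perm (Fin n)) (swap j i)) _ _ _ fun q => ?_
  simp only [Finset.mem_filter, Finset.mem_product, Finset.mem_univ, true_and]
  tauto

/-- **`X_m` is central for `S_m`**: the class sum of the transpositions of `S_m` commutes with every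
permutation fixing all `x ≥ m` (conjugation permutes the summands). [folklore] -/
theorem of_mul_transpositionSum {σ : Perm (Fin n)} {m : ℕ}
    (hσ : ∀ x : Fin n, m ≤ (x : ℕ) → σ x = x) :
    MonoidAlgebra.of k _ σ * transpositionSum k m =
      transpositionSum k m * MonoidAlgebra.of k _ σ := by
  have key : ∑ τ ∈ transpositionsBelow n m, MonoidAlgebra.of k _ (σ * τ * σ⁻¹) =
      ∑ τ ∈ transpositionsBelow n m, MonoidAlgebra.of k _ τ := by
    refine Finset.sum_nbij' (fun τ => σ * τ * σ⁻¹) (fun τ => σ⁻¹ * τ * σ) (fun τ hτ => ?_)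
      (fun τ hτ => ?_) (fun τ _ => by group) (fun τ _ => by group) (fun τ _ => rfl)
    · exact conj_mem_transpositionsBelow hσ hτ
    · have h := conj_mem_transpositionsBelow (perm_inv_fix_of_fix hσ) hτ
      rwa [inv_inv] at h
  rw [transpositionSum, Finset.mul_sum, Finset.sum_mul]
  calc ∑ τ ∈ transpositionsBelow n m, MonoidAlgebra.of k _ σ * MonoidAlgebra.of k _ τ
      = ∑ τ ∈ transpositionsBelow n m,
          MonoidAlgebra.of k _ (σ * τ * σ⁻¹) * MonoidAlgebra.of k _ σ := by
        refine Finset.sum_congr rfl fun τ _ => ?_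
        rw [← map_mul, ← map_mul]
        congr 1
        group
    _ = (∑ τ ∈ transpositionsBelow n m, MonoidAlgebra.of k _ (σ * τ * σ⁻¹)) *
          MonoidAlgebra.of k _ σ := by rw [Finset.sum_mul]
    _ = (∑ τ ∈ transpositionsBelow n m, MonoidAlgebra.of k _ τ) * MonoidAlgebra.of k _ σ := by
        rw [key]
    _ = ∑ τ ∈ transpositionsBelow n m, MonoidAlgebra.of k _ τ * MonoidAlgebra.of k _ σ := by
        rw [Finset.sum_mul]

/-- `L_i = X_{i+1} - X_i`. [folklore] -/
theorem jucysMurphy_eq_transpositionSum_sub (i : Fin n) :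
    jucysMurphy k i = transpositionSum k ((i : ℕ) + 1) - transpositionSum k i := by
  rw [← sum_jucysMurphy_eq_transpositionSum, ← sum_jucysMurphy_eq_transpositionSum]
  have hfilter : Finset.univ.filter (fun i' : Fin n => (i' : ℕ) < (i : ℕ) + 1) =
      insert i (Finset.univ.filter (fun i' : Fin n => (i' : ℕ) < i)) := by
    ext i'
    simp only [Finset.mem_filter, Finset.mem_univ, true_and, Finset.mem_insert, Fin.ext_iff]
    omega
  have hnot : i ∉ Finset.univ.filter (fun i' : Fin n => (i' : ℕ) < i) := by simp
  rw [hfilter, Finset.sum_insert hnot, add_sub_cancel_right]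

/-- A Jucys–Murphy element `L_j` commutes with every permutation fixing all `x > j`... stated for
the class sums: `L_j` commutes with `X_m` whenever `j < m`. [folklore] -/
theorem jucysMurphy_mul_transpositionSum {j : Fin n} {m : ℕ} (hjm : (j : ℕ) < m) :
    jucysMurphy k j * transpositionSum k m = transpositionSum k m * jucysMurphy k j := by
  rw [jucysMurphy, Finset.sum_mul, Finset.mul_sum]
  refine Finset.sum_congr rfl fun j' hj' => ?_
  have hj'j : j' < j := (Finset.mem_filter.1 hj').2
  refine of_mul_transpositionSum k fun x hx => swap_apply_of_ne_of_ne ?_ ?_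
  · intro e
    subst e
    rw [Fin.lt_def] at hj'j
    omega
  · intro e
    subst e
    omega

/-- **The Jucys–Murphy elements commute** (`L_r L_t = L_t L_r`, a defining relation of the
degenerate cyclotomic Hecke algebra, Hu–Mathas 2010, §3.2 Def. 21; for `k[S_n]`: Jucys 1974, Murphy 1981 —
`L_i = X_{i+1} - X_i` with `X_m` central in `k[S_m] ∋ L_j` for `j < m`).
[cite: HuMathas2010, §3.2 Def. 21] -/
theorem commute_jucysMurphy (i j : Fin n) : Commute (jucysMurphy k i) (jucysMurphy k j) := by
  -- reduce to `j < i`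
  wlog hji : j < i generalizing i j
  · rcases eq_or_lt_of_not_gt hji with h | h
    · subst h
      exact Commute.refl _
    · exact (this j i h).symm
  have hj1 : (j : ℕ) < (i : ℕ) + 1 := Nat.lt_succ_of_lt (Fin.lt_def.1 hji)
  have hj2 : (j : ℕ) < (i : ℕ) := Fin.lt_def.1 hji
  change jucysMurphy k i * jucysMurphy k j = jucysMurphy k j * jucysMurphy k i
  rw [jucysMurphy_eq_transpositionSum_sub k i, sub_mul, mul_sub,
    jucysMurphy_mul_transpositionSum k hj1, jucysMurphy_mul_transpositionSum k hj2]


/-- `T_r² = 1` in `k[S_n]` (the quadratic relation `(T_r + 1)(T_r - q) = 0` at `q = 1`,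
Hu–Mathas 2010, §3.2 Def. 21). [cite: HuMathas2010, §3.2 Def. 21] -/
theorem of_swap_mul_self (a b : Fin n) :
    MonoidAlgebra.of k (Perm (Fin n)) (swap a b) * MonoidAlgebra.of k _ (swap a b) = 1 := by
  rw [← map_mul, swap_mul_self, map_one]

/-- **The relation `T_r L_r + 1 = L_{r+1} T_r`** of the degenerate cyclotomic Hecke algebra
(Hu–Mathas 2010, §3.2 Def. 21, `T_r L_r + δ_{q1} = L_{r+1}(T_r - q + 1)` at `q = 1`) holds in
`k[S_n]`. [cite: HuMathas2010, §3.2 Def. 21] -/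
theorem jucysMurphy_succ_mul_swap {i i' : Fin n} (h : (i' : ℕ) = i + 1) :
    jucysMurphy k i' * MonoidAlgebra.of k _ (swap i i') =
      MonoidAlgebra.of k _ (swap i i') * jucysMurphy k i + 1 := by
  rw [jucysMurphy_succ k h, add_mul, mul_assoc, of_swap_mul_self, mul_one]

/-- **The relation `T_r L_s = L_s T_r` (`s ≠ r, r+1`)** of the degenerate cyclotomic Hecke algebra
(Hu–Mathas 2010, §3.2 Def. 21) holds in `k[S_n]`: for `s < r` the transpositions involved are
disjoint, for `s > r + 1` the simple transposition `s_r` lies in `S_s` and commutes with the class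
sums `X_s`, `X_{s+1}`. [cite: HuMathas2010, §3.2 Def. 21] -/
theorem of_swap_mul_jucysMurphy_of_ne {a a' t : Fin n} (ha : (a' : ℕ) = a + 1) (hta : t ≠ a)
    (hta' : t ≠ a') :
    MonoidAlgebra.of k _ (swap a a') * jucysMurphy k t =
      jucysMurphy k t * MonoidAlgebra.of k _ (swap a a') := by
  rcases lt_or_gt_of_ne hta with h | h
  · -- `t < a`: termwise, disjoint transpositions commute
    rw [jucysMurphy, Finset.mul_sum, Finset.sum_mul]
    refine Finset.sum_congr rfl fun j hj => ?_
    have hjt : (j : ℕ) < t := Fin.lt_def.1 (Finset.mem_filter.1 hj).2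
    have hta2 : (t : ℕ) < a := Fin.lt_def.1 h
    rw [← map_mul, ← map_mul]
    congr 1
    have hnd : [j, t, a, a'].Nodup := by
      have h1 : j ≠ t := fun e => by rw [Fin.ext_iff] at e; omega
      have h2 : j ≠ a := fun e => by rw [Fin.ext_iff] at e; omega
      have h3 : j ≠ a' := fun e => by rw [Fin.ext_iff] at e; omega
      have h4 : t ≠ a' := fun e => by rw [Fin.ext_iff] at e; omega
      have h5 : a ≠ a' := fun e => by rw [Fin.ext_iff] at e; omega
      simp only [List.nodup_cons, List.mem_cons, List.not_mem_nil, List.nodup_nil, or_false,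
        not_or, and_true, not_false_eq_true]
      exact ⟨⟨h1, h2, h3⟩, ⟨hta, h4⟩, h5⟩
    exact (Perm.disjoint_swap_swap hnd).commute.eq.symm
  · -- `t > a`, `t ≠ a + 1`: `swap a a'` fixes every `x ≥ t`
    have ht2 : (a : ℕ) + 2 ≤ t := by
      rw [Fin.lt_def] at h
      have h' := Fin.val_ne_of_ne hta'
      omega
    have hfix : ∀ m : ℕ, (t : ℕ) ≤ m → ∀ x : Fin n, m ≤ (x : ℕ) → swap a a' x = x := by
      intro m hm x hx
      refine swap_apply_of_ne_of_ne ?_ ?_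
      · intro e
        subst e
        omega
      · intro e
        subst e
        omega
    rw [jucysMurphy_eq_transpositionSum_sub k t, mul_sub, sub_mul,
      of_mul_transpositionSum k (hfix _ (Nat.le_succ _)), of_mul_transpositionSum k (hfix _ le_rfl)]

end JucysMurphy


/-! ### The degenerate cyclotomic Hecke relations, continued -/

section JucysMurphyRelations

open Equiv

variable (k : Type*) [CommRing k] {n : ℕ}

/-- **The relation `s_i L_{i+1} = L_i s_i + 1`** (left-multiplied form of the recursion).
[cite: HuMathas2010, §3.2 Def. 21] -/
theorem of_swap_mul_jucysMurphy_succ {i i' : Fin n} (h : (i' : ℕ) = i + 1) :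
    MonoidAlgebra.of k _ (swap i i') * jucysMurphy k i' =
      jucysMurphy k i * MonoidAlgebra.of k _ (swap i i') + 1 := by
  rw [jucysMurphy_succ k h, mul_add, of_swap_mul_self, ← mul_assoc, ← mul_assoc, of_swap_mul_self,
    one_mul]

end JucysMurphyRelations

/-! ### The spectrum of the Jucys–Murphy elements: eigenvalues are integers `c`, `|c| ≤ i`

Hu–Mathas 2010, §3.2 (before Thm 24, citing Grojnowski and Kleshchev's book): on every
finite-dimensional `H_n^Λ`-module the eigenvalues of each `L_m` lie in `I = ℤ/eℤ` (degenerate case),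
so that the joint generalized eigenspaces `M_𝐢`, `𝐢 ∈ I^n`, exhaust `M` and the KLR idempotents
`e(𝐢)` exist. For `k[S_n]` this is Jucys's theorem that the eigenvalues of `L_i` are the contents
`c`, `|c| ≤ i` (0-based). We prove it over any algebraically closed field by the Okounkov–Vershik
argument on the rank-two algebra `⟨L_i, L_{i+1}, s_i⟩`: if `L_{i+1} v = μ v`, `L_i v = a v`, then
with `w = s_i v` one has `L_{i+1} w = a w + v`, `L_i w = μ w - v`; either `(μ - a) w - v = 0`, and
then `s_i² = 1` forces `(μ - a)² = 1`, or `(μ - a) w - v` is a `μ`-eigenvector of `L_i`; induct. -/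

section Spectrum

open Equiv

variable (K : Type*) [Field K] {n : ℕ}

/-- **Jucys's theorem on the spectrum of the Jucys–Murphy elements** (inductive form): over an
algebraically closed field `K` (any characteristic), if `L_i v = μ v` for some `v ≠ 0` in `K[S_n]`
then `μ = c · 1` for an integer `c` with `|c| ≤ i` (0-based `L_i = ∑_{j<i} (j i)`). This is the
degenerate, level-one case of "the eigenvalues of each `L_m` are of the form `q_i`, `i ∈ I`"
(Hu–Mathas 2010, §3.2, the paragraph defining `e(𝐢)`), proved by the Okounkov–Vershik rank-two
argument. [cite: HuMathas2010, §3.2 (eigenvalues of L_m, before Thm 24)] -/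
theorem exists_int_eq_of_jucysMurphy_mul_eq_smul [IsAlgClosed K] (m : ℕ) :
    ∀ (i : Fin n), (i : ℕ) = m → ∀ (μ : K) (v : MonoidAlgebra K (Perm (Fin n))),
      v ≠ 0 → jucysMurphy K i * v = μ • v → ∃ c : ℤ, |c| ≤ m ∧ (c : K) = μ := by
  induction m with
  | zero =>
    intro i hi μ v hv h
    rw [jucysMurphy_eq_zero K hi, zero_mul] at h
    have hμ : μ = 0 := by
      by_contra hne
      exact hv ((smul_eq_zero.1 h.symm).resolve_left hne)
    exact ⟨0, le_rfl, by simp [hμ]⟩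
  | succ m ih =>
    intro i' hi' μ v₀ hv₀ h₀
    have hm : m < n := by have h2 := i'.2; omega
    obtain ⟨i, hi⟩ : ∃ i : Fin n, (i : ℕ) = m := ⟨⟨m, hm⟩, rfl⟩
    have hii' : (i' : ℕ) = (i : ℕ) + 1 := by rw [hi, hi']
    -- notation
    have hss : MonoidAlgebra.of K (Perm (Fin n)) (swap i i') * MonoidAlgebra.of K _ (swap i i') = 1 :=
      of_swap_mul_self K i i'
    -- a joint eigenvector `v` of `L_{i'}` (eigenvalue `μ`) and `L_i` (eigenvalue `a`)
    let f : Module.End K (MonoidAlgebra K (Perm (Fin n))) := LinearMap.mulLeft K (jucysMurphy K i')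
    let g : Module.End K (MonoidAlgebra K (Perm (Fin n))) := LinearMap.mulLeft K (jucysMurphy K i)
    have hE : ∀ x ∈ f.eigenspace μ, g x ∈ f.eigenspace μ := by
      intro x hx
      rw [Module.End.mem_eigenspace_iff] at hx ⊢
      change jucysMurphy K i' * (jucysMurphy K i * x) = μ • (jucysMurphy K i * x)
      change jucysMurphy K i' * x = μ • x at hx
      rw [← mul_assoc, (commute_jucysMurphy K i' i).eq, mul_assoc, hx, mul_smul_comm]
    have hv₀E : v₀ ∈ f.eigenspace μ := Module.End.mem_eigenspace_iff.2 h₀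
    haveI : Nontrivial (f.eigenspace μ) :=
      ⟨⟨⟨v₀, hv₀E⟩, 0, fun e => hv₀ (congrArg Subtype.val e)⟩⟩
    obtain ⟨a, ha⟩ := Module.End.exists_eigenvalue (g.restrict hE)
    obtain ⟨⟨v, hvE⟩, hv⟩ := ha.exists_hasEigenvector
    have hv0 : v ≠ 0 := fun e => hv.2 (Subtype.ext e)
    have hgv : jucysMurphy K i * v = a • v := by
      have e := congrArg Subtype.val hv.apply_eq_smul
      simpa [LinearMap.restrict_apply, g] using e
    have hfv : jucysMurphy K i' * v = μ • v := Module.End.mem_eigenspace_iff.1 hvE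
    -- the induction hypothesis for `(a, v)`
    obtain ⟨c, hc, hca⟩ := ih i hi a v hv0 hgv
    -- `w = s v`:  `L_{i'} w = a w + v`  and  `L_i w = μ w - v`
    have h1 : jucysMurphy K i' * (MonoidAlgebra.of K _ (swap i i') * v) =
        a • (MonoidAlgebra.of K _ (swap i i') * v) + v := by
      rw [jucysMurphy_succ K hii', add_mul, mul_assoc (_ * jucysMurphy K i) _ (_ * v),
        ← mul_assoc (MonoidAlgebra.of K _ (swap i i')) (MonoidAlgebra.of K _ (swap i i')) v, hss,
        one_mul, mul_assoc _ (jucysMurphy K i) v, hgv, mul_smul_comm]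
    have h2 : jucysMurphy K i * (MonoidAlgebra.of K _ (swap i i') * v) =
        μ • (MonoidAlgebra.of K _ (swap i i') * v) - v := by
      have e : jucysMurphy K i * MonoidAlgebra.of K _ (swap i i') =
          MonoidAlgebra.of K _ (swap i i') * jucysMurphy K i' - 1 := by
        rw [of_swap_mul_jucysMurphy_succ K hii', add_sub_cancel_right]
      rw [← mul_assoc, e, sub_mul, one_mul, mul_assoc, hfv, mul_smul_comm]
    have hw0 : MonoidAlgebra.of K _ (swap i i') * v ≠ 0 := by
      intro e0
      apply hv0
      rw [← one_mul v, ← hss, mul_assoc, e0, mul_zero]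
    obtain ⟨hc1, hc2⟩ := abs_le.1 hc
    by_cases hx : (μ - a) • (MonoidAlgebra.of K _ (swap i i') * v) - v = 0
    · -- `v = (μ - a) w`; applying `s` (with `s² = 1`) gives `(μ - a)² = 1`
      have hvx : v = (μ - a) • (MonoidAlgebra.of K _ (swap i i') * v) := (sub_eq_zero.1 hx).symm
      have e1 : MonoidAlgebra.of K _ (swap i i') * v =
          ((μ - a) * (μ - a)) • (MonoidAlgebra.of K _ (swap i i') * v) := by
        conv_lhs => rw [hvx, mul_smul_comm, ← mul_assoc, hss, one_mul, hvx, smul_smul]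
      have e2 : ((μ - a) * (μ - a) - 1) • (MonoidAlgebra.of K _ (swap i i') * v) = 0 := by
        rw [sub_smul, one_smul, ← e1, sub_self]
      have hsq : (μ - a) * (μ - a) = 1 := by
        rcases smul_eq_zero.1 e2 with h | h
        · exact sub_eq_zero.1 h
        · exact absurd h hw0
      rcases mul_self_eq_one_iff.1 hsq with h | h
      · refine ⟨c + 1, abs_le.2 ⟨by omega, by omega⟩, ?_⟩
        push_cast
        rw [hca]
        linear_combination -h
      · refine ⟨c - 1, abs_le.2 ⟨by omega, by omega⟩, ?_⟩
        push_cast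
        rw [hca]
        linear_combination -h
    · -- `(μ - a) w - v ≠ 0` is a `μ`-eigenvector of `L_i`
      have hLx : jucysMurphy K i * ((μ - a) • (MonoidAlgebra.of K _ (swap i i') * v) - v) =
          μ • ((μ - a) • (MonoidAlgebra.of K _ (swap i i') * v) - v) := by
        rw [mul_sub, mul_smul_comm, h2, hgv]
        module
      obtain ⟨c', hc', hc'μ⟩ := ih i hi μ _ hx hLx
      obtain ⟨hc'1, hc'2⟩ := abs_le.1 hc'
      exact ⟨c', abs_le.2 ⟨by omega, by omega⟩, hc'μ⟩

/-- **The eigenvalues of the Jucys–Murphy element `L_i` on `K[S_n]` (left multiplication) are the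
integers `c · 1_K` with `|c| ≤ i`**, `K` algebraically closed of any characteristic; in
characteristic `p` they therefore lie in the prime field `𝔽_p = I`, which is what makes the KLR
idempotents `e(𝐢)`, `𝐢 ∈ I^n`, of `𝔽_p S_n` well defined (Hu–Mathas 2010, §3.2).
[cite: HuMathas2010, §3.2 (eigenvalues of L_m, before Thm 24)] -/
theorem exists_int_of_hasEigenvalue_jucysMurphy [IsAlgClosed K] (i : Fin n) (μ : K)
    (hμ : Module.End.HasEigenvalue (LinearMap.mulLeft K (jucysMurphy K i)) μ) :
    ∃ c : ℤ, |c| ≤ i ∧ (c : K) = μ := by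
  obtain ⟨v, hv⟩ := hμ.exists_hasEigenvector
  exact exists_int_eq_of_jucysMurphy_mul_eq_smul K i i rfl μ v hv.2
    (Module.End.mem_eigenspace_iff.1 hv.1)

end Spectrum


/-! ### The annihilating polynomial `∏_{|c| ≤ i} (X - c)^{n!}` of `L_i`, over any commutative ring

From the spectrum over an algebraically closed field we descend to `ℤ[S_n]` (through
`ℤ[S_n] ↪ ℚ̄[S_n]`) and then to every commutative ring `k`: the Jucys–Murphy element `L_i` of
`k[S_n]` is killed by `∏_{c=-i}^{i} (X - c)^{n!}`. Over a field this says that the generalized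
eigenspaces of `L_i` for the INTEGER eigenvalues `c`, `|c| ≤ i`, exhaust `k[S_n]`; over `𝔽_p` these
are the residues `I = ℤ/pℤ` of Hu–Mathas 2010, §3.2, and the joint generalized eigenspaces of
`L_1, …, L_n` give the KLR idempotents `e(𝐢)`. -/

section SpectrumDescent

open Equiv Polynomial

variable {n : ℕ}

/-- Base change of coefficients maps Jucys–Murphy elements to Jucys–Murphy elements. [folklore] -/
theorem mapRingHom_jucysMurphy {k k' : Type*} [CommRing k] [CommRing k'] (φ : k →+* k')
    (i : Fin n) :
    MonoidAlgebra.mapRingHom (Perm (Fin n)) φ (jucysMurphy k i) = jucysMurphy k' i := by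
  simp [jucysMurphy, map_sum, MonoidAlgebra.of_apply]

/-- The polynomial `∏_{c=-i}^{i} (X - c)^N ∈ k[X]`. [folklore] -/
def jmAnnihilator (k : Type*) [CommRing k] (i N : ℕ) : k[X] :=
  ∏ c ∈ Finset.Icc (-(i : ℤ)) i, (X - C (c : k)) ^ N

/-- `jmAnnihilator` is compatible with base change. [folklore] -/
theorem jmAnnihilator_map {k k' : Type*} [CommRing k] [CommRing k'] (φ : k →+* k') (i N : ℕ) :
    (jmAnnihilator k i N).map φ = jmAnnihilator k' i N := by
  simp [jmAnnihilator, Polynomial.map_prod, Polynomial.map_pow, Polynomial.map_sub]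

/-- `dim_K K[S_n] = n!`. [folklore] -/
theorem finrank_monoidAlgebra_perm_eq_factorial (K : Type*) [Field K] :
    Module.finrank K (MonoidAlgebra K (Perm (Fin n))) = n.factorial := by
  rw [Module.finrank_eq_card_basis (MonoidAlgebra.basis (Perm (Fin n)) K), Fintype.card_perm,
    Fintype.card_fin]

/-- Over an algebraically closed field `K` (any characteristic), `∏_{|c| ≤ i} (L_i - c)^{n!} = 0` in
`K[S_n]`: the generalized eigenspaces of left multiplication by `L_i` exhaust `K[S_n]`
(Mathlib's `iSup_maxGenEigenspace_eq_top`), only integers `c` with `|c| ≤ i` occur as eigenvalues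
(`exists_int_of_hasEigenvalue_jucysMurphy`), and each generalized eigenspace is killed by
`(L_i - c)^{dim}`. [folklore] -/
theorem aeval_jucysMurphy_jmAnnihilator_of_isAlgClosed (K : Type*) [Field K] [IsAlgClosed K]
    (i : Fin n) :
    aeval (jucysMurphy K i) (jmAnnihilator K i n.factorial) = 0 := by
  classical
  set f : Module.End K (MonoidAlgebra K (Perm (Fin n))) := LinearMap.mulLeft K (jucysMurphy K i)
    with hf_def
  -- (1) the endomorphism `aeval f Q` vanishes
  have hf : aeval f (jmAnnihilator K i n.factorial) = 0 := by
    apply LinearMap.ext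
    intro v
    have hv : v ∈ ⨆ μ, f.maxGenEigenspace μ := by
      rw [Module.End.iSup_maxGenEigenspace_eq_top]; exact Submodule.mem_top
    rw [LinearMap.zero_apply]
    refine Submodule.iSup_induction (p := fun μ => f.maxGenEigenspace μ)
      (motive := fun v => aeval f (jmAnnihilator K i n.factorial) v = 0) hv ?_ (map_zero _) ?_
    · intro μ x hx
      by_cases hx0 : x = 0
      · rw [hx0, map_zero]
      -- `μ` is an eigenvalue, hence an integer `c`, `|c| ≤ i`
      have hμ : f.HasEigenvalue μ := by
        refine Module.End.hasEigenvalue_of_hasGenEigenvalue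
          (k := Module.finrank K (MonoidAlgebra K (Perm (Fin n)))) ?_
        rw [Module.End.HasGenEigenvalue, Module.End.HasUnifEigenvalue,
          ← Module.End.maxGenEigenspace_eq_genEigenspace_finrank, Submodule.ne_bot_iff]
        exact ⟨x, hx, hx0⟩
      obtain ⟨c, hc, hcμ⟩ := exists_int_of_hasEigenvalue_jucysMurphy K i μ hμ
      -- `x` is killed by `(f - μ)^{n!}`
      have hxk :
          ((f - μ • (1 : Module.End K (MonoidAlgebra K (Perm (Fin n))))) ^ n.factorial) x = 0 := by
        rw [Module.End.maxGenEigenspace_eq_genEigenspace_finrank, Module.End.genEigenspace_nat,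
          finrank_monoidAlgebra_perm_eq_factorial] at hx
        exact hx
      -- split off the factor `(X - C μ)^{n!}` of `Q`
      have hcmem : c ∈ Finset.Icc (-(i : ℤ)) i := by
        rw [Finset.mem_Icc]; exact abs_le.1 hc
      have hQ : jmAnnihilator K i n.factorial =
          (∏ c' ∈ (Finset.Icc (-(i : ℤ)) i).erase c, (X - C (c' : K)) ^ n.factorial) *
            (X - C (c : K)) ^ n.factorial := by
        rw [jmAnnihilator, Finset.prod_erase_mul _ _ hcmem]
      have hfac : aeval f ((X - C (c : K)) ^ n.factorial) x = 0 := by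
        rw [map_pow, map_sub, aeval_X, aeval_C, Algebra.algebraMap_eq_smul_one, hcμ]
        exact hxk
      rw [hQ, map_mul, Module.End.mul_apply, hfac, map_zero]
    · intro x y hx hy
      rw [map_add, hx, hy, add_zero]
  -- (2) evaluate at `1`
  have h1 : aeval f (jmAnnihilator K i n.factorial) 1 = 0 := by rw [hf, LinearMap.zero_apply]
  have hlmul : f = Algebra.lmul K _ (jucysMurphy K i) := rfl
  rw [hlmul, aeval_algHom_apply] at h1
  simpa using h1

/-- **`∏_{c=-i}^{i} (L_i - c)^{n!} = 0` in `ℤ[S_n]`** (descended from `ℚ̄[S_n]` along the injection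
`ℤ[S_n] ↪ ℚ̄[S_n]`): the integral form of Jucys's theorem that the eigenvalues of the Jucys–Murphy
element `L_i` are the contents `-i, …, i`. [folklore] -/
theorem aeval_jucysMurphy_jmAnnihilator_int (i : Fin n) :
    aeval (jucysMurphy ℤ i) (jmAnnihilator ℤ i n.factorial) = 0 := by
  let K := AlgebraicClosure ℚ
  haveI : CharZero K := charZero_of_injective_algebraMap (algebraMap ℚ K).injective
  have hinj : Function.Injective (MonoidAlgebra.mapRingHom (Perm (Fin n)) (Int.castRingHom K)) :=
    MonoidAlgebra.map_injective (Int.castRingHom K : ℤ →+ K) Int.cast_injective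
  apply hinj
  rw [map_zero, map_aeval_eq_aeval_map (R := ℤ) (S := MonoidAlgebra ℤ (Perm (Fin n))) (T := K)
    (U := MonoidAlgebra K (Perm (Fin n))) (φ := Int.castRingHom K)
    (ψ := MonoidAlgebra.mapRingHom (Perm (Fin n)) (Int.castRingHom K)) (RingHom.ext_int _ _),
    mapRingHom_jucysMurphy, jmAnnihilator_map]
  exact aeval_jucysMurphy_jmAnnihilator_of_isAlgClosed K i

/-- **`∏_{c=-i}^{i} (L_i - c)^{n!} = 0` in `k[S_n]` for every commutative ring `k`** (base change
of the integral identity). Over `𝔽_p` the distinct factors are indexed by the residues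
`c mod p ∈ I = ℤ/pℤ`: "the eigenvalues of each `L_m` lie in `I`" (Hu–Mathas 2010, §3.2).
[cite: HuMathas2010, §3.2 (eigenvalues of L_m, before Thm 24)] -/
theorem aeval_jucysMurphy_jmAnnihilator (k : Type*) [CommRing k] (i : Fin n) :
    aeval (jucysMurphy k i) (jmAnnihilator k i n.factorial) = 0 := by
  have h := congrArg (MonoidAlgebra.mapRingHom (Perm (Fin n)) (Int.castRingHom k))
    (aeval_jucysMurphy_jmAnnihilator_int i)
  rwa [map_zero, map_aeval_eq_aeval_map (R := ℤ) (S := MonoidAlgebra ℤ (Perm (Fin n))) (T := k)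
    (U := MonoidAlgebra k (Perm (Fin n))) (φ := Int.castRingHom k)
    (ψ := MonoidAlgebra.mapRingHom (Perm (Fin n)) (Int.castRingHom k)) (RingHom.ext_int _ _),
    mapRingHom_jucysMurphy, jmAnnihilator_map] at h


/-- Kernel of a product of powers of DISTINCT linear factors evaluated at an endomorphism: it is
covered by the maximal generalized eigenspaces of the roots (coprime factors,
`sup_ker_aeval_eq_ker_aeval_mul_of_coprime`). [folklore] -/
theorem ker_aeval_prod_X_sub_C_pow_le {k V : Type*} [Field k] [AddCommGroup V] [Module k V]
    (f : Module.End k V) (S : Finset k) (e : k → ℕ) :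
    LinearMap.ker (aeval f (∏ r ∈ S, (X - C r) ^ e r)) ≤ ⨆ r ∈ S, f.maxGenEigenspace r := by
  classical
  induction S using Finset.induction_on with
  | empty =>
    intro v hv
    rw [Finset.prod_empty, map_one, LinearMap.mem_ker, Module.End.one_apply] at hv
    rw [hv]
    exact Submodule.zero_mem _
  | insert a S haS ih =>
    have hcop : IsCoprime ((X - C a) ^ e a) (∏ r ∈ S, (X - C r) ^ e r) := by
      refine IsCoprime.prod_right fun r hr => IsCoprime.pow ?_
      have hne : a ≠ r := fun h => haS (h ▸ hr)
      exact pairwise_coprime_X_sub_C (s := fun x : k => x) (fun _ _ h => h) hne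
    rw [Finset.prod_insert haS, ← sup_ker_aeval_eq_ker_aeval_mul_of_coprime f hcop,
      Finset.iSup_insert]
    refine sup_le_sup ?_ ih
    intro v hv
    rw [LinearMap.mem_ker, map_pow, map_sub, aeval_X, aeval_C, Algebra.algebraMap_eq_smul_one] at hv
    exact (Module.End.mem_maxGenEigenspace f a v).2 ⟨e a, hv⟩

/-- **Over a field `k`, the generalized eigenspaces of `L_i` (acting on `k[S_n]` by left
multiplication) for the integer eigenvalues `c`, `|c| ≤ i`, exhaust `k[S_n]`** — for `k = 𝔽_p`:
`k[S_n] = ⊕_{r ∈ I} (k[S_n])_r` over the residues `r = c mod p`, the decomposition behind the KLR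
idempotents `e(𝐢)` (Hu–Mathas 2010, §3.2: `M = ⊕_{𝐢 ∈ I^n} M_𝐢` for every finite-dimensional
module `M`; here the regular module and one `L_i` at a time).
[cite: HuMathas2010, §3.2 (generalized eigenspaces M_𝐢, before Thm 24)] -/
theorem iSup_maxGenEigenspace_jucysMurphy_eq_top (k : Type*) [Field k] (i : Fin n) :
    ⨆ c ∈ Finset.Icc (-(i : ℤ)) i,
      Module.End.maxGenEigenspace (LinearMap.mulLeft k (jucysMurphy k i)) (c : k) = ⊤ := by
  classical
  set f : Module.End k (MonoidAlgebra k (Perm (Fin n))) := LinearMap.mulLeft k (jucysMurphy k i)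
    with hf_def
  set T : Finset ℤ := Finset.Icc (-(i : ℤ)) i with hT
  -- `aeval f Q = 0` for the annihilator `Q`, from the element identity
  have hfQ : aeval f (jmAnnihilator k i n.factorial) = 0 := by
    have hlmul : f = Algebra.lmul k _ (jucysMurphy k i) := rfl
    rw [hlmul, aeval_algHom_apply, aeval_jucysMurphy_jmAnnihilator, map_zero]
  -- regroup `Q` by distinct roots
  have hQ : jmAnnihilator k i n.factorial =
      ∏ r ∈ T.image (fun c : ℤ => (c : k)),
        (X - C r) ^ (n.factorial * (T.filter fun c : ℤ => (c : k) = r).card) := by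
    rw [jmAnnihilator, ← hT, ← Finset.prod_fiberwise_of_maps_to (g := fun c : ℤ => (c : k))
      (t := T.image fun c : ℤ => (c : k)) (fun c hc => Finset.mem_image_of_mem _ hc)]
    refine Finset.prod_congr rfl fun r _ => ?_
    rw [pow_mul, ← Finset.prod_const]
    refine Finset.prod_congr rfl fun c hc => ?_
    rw [(Finset.mem_filter.1 hc).2]
  -- conclude
  rw [eq_top_iff]
  calc (⊤ : Submodule k (MonoidAlgebra k (Perm (Fin n))))
      = LinearMap.ker (aeval f (jmAnnihilator k i n.factorial)) := by rw [hfQ, LinearMap.ker_zero]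
    _ ≤ ⨆ r ∈ T.image (fun c : ℤ => (c : k)), f.maxGenEigenspace r := by
        rw [hQ]; exact ker_aeval_prod_X_sub_C_pow_le f _ _
    _ = ⨆ c ∈ T, f.maxGenEigenspace (c : k) := Finset.iSup_finset_image

end SpectrumDescent


/-! ### The joint generalized eigenspaces `M_𝐢` and the KLR idempotents `e(𝐢)` (Hu–Mathas §3.2)

For the left regular module `M = k[S_n]` and the commuting family of left multiplications by
`L_0, …, L_{n-1}`: `M = ⊕_𝐢 M_𝐢` over `𝐢 : Fin n → k` (only integer-valued `𝐢` with `|i_r| ≤ r`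
contribute), the `M_𝐢` are right ideals, and the component of `1` in `M_𝐢` is an idempotent
`e(𝐢)` with `e(𝐢) v = ` the `M_𝐢`-component of `v`, `e(𝐢) e(𝐣) = δ_{𝐢𝐣} e(𝐢)`
(Hu–Mathas 2010, §3.2: "a system `{e(𝐢) | 𝐢 ∈ I^n}` of pairwise orthogonal idempotents such that
`M e(𝐢) = M_𝐢`"; here for left modules, which gives the same elements since they are polynomials
in the commuting `L_r`). -/

section JointSpectrum

open Equiv

variable (k : Type*) [Field k] {n : ℕ}

/-- The **joint generalized eigenspace** `M_𝐢 = {v ∈ k[S_n] | (L_r - i_r)^N v = 0 ∀ r}` of the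
Jucys–Murphy elements acting on `k[S_n]` by left multiplication (Hu–Mathas 2010, §3.2, `M_𝐢` for
the regular module). [cite: HuMathas2010, §3.2 (generalized eigenspaces M_𝐢, before Thm 24)] -/
def jointEigenspace (χ : Fin n → k) : Submodule k (MonoidAlgebra k (Perm (Fin n))) :=
  ⨅ r, Module.End.maxGenEigenspace (LinearMap.mulLeft k (jucysMurphy k r)) (χ r)

/-- Membership in `M_𝐢`: killed by a power of each `L_r - i_r`. [folklore] -/
theorem mem_jointEigenspace_iff (χ : Fin n → k) (v : MonoidAlgebra k (Perm (Fin n))) :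
    v ∈ jointEigenspace k χ ↔
      ∀ r, ∃ m : ℕ, ((LinearMap.mulLeft k (jucysMurphy k r) - χ r • 1) ^ m) v = 0 := by
  simp [jointEigenspace]

/-- The left multiplications by the Jucys–Murphy elements commute. [folklore] -/
theorem commute_mulLeft_jucysMurphy (r t : Fin n) :
    Commute (LinearMap.mulLeft k (jucysMurphy k r)) (LinearMap.mulLeft k (jucysMurphy k t)) := by
  change LinearMap.mulLeft k _ * LinearMap.mulLeft k _ = LinearMap.mulLeft k _ * LinearMap.mulLeft k _
  rw [Module.End.mul_eq_comp, Module.End.mul_eq_comp, ← LinearMap.mulLeft_mul,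
    ← LinearMap.mulLeft_mul, (commute_jucysMurphy k r t).eq]

/-- All generalized eigenspaces of `L_r` together exhaust `k[S_n]` (from the integer ones).
[folklore] -/
theorem iSup_maxGenEigenspace_jucysMurphy_eq_top' (r : Fin n) :
    ⨆ μ : k, Module.End.maxGenEigenspace (LinearMap.mulLeft k (jucysMurphy k r)) μ = ⊤ :=
  top_unique ((iSup_maxGenEigenspace_jucysMurphy_eq_top k r).symm.le.trans
    (iSup₂_le fun c _ => le_iSup
      (fun μ : k => Module.End.maxGenEigenspace (LinearMap.mulLeft k (jucysMurphy k r)) μ) (c : k)))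

/-- **`k[S_n] = ∑_𝐢 M_𝐢`**: the joint generalized eigenspaces of the Jucys–Murphy elements exhaust
`k[S_n]` (Hu–Mathas 2010, §3.2, `M = ⊕_{𝐢 ∈ I^n} M_𝐢`).
[cite: HuMathas2010, §3.2 (generalized eigenspaces M_𝐢, before Thm 24)] -/
theorem iSup_jointEigenspace_eq_top : ⨆ χ : Fin n → k, jointEigenspace k χ = ⊤ :=
  Module.End.iSup_iInf_maxGenEigenspace_eq_top_of_iSup_maxGenEigenspace_eq_top_of_commute _
    (fun r t _ => commute_mulLeft_jucysMurphy k r t) (iSup_maxGenEigenspace_jucysMurphy_eq_top' k)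

/-- **The `M_𝐢` are independent** (so `k[S_n] = ⊕_𝐢 M_𝐢`). [folklore] -/
theorem iSupIndep_jointEigenspace : iSupIndep (jointEigenspace k (n := n)) :=
  Module.End.independent_iInf_maxGenEigenspace_of_forall_mapsTo _ fun r t φ =>
    Module.End.mapsTo_maxGenEigenspace_of_comm (commute_mulLeft_jucysMurphy k t r) φ

/-- `M_𝐢` is a right ideal: stable under right multiplication (left and right multiplications
commute). [folklore] -/
theorem mul_mem_jointEigenspace {χ : Fin n → k} {v : MonoidAlgebra k (Perm (Fin n))}
    (hv : v ∈ jointEigenspace k χ) (a : MonoidAlgebra k (Perm (Fin n))) :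
    v * a ∈ jointEigenspace k χ := by
  simp only [jointEigenspace, Submodule.mem_iInf] at hv ⊢
  intro r
  exact Module.End.mapsTo_maxGenEigenspace_of_comm
    (LinearMap.commute_mulLeft_right (jucysMurphy k r) a) (χ r) (hv r)

/-- Only the integers `c`, `|c| ≤ r`, are generalized eigenvalues of `L_r`: for any other scalar
the generalized eigenspace vanishes. [folklore] -/
theorem maxGenEigenspace_jucysMurphy_eq_bot {r : Fin n} {μ : k}
    (hμ : ∀ c ∈ Finset.Icc (-(r : ℤ)) r, (c : k) ≠ μ) :
    Module.End.maxGenEigenspace (LinearMap.mulLeft k (jucysMurphy k r)) μ = ⊥ := by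
  have hdisj := (iSupIndep_def.1
    (Module.End.independent_maxGenEigenspace (LinearMap.mulLeft k (jucysMurphy k r)))) μ
  refine hdisj.eq_bot_of_le ?_
  calc Module.End.maxGenEigenspace (LinearMap.mulLeft k (jucysMurphy k r)) μ
      ≤ ⊤ := le_top
    _ = ⨆ c ∈ Finset.Icc (-(r : ℤ)) r,
          Module.End.maxGenEigenspace (LinearMap.mulLeft k (jucysMurphy k r)) (c : k) :=
        (iSup_maxGenEigenspace_jucysMurphy_eq_top k r).symm
    _ ≤ ⨆ (ν : k) (_ : ν ≠ μ),
          Module.End.maxGenEigenspace (LinearMap.mulLeft k (jucysMurphy k r)) ν :=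
        iSup₂_le fun c hc => le_iSup₂_of_le (c : k) (hμ c hc) le_rfl

/-- **`M_𝐢 = 0` unless `𝐢` is a sequence of integers `i_r` with `|i_r| ≤ r`** (in characteristic `p`:
unless `𝐢 ∈ I^n`, `I = ℤ/pℤ` — and then automatically). [folklore] -/
theorem jointEigenspace_eq_bot {χ : Fin n → k}
    (h : ∃ r : Fin n, ∀ c ∈ Finset.Icc (-(r : ℤ)) r, (c : k) ≠ χ r) : jointEigenspace k χ = ⊥ := by
  obtain ⟨r, hr⟩ := h
  rw [eq_bot_iff]
  exact (iInf_le _ r).trans (maxGenEigenspace_jucysMurphy_eq_bot k hr).le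

/-- `M_𝐢` and the sum of the other `M_𝐣` are complementary. [folklore] -/
theorem isCompl_jointEigenspace (χ : Fin n → k) :
    IsCompl (jointEigenspace k χ) (⨆ (χ' : Fin n → k) (_ : χ' ≠ χ), jointEigenspace k χ') := by
  refine ⟨(iSupIndep_def.1 (iSupIndep_jointEigenspace k)) χ, ?_⟩
  rw [codisjoint_iff, eq_top_iff, ← iSup_jointEigenspace_eq_top k]
  refine iSup_le fun χ' => ?_
  by_cases h : χ' = χ
  · subst h
    exact le_sup_left
  · exact le_sup_of_le_right (le_iSup₂_of_le χ' h le_rfl)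

/-- The sum of the `M_𝐣`, `𝐣 ≠ 𝐢`, is a right ideal too. [folklore] -/
theorem mul_mem_iSup_jointEigenspace_ne {χ : Fin n → k} {v : MonoidAlgebra k (Perm (Fin n))}
    (hv : v ∈ ⨆ (χ' : Fin n → k) (_ : χ' ≠ χ), jointEigenspace k χ')
    (a : MonoidAlgebra k (Perm (Fin n))) :
    v * a ∈ ⨆ (χ' : Fin n → k) (_ : χ' ≠ χ), jointEigenspace k χ' := by
  refine Submodule.iSup_induction (p := fun χ' => ⨆ (_ : χ' ≠ χ), jointEigenspace k χ')
    (motive := fun v => v * a ∈ ⨆ (χ' : Fin n → k) (_ : χ' ≠ χ), jointEigenspace k χ') hv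
    ?_ (by rw [zero_mul]; exact Submodule.zero_mem _) ?_
  · intro χ' x hx
    by_cases h : χ' = χ
    · subst h
      rw [iSup_neg (not_not.2 rfl), Submodule.mem_bot] at hx
      rw [hx, zero_mul]
      exact Submodule.zero_mem _
    · rw [iSup_pos h] at hx
      exact Submodule.mem_iSup_of_mem χ' (Submodule.mem_iSup_of_mem h (mul_mem_jointEigenspace k hx a))
  · intro x y hx hy
    rw [add_mul]
    exact Submodule.add_mem _ hx hy

/-- **The KLR idempotent `e(𝐢)`**: the component of `1` in `M_𝐢` along `⊕_{𝐣 ≠ 𝐢} M_𝐣`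
(Hu–Mathas 2010, §3.2; Brundan–Kleshchev). It is `0` unless `𝐢` is a residue sequence
(`jointEigenspace_eq_bot`). [cite: HuMathas2010, §3.2 (the idempotents e(𝐢), before Thm 24)] -/
def klrIdempotent (χ : Fin n → k) : MonoidAlgebra k (Perm (Fin n)) :=
  (jointEigenspace k χ).projection _ (isCompl_jointEigenspace k χ) 1

/-- `e(𝐢) ∈ M_𝐢`. [folklore] -/
theorem klrIdempotent_mem (χ : Fin n → k) : klrIdempotent k χ ∈ jointEigenspace k χ :=
  Submodule.coe_mem _

/-- `1 - e(𝐢) ∈ ⊕_{𝐣 ≠ 𝐢} M_𝐣`. [folklore] -/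
theorem one_sub_klrIdempotent_mem (χ : Fin n → k) :
    1 - klrIdempotent k χ ∈ ⨆ (χ' : Fin n → k) (_ : χ' ≠ χ), jointEigenspace k χ' :=
  Submodule.sub_projection_mem _ _

/-- **Left multiplication by `e(𝐢)` is the projection onto `M_𝐢`** along `⊕_{𝐣 ≠ 𝐢} M_𝐣` (both
are right ideals, so `v = e(𝐢) v + (1 - e(𝐢)) v` is the decomposition of `v`). [folklore] -/
theorem projection_jointEigenspace_apply (χ : Fin n → k) (v : MonoidAlgebra k (Perm (Fin n))) :
    (jointEigenspace k χ).projection _ (isCompl_jointEigenspace k χ) v = klrIdempotent k χ * v := by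
  have hsplit : v = klrIdempotent k χ * v + (1 - klrIdempotent k χ) * v := by
    rw [← add_mul, add_sub_cancel, one_mul]
  have h1 : (jointEigenspace k χ).projection _ (isCompl_jointEigenspace k χ)
      (klrIdempotent k χ * v) = klrIdempotent k χ * v :=
    (Submodule.projection_eq_self_iff _ _).2
      (mul_mem_jointEigenspace k (klrIdempotent_mem k χ) v)
  have h2 : (jointEigenspace k χ).projection _ (isCompl_jointEigenspace k χ)
      ((1 - klrIdempotent k χ) * v) = 0 :=
    (Submodule.projection_apply_eq_zero_iff _).2
      (mul_mem_iSup_jointEigenspace_ne k (one_sub_klrIdempotent_mem k χ) v)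
  conv_lhs => rw [hsplit]
  rw [map_add, h1, h2, add_zero]


/-- `e(𝐢) v = v` for `v ∈ M_𝐢`. [folklore] -/
theorem klrIdempotent_mul_of_mem {χ : Fin n → k} {v : MonoidAlgebra k (Perm (Fin n))}
    (hv : v ∈ jointEigenspace k χ) : klrIdempotent k χ * v = v := by
  rw [← projection_jointEigenspace_apply]
  exact (Submodule.projection_eq_self_iff _ _).2 hv

/-- `e(𝐢) v = 0` for `v ∈ M_𝐣`, `𝐣 ≠ 𝐢`. [folklore] -/
theorem klrIdempotent_mul_of_mem_ne {χ χ' : Fin n → k} (h : χ' ≠ χ)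
    {v : MonoidAlgebra k (Perm (Fin n))} (hv : v ∈ jointEigenspace k χ') :
    klrIdempotent k χ * v = 0 := by
  rw [← projection_jointEigenspace_apply]
  exact (Submodule.projection_apply_eq_zero_iff _).2
    (Submodule.mem_iSup_of_mem χ' (Submodule.mem_iSup_of_mem h hv))

/-- **`e(𝐢)² = e(𝐢)`.** [cite: HuMathas2010, §3.2 (the idempotents e(𝐢), before Thm 24)] -/
theorem klrIdempotent_mul_self (χ : Fin n → k) :
    klrIdempotent k χ * klrIdempotent k χ = klrIdempotent k χ :=
  klrIdempotent_mul_of_mem k (klrIdempotent_mem k χ)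

/-- **`e(𝐢) e(𝐣) = 0` for `𝐢 ≠ 𝐣`** (pairwise orthogonal).
[cite: HuMathas2010, §3.2 (the idempotents e(𝐢), before Thm 24)] -/
theorem klrIdempotent_mul_klrIdempotent_of_ne {χ χ' : Fin n → k} (h : χ ≠ χ') :
    klrIdempotent k χ * klrIdempotent k χ' = 0 :=
  klrIdempotent_mul_of_mem_ne k (Ne.symm h) (klrIdempotent_mem k χ')

/-- `e(𝐢) = 0` unless `𝐢` is a sequence of integers `i_r`, `|i_r| ≤ r` ("all but finitely many of
the `e(𝐢)` are zero", Hu–Mathas 2010, §3.2). [folklore] -/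
theorem klrIdempotent_eq_zero {χ : Fin n → k}
    (h : ∃ r : Fin n, ∀ c ∈ Finset.Icc (-(r : ℤ)) r, (c : k) ≠ χ r) : klrIdempotent k χ = 0 := by
  have hmem := klrIdempotent_mem k χ
  rwa [jointEigenspace_eq_bot k h, Submodule.mem_bot] at hmem

/-- **`M_𝐢 = e(𝐢) k[S_n]`**: `v ∈ M_𝐢 ↔ e(𝐢) v = v` (Hu–Mathas 2010, §3.2, `M e(𝐢) = M_𝐢`, left
version). [cite: HuMathas2010, §3.2 (the idempotents e(𝐢), before Thm 24)] -/
theorem mem_jointEigenspace_iff_klrIdempotent_mul (χ : Fin n → k)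
    (v : MonoidAlgebra k (Perm (Fin n))) :
    v ∈ jointEigenspace k χ ↔ klrIdempotent k χ * v = v :=
  ⟨klrIdempotent_mul_of_mem k, fun h => h ▸ mul_mem_jointEigenspace k (klrIdempotent_mem k χ) v⟩

/-- `∑_𝐢 e(𝐢) v = v`, summing over any finite set of indices containing all `𝐢` with `M_𝐢 ≠ 0`.
[folklore] -/
theorem sum_klrIdempotent_mul (S : Finset (Fin n → k))
    (hS : ∀ χ, jointEigenspace k χ ≠ ⊥ → χ ∈ S) (v : MonoidAlgebra k (Perm (Fin n))) :
    ∑ χ ∈ S, klrIdempotent k χ * v = v := by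
  classical
  have hv : v ∈ ⨆ χ : Fin n → k, jointEigenspace k χ := by
    rw [iSup_jointEigenspace_eq_top]; exact Submodule.mem_top
  refine Submodule.iSup_induction (p := jointEigenspace k)
    (motive := fun v => ∑ χ ∈ S, klrIdempotent k χ * v = v) hv ?_ ?_ ?_
  · intro χ₀ x hx
    by_cases h0 : χ₀ ∈ S
    · rw [Finset.sum_eq_single_of_mem χ₀ h0 fun χ _ hne => klrIdempotent_mul_of_mem_ne k hne.symm hx]
      exact klrIdempotent_mul_of_mem k hx
    · have hbot : jointEigenspace k χ₀ = ⊥ := by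
        by_contra hne
        exact h0 (hS χ₀ hne)
      rw [hbot, Submodule.mem_bot] at hx
      simp [hx]
  · simp
  · intro x y hx hy
    simp only [mul_add, Finset.sum_add_distrib, hx, hy]

/-- **`∑_𝐢 e(𝐢) = 1`** over any finite set of indices containing all `𝐢` with `M_𝐢 ≠ 0`
(Hu–Mathas 2010, §3.2: "their sum is the identity").
[cite: HuMathas2010, §3.2 (the idempotents e(𝐢), before Thm 24)] -/
theorem sum_klrIdempotent (S : Finset (Fin n → k)) (hS : ∀ χ, jointEigenspace k χ ≠ ⊥ → χ ∈ S) :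
    ∑ χ ∈ S, klrIdempotent k χ = 1 := by
  have h := sum_klrIdempotent_mul k S hS 1
  simpa using h

/-- The finite set of candidate residue sequences `𝐢 = (i_0, …, i_{n-1})`, `i_r ∈ {-r, …, r} · 1_k`
(for `k = 𝔽_p` and `n ≥ p`: all of `I^n`). [folklore] -/
def residueSeqs [DecidableEq k] (n : ℕ) : Finset (Fin n → k) :=
  Fintype.piFinset fun r : Fin n => (Finset.Icc (-(r : ℤ)) r).image fun c : ℤ => (c : k)

/-- Every `𝐢` with `M_𝐢 ≠ 0` is a candidate residue sequence. [folklore] -/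
theorem mem_residueSeqs_of_ne_bot [DecidableEq k] {χ : Fin n → k} (h : jointEigenspace k χ ≠ ⊥) :
    χ ∈ residueSeqs k n := by
  rw [residueSeqs, Fintype.mem_piFinset]
  intro r
  by_contra hr
  apply h
  refine jointEigenspace_eq_bot k ⟨r, fun c hc hcr => hr ?_⟩
  exact Finset.mem_image.2 ⟨c, hc, hcr⟩

/-- **`1 = ∑_{𝐢 ∈ I^n} e(𝐢)`** summed over the candidate residue sequences.
[cite: HuMathas2010, §3.2 (the idempotents e(𝐢), before Thm 24)] -/
theorem sum_residueSeqs_klrIdempotent [DecidableEq k] :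
    ∑ χ ∈ residueSeqs k n, klrIdempotent k χ = 1 :=
  sum_klrIdempotent k _ fun _ h => mem_residueSeqs_of_ne_bot k h

end JointSpectrum


/-! ### Generalized eigenvectors of sums and products of commuting operators

Linear algebra for the `s_r`-stability of the content classes: a common generalized eigenvector of
two commuting operators `f`, `g` (eigenvalues `a`, `b`) is a generalized eigenvector of `f + g` and
of `f g` (eigenvalues `a + b`, `a b`). -/

section CommutingOperators

variable {K V : Type*} [Field K] [AddCommGroup V] [Module K V]

/-- If `F`, `G` commute, `F^a v = 0` and `G^b v = 0`, then `(F + G)^{a+b} v = 0` (binomial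
theorem). [folklore] -/
theorem pow_add_apply_eq_zero_of_commute {F G : Module.End K V} (h : Commute F G) {v : V}
    {a b : ℕ} (hF : (F ^ a) v = 0) (hG : (G ^ b) v = 0) : ((F + G) ^ (a + b)) v = 0 := by
  rw [h.add_pow, LinearMap.sum_apply]
  refine Finset.sum_eq_zero fun m _ => ?_
  rw [Module.End.mul_apply, Module.End.mul_apply, Module.End.natCast_apply, map_nsmul, map_nsmul]
  suffices hz : (F ^ m) ((G ^ (a + b - m)) v) = 0 by rw [hz, smul_zero]
  by_cases hma : a ≤ m
  · have hc : (F ^ m) ((G ^ (a + b - m)) v) = (G ^ (a + b - m)) ((F ^ m) v) := by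
      rw [← Module.End.mul_apply, (h.pow_pow m (a + b - m)).eq, Module.End.mul_apply]
    rw [hc, ← pow_sub_mul_pow F hma, Module.End.mul_apply, hF, map_zero, map_zero]
  · have hmb : b ≤ a + b - m := by omega
    rw [← pow_sub_mul_pow G hmb, Module.End.mul_apply, hG, map_zero, map_zero]

/-- `f - a` and `g - b` commute when `f` and `g` do. [folklore] -/
theorem commute_sub_smul_one {f g : Module.End K V} (h : Commute f g) (a b : K) :
    Commute (f - a • (1 : Module.End K V)) (g - b • (1 : Module.End K V)) := by
  rw [← Algebra.algebraMap_eq_smul_one, ← Algebra.algebraMap_eq_smul_one]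
  exact (h.sub_right (Algebra.commute_algebraMap_right b f)).sub_left
    ((Algebra.commute_algebraMap_left a g).sub_right (Algebra.commute_algebraMap_left a _))

/-- **A common generalized eigenvector of commuting `f`, `g` (eigenvalues `a`, `b`) is a generalized
eigenvector of `f + g` with eigenvalue `a + b`.** [folklore] -/
theorem mem_maxGenEigenspace_add_of_commute {f g : Module.End K V} (h : Commute f g) {a b : K}
    {v : V} (hf : v ∈ f.maxGenEigenspace a) (hg : v ∈ g.maxGenEigenspace b) :
    v ∈ (f + g).maxGenEigenspace (a + b) := by
  rw [Module.End.mem_maxGenEigenspace] at hf hg ⊢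
  obtain ⟨kf, hkf⟩ := hf
  obtain ⟨kg, hkg⟩ := hg
  refine ⟨kf + kg, ?_⟩
  have hsum : f + g - (a + b) • (1 : Module.End K V) = (f - a • 1) + (g - b • 1) := by
    rw [add_smul]; abel
  rw [hsum]
  exact pow_add_apply_eq_zero_of_commute (commute_sub_smul_one h a b) hkf hkg

/-- **A common generalized eigenvector of commuting `f`, `g` (eigenvalues `a`, `b`) is a generalized
eigenvector of `f g` with eigenvalue `a b`** (finite-dimensional `V`). [folklore] -/
theorem mem_maxGenEigenspace_mul_of_commute [FiniteDimensional K V] {f g : Module.End K V}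
    (h : Commute f g) {a b : K} {v : V} (hf : v ∈ f.maxGenEigenspace a)
    (hg : v ∈ g.maxGenEigenspace b) : v ∈ (f * g).maxGenEigenspace (a * b) := by
  obtain ⟨kg, hkg⟩ := (Module.End.mem_maxGenEigenspace _ _ _).1 hg
  set N := Module.finrank K V with hN
  -- `F = (f - a) g`, `G = a (g - b)`; `F + G = f g - a b`
  set F : Module.End K V := (f - a • 1) * g with hF
  set G : Module.End K V := a • (g - b • 1) with hG
  have hsum : f * g - (a * b) • (1 : Module.End K V) = F + G := by
    simp only [hF, hG, sub_mul, smul_sub, smul_smul, smul_mul_assoc, one_mul]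
    abel
  have hFG : Commute F G := by
    refine Commute.smul_right (Commute.mul_left (commute_sub_smul_one h a b) ?_) a
    exact (Commute.refl g).sub_right ((Commute.one_right g).smul_right b)
  -- `F^N v = 0`: `g^N v ∈ maxGenEigenspace f a = ker (f - a)^N`
  have hFN : (F ^ N) v = 0 := by
    have hc : Commute (f - a • (1 : Module.End K V)) g :=
      (h.sub_left ((Commute.one_left g).smul_left a))
    rw [hF, hc.mul_pow, Module.End.mul_apply]
    have hgN : (g ^ N) v ∈ f.maxGenEigenspace a :=
      Module.End.mapsTo_maxGenEigenspace_of_comm (h.pow_right N) a hf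
    rw [Module.End.maxGenEigenspace_eq_genEigenspace_finrank, Module.End.genEigenspace_nat,
      LinearMap.mem_ker] at hgN
    exact hgN
  -- `G^kg v = 0`
  have hGk : (G ^ kg) v = 0 := by
    rw [hG, smul_pow, LinearMap.smul_apply, hkg, smul_zero]
  rw [Module.End.mem_maxGenEigenspace]
  exact ⟨N + kg, by rw [hsum]; exact pow_add_apply_eq_zero_of_commute hFG hFN hGk⟩

end CommutingOperators


/-! ### `s_r M_𝐢 ⊆ M_𝐢 ⊕ M_{s_r 𝐢}`: the simple transpositions and the joint eigenspaces

The simple transposition `s_r = (r, r+1)` commutes with `L_t` (`t ≠ r, r+1`), with `L_r + L_{r+1}`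
and with `L_r L_{r+1}` (degenerate Hecke relations), hence preserves the joint generalized eigenspace
`W` of these operators; and `W` meets `M_𝐣` only for `𝐣 ∈ {𝐢, s_r 𝐢}` (the unordered pair
`{j_r, j_{r+1}}` is determined by its sum and product). This is the mechanism making the residue
CONTENT classes `⊕_{cont 𝐢 = α} M_𝐢` two-sided ideals (the blocks `e_α k[S_n]`). -/

section TranspositionStability

open Equiv

variable (k : Type*) [Field k] {n : ℕ}

/-- `s_r (L_r + L_{r+1}) = (L_r + L_{r+1}) s_r`. [folklore] -/
theorem of_swap_mul_jucysMurphy_add {r r' : Fin n} (h : (r' : ℕ) = r + 1) :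
    MonoidAlgebra.of k _ (swap r r') * (jucysMurphy k r + jucysMurphy k r') =
      (jucysMurphy k r + jucysMurphy k r') * MonoidAlgebra.of k _ (swap r r') := by
  have h1 : MonoidAlgebra.of k _ (swap r r') * jucysMurphy k r =
      jucysMurphy k r' * MonoidAlgebra.of k _ (swap r r') - 1 := by
    rw [jucysMurphy_succ_mul_swap k h, add_sub_cancel_right]
  rw [mul_add, add_mul, h1, of_swap_mul_jucysMurphy_succ k h]
  abel

/-- `s_r (L_r L_{r+1}) = (L_r L_{r+1}) s_r`. [folklore] -/
theorem of_swap_mul_jucysMurphy_mul {r r' : Fin n} (h : (r' : ℕ) = r + 1) :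
    MonoidAlgebra.of k _ (swap r r') * (jucysMurphy k r * jucysMurphy k r') =
      (jucysMurphy k r * jucysMurphy k r') * MonoidAlgebra.of k _ (swap r r') := by
  have h1 : MonoidAlgebra.of k _ (swap r r') * jucysMurphy k r =
      jucysMurphy k r' * MonoidAlgebra.of k _ (swap r r') - 1 := by
    rw [jucysMurphy_succ_mul_swap k h, add_sub_cancel_right]
  rw [← mul_assoc, h1, sub_mul, one_mul, mul_assoc, of_swap_mul_jucysMurphy_succ k h, mul_add,
    mul_one, add_sub_cancel_right, ← mul_assoc, (commute_jucysMurphy k r' r).eq]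

/-- Commuting elements give commuting left multiplications. [folklore] -/
theorem commute_mulLeft_of_mul_eq {a b : MonoidAlgebra k (Perm (Fin n))} (h : a * b = b * a) :
    Commute (LinearMap.mulLeft k a) (LinearMap.mulLeft k b) := by
  change LinearMap.mulLeft k _ * LinearMap.mulLeft k _ = LinearMap.mulLeft k _ * LinearMap.mulLeft k _
  rw [Module.End.mul_eq_comp, Module.End.mul_eq_comp, ← LinearMap.mulLeft_mul,
    ← LinearMap.mulLeft_mul, h]

/-- `mulLeft` is additive. [folklore] -/
theorem mulLeft_add_eq (a b : MonoidAlgebra k (Perm (Fin n))) :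
    LinearMap.mulLeft k (a + b) = LinearMap.mulLeft k a + LinearMap.mulLeft k b :=
  map_add (Algebra.lmul k (MonoidAlgebra k (Perm (Fin n)))) a b

/-- `mulLeft` is multiplicative. [folklore] -/
theorem mulLeft_mul_eq (a b : MonoidAlgebra k (Perm (Fin n))) :
    LinearMap.mulLeft k (a * b) = LinearMap.mulLeft k a * LinearMap.mulLeft k b :=
  map_mul (Algebra.lmul k (MonoidAlgebra k (Perm (Fin n)))) a b

/-- The auxiliary space `W`: joint generalized eigenspace of `L_t` (`t ≠ r, r'`), `L_r + L_{r'}`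
and `L_r L_{r'}` for the eigenvalues read off from `𝐢`. [folklore] -/
def symmEigenspace (χ : Fin n → k) (r r' : Fin n) :
    Submodule k (MonoidAlgebra k (Perm (Fin n))) :=
  (⨅ (t : Fin n) (_ : t ≠ r ∧ t ≠ r'),
      Module.End.maxGenEigenspace (LinearMap.mulLeft k (jucysMurphy k t)) (χ t)) ⊓
    Module.End.maxGenEigenspace
      (LinearMap.mulLeft k (jucysMurphy k r + jucysMurphy k r')) (χ r + χ r') ⊓
    Module.End.maxGenEigenspace
      (LinearMap.mulLeft k (jucysMurphy k r * jucysMurphy k r')) (χ r * χ r')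

/-- `M_𝐢 ⊆ W`. [folklore] -/
theorem jointEigenspace_le_symmEigenspace (χ : Fin n → k) (r r' : Fin n) :
    jointEigenspace k χ ≤ symmEigenspace k χ r r' := by
  intro v hv
  have hv' : ∀ t, v ∈ Module.End.maxGenEigenspace (LinearMap.mulLeft k (jucysMurphy k t)) (χ t) :=
    fun t => (Submodule.mem_iInf _).1 hv t
  refine ⟨⟨(Submodule.mem_iInf _).2 fun t => (Submodule.mem_iInf _).2 fun _ => hv' t, ?_⟩, ?_⟩
  · rw [mulLeft_add_eq]
    exact mem_maxGenEigenspace_add_of_commute (commute_mulLeft_jucysMurphy k r r') (hv' r) (hv' r')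
  · rw [mulLeft_mul_eq]
    exact mem_maxGenEigenspace_mul_of_commute (commute_mulLeft_jucysMurphy k r r') (hv' r) (hv' r')

/-- `W` is stable under left multiplication by any element commuting with `L_t` (`t ≠ r, r'`),
`L_r + L_{r'}` and `L_r L_{r'}`. [folklore] -/
theorem mul_mem_symmEigenspace {χ : Fin n → k} {r r' : Fin n} {a : MonoidAlgebra k (Perm (Fin n))}
    (ht : ∀ t, t ≠ r → t ≠ r' → a * jucysMurphy k t = jucysMurphy k t * a)
    (hadd : a * (jucysMurphy k r + jucysMurphy k r') = (jucysMurphy k r + jucysMurphy k r') * a)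
    (hmul : a * (jucysMurphy k r * jucysMurphy k r') = (jucysMurphy k r * jucysMurphy k r') * a)
    {w : MonoidAlgebra k (Perm (Fin n))} (hw : w ∈ symmEigenspace k χ r r') :
    a * w ∈ symmEigenspace k χ r r' := by
  obtain ⟨⟨h1, h2⟩, h3⟩ := hw
  refine ⟨⟨(Submodule.mem_iInf _).2 fun t => (Submodule.mem_iInf _).2 fun htt => ?_, ?_⟩, ?_⟩
  · have h1t := (Submodule.mem_iInf _).1 ((Submodule.mem_iInf _).1 h1 t) htt
    exact Module.End.mapsTo_maxGenEigenspace_of_comm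
      (commute_mulLeft_of_mul_eq k (ht t htt.1 htt.2)).symm (χ t) h1t
  · exact Module.End.mapsTo_maxGenEigenspace_of_comm (commute_mulLeft_of_mul_eq k hadd).symm _ h2
  · exact Module.End.mapsTo_maxGenEigenspace_of_comm (commute_mulLeft_of_mul_eq k hmul).symm _ h3

/-- **`s_r W ⊆ W`.** [folklore] -/
theorem of_swap_mul_mem_symmEigenspace {χ : Fin n → k} {r r' : Fin n} (h : (r' : ℕ) = r + 1)
    {w : MonoidAlgebra k (Perm (Fin n))} (hw : w ∈ symmEigenspace k χ r r') :
    MonoidAlgebra.of k _ (swap r r') * w ∈ symmEigenspace k χ r r' :=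
  mul_mem_symmEigenspace k (fun _ h1 h2 => of_swap_mul_jucysMurphy_of_ne k h h1 h2)
    (of_swap_mul_jucysMurphy_add k h) (of_swap_mul_jucysMurphy_mul k h) hw

/-- `M_𝐢` is stable under left multiplication by the `L_t`. [folklore] -/
theorem jucysMurphy_mul_mem_jointEigenspace {χ : Fin n → k} (t : Fin n)
    {v : MonoidAlgebra k (Perm (Fin n))} (hv : v ∈ jointEigenspace k χ) :
    jucysMurphy k t * v ∈ jointEigenspace k χ := by
  simp only [jointEigenspace, Submodule.mem_iInf] at hv ⊢
  intro r
  exact Module.End.mapsTo_maxGenEigenspace_of_comm (commute_mulLeft_jucysMurphy k r t) (χ r) (hv r)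

/-- **The Jucys–Murphy elements commute with the KLR idempotents**, `L_t e(𝐢) = e(𝐢) L_t` (both
`M_𝐢` and `⊕_{𝐣 ≠ 𝐢} M_𝐣` are `L_t`-stable, so `L_t = L_t e(𝐢) + L_t (1 - e(𝐢))` is the
decomposition of `L_t`). [folklore] -/
theorem jucysMurphy_mul_klrIdempotent (t : Fin n) (χ : Fin n → k) :
    jucysMurphy k t * klrIdempotent k χ = klrIdempotent k χ * jucysMurphy k t := by
  have hsplit : jucysMurphy k t =
      jucysMurphy k t * klrIdempotent k χ + jucysMurphy k t * (1 - klrIdempotent k χ) := by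
    rw [← mul_add, add_sub_cancel, mul_one]
  have hq : jucysMurphy k t * (1 - klrIdempotent k χ) ∈
      ⨆ (χ' : Fin n → k) (_ : χ' ≠ χ), jointEigenspace k χ' := by
    refine Submodule.iSup_induction (p := fun χ' => ⨆ (_ : χ' ≠ χ), jointEigenspace k χ')
      (motive := fun v => jucysMurphy k t * v ∈ ⨆ (χ' : Fin n → k) (_ : χ' ≠ χ), jointEigenspace k χ')
      (one_sub_klrIdempotent_mem k χ) ?_ (by rw [mul_zero]; exact Submodule.zero_mem _) ?_
    · intro χ' x hx
      by_cases hc : χ' = χ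
      · subst hc
        rw [iSup_neg (not_not.2 rfl), Submodule.mem_bot] at hx
        rw [hx, mul_zero]
        exact Submodule.zero_mem _
      · rw [iSup_pos hc] at hx
        exact Submodule.mem_iSup_of_mem χ'
          (Submodule.mem_iSup_of_mem hc (jucysMurphy_mul_mem_jointEigenspace k t hx))
    · intro x y hx hy
      rw [mul_add]
      exact Submodule.add_mem _ hx hy
  have hp : jucysMurphy k t * klrIdempotent k χ ∈ jointEigenspace k χ :=
    jucysMurphy_mul_mem_jointEigenspace k t (klrIdempotent_mem k χ)
  -- the projection of `L_t` onto `M_𝐢` is `L_t e(𝐢)`; it is also `e(𝐢) L_t`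
  have hproj := projection_jointEigenspace_apply k χ (jucysMurphy k t)
  conv_lhs at hproj => rw [hsplit]
  rw [map_add, (Submodule.projection_eq_self_iff _ _).2 hp,
    (Submodule.projection_apply_eq_zero_iff _).2 hq, add_zero] at hproj
  exact hproj

/-- `e(𝐣) W ⊆ W` (the `e(𝐣)` commute with the `L_t`). [folklore] -/
theorem klrIdempotent_mul_mem_symmEigenspace {χ : Fin n → k} {r r' : Fin n} (χ' : Fin n → k)
    {w : MonoidAlgebra k (Perm (Fin n))} (hw : w ∈ symmEigenspace k χ r r') :
    klrIdempotent k χ' * w ∈ symmEigenspace k χ r r' := by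
  refine mul_mem_symmEigenspace k (fun t _ _ => (jucysMurphy_mul_klrIdempotent k t χ').symm) ?_ ?_ hw
  · rw [mul_add, add_mul, jucysMurphy_mul_klrIdempotent, jucysMurphy_mul_klrIdempotent]
  · rw [← mul_assoc, ← jucysMurphy_mul_klrIdempotent, mul_assoc, ← jucysMurphy_mul_klrIdempotent,
      mul_assoc]

/-- Two generalized eigenvalues of one operator with a common nonzero generalized eigenvector are
equal. [folklore] -/
theorem eq_of_mem_maxGenEigenspace {f : Module.End k (MonoidAlgebra k (Perm (Fin n)))} {a b : k}
    {u : MonoidAlgebra k (Perm (Fin n))} (ha : u ∈ f.maxGenEigenspace a)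
    (hb : u ∈ f.maxGenEigenspace b) (hu : u ≠ 0) : a = b := by
  by_contra hab
  have hd := (Module.End.independent_maxGenEigenspace f).pairwiseDisjoint hab
  exact hu ((Submodule.disjoint_def.1 hd) u ha hb)

/-- **`W ∩ M_𝐣 = 0` unless `𝐣 ∈ {𝐢, s_r 𝐢}`.** [folklore] -/
theorem eq_or_eq_swap_of_mem_symmEigenspace {χ χ' : Fin n → k} {r r' : Fin n} (hrr' : r ≠ r')
    {u : MonoidAlgebra k (Perm (Fin n))} (hu : u ∈ symmEigenspace k χ r r')
    (hu' : u ∈ jointEigenspace k χ') (hu0 : u ≠ 0) : χ' = χ ∨ χ' = χ ∘ swap r r' := by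
  obtain ⟨⟨h1, h2⟩, h3⟩ := hu
  have hu't : ∀ t, u ∈ Module.End.maxGenEigenspace (LinearMap.mulLeft k (jucysMurphy k t)) (χ' t) :=
    fun t => (Submodule.mem_iInf _).1 hu' t
  -- coordinates `t ≠ r, r'` agree
  have ht : ∀ t, t ≠ r → t ≠ r' → χ' t = χ t := by
    intro t h1t h2t
    have hW := (Submodule.mem_iInf _).1 ((Submodule.mem_iInf _).1 h1 t) ⟨h1t, h2t⟩
    exact eq_of_mem_maxGenEigenspace k (hu't t) hW hu0
  -- sum and product agree
  have hsum : χ' r + χ' r' = χ r + χ r' := by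
    have hm : u ∈ Module.End.maxGenEigenspace
        (LinearMap.mulLeft k (jucysMurphy k r + jucysMurphy k r')) (χ' r + χ' r') := by
      rw [mulLeft_add_eq]
      exact mem_maxGenEigenspace_add_of_commute (commute_mulLeft_jucysMurphy k r r')
        (hu't r) (hu't r')
    exact eq_of_mem_maxGenEigenspace k hm h2 hu0
  have hprod : χ' r * χ' r' = χ r * χ r' := by
    have hm : u ∈ Module.End.maxGenEigenspace
        (LinearMap.mulLeft k (jucysMurphy k r * jucysMurphy k r')) (χ' r * χ' r') := by
      rw [mulLeft_mul_eq]
      exact mem_maxGenEigenspace_mul_of_commute (commute_mulLeft_jucysMurphy k r r')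
        (hu't r) (hu't r')
    exact eq_of_mem_maxGenEigenspace k hm h3 hu0
  -- `{χ' r, χ' r'} = {χ r, χ r'}`
  have hquad : (χ' r - χ r) * (χ' r - χ r') = 0 := by
    have e : χ' r' = χ r + χ r' - χ' r := by rw [← hsum]; ring
    rw [e] at hprod
    linear_combination (-1 : k) * hprod
  rcases mul_eq_zero.1 hquad with h0 | h0
  · left
    have hr : χ' r = χ r := sub_eq_zero.1 h0
    have hr' : χ' r' = χ r' := by rw [hr] at hsum; exact add_left_cancel hsum
    funext t
    by_cases h1t : t = r
    · subst h1t; exact hr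
    by_cases h2t : t = r'
    · subst h2t; exact hr'
    exact ht t h1t h2t
  · right
    have hr : χ' r = χ r' := sub_eq_zero.1 h0
    have hr' : χ' r' = χ r := by rw [hr, add_comm] at hsum; exact add_right_cancel hsum
    funext t
    simp only [Function.comp_apply]
    by_cases h1t : t = r
    · subst h1t; rw [swap_apply_left]; exact hr
    by_cases h2t : t = r'
    · subst h2t; rw [swap_apply_right]; exact hr'
    rw [swap_apply_of_ne_of_ne h1t h2t]
    exact ht t h1t h2t

/-- **`W ⊆ M_𝐢 ⊕ M_{s_r 𝐢}`.** [folklore] -/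
theorem symmEigenspace_le {χ : Fin n → k} {r r' : Fin n} (hrr' : r ≠ r') :
    symmEigenspace k χ r r' ≤ jointEigenspace k χ ⊔ jointEigenspace k (χ ∘ swap r r') := by
  classical
  intro w hw
  rw [← sum_klrIdempotent_mul k (residueSeqs k n) (fun _ h => mem_residueSeqs_of_ne_bot k h) w]
  refine Submodule.sum_mem _ fun χ' _ => ?_
  have hW : klrIdempotent k χ' * w ∈ symmEigenspace k χ r r' :=
    klrIdempotent_mul_mem_symmEigenspace k χ' hw
  have hM : klrIdempotent k χ' * w ∈ jointEigenspace k χ' := by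
    rw [← projection_jointEigenspace_apply]
    exact Submodule.coe_mem _
  by_cases h0 : klrIdempotent k χ' * w = 0
  · rw [h0]; exact Submodule.zero_mem _
  rcases eq_or_eq_swap_of_mem_symmEigenspace k hrr' hW hM h0 with h | h
  · subst h; exact Submodule.mem_sup_left hM
  · subst h; exact Submodule.mem_sup_right hM

/-- **`s_r M_𝐢 ⊆ M_𝐢 ⊕ M_{s_r 𝐢}`** for the simple transposition `s_r = (r, r+1)`: the joint
generalized eigenspaces of the Jucys–Murphy elements are permuted, up to the diagonal term, by the
simple transpositions (the content of Brundan–Kleshchev's / Hu–Mathas's relations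
`ψ_r e(𝐢) = e(s_r 𝐢) ψ_r` at the level of subspaces). [folklore] -/
theorem of_swap_mul_mem_sup_jointEigenspace {χ : Fin n → k} {r r' : Fin n} (h : (r' : ℕ) = r + 1)
    {v : MonoidAlgebra k (Perm (Fin n))} (hv : v ∈ jointEigenspace k χ) :
    MonoidAlgebra.of k _ (swap r r') * v ∈
      jointEigenspace k χ ⊔ jointEigenspace k (χ ∘ swap r r') := by
  have hrr' : r ≠ r' := by
    intro e; rw [Fin.ext_iff] at e; omega
  exact symmEigenspace_le k hrr'
    (of_swap_mul_mem_symmEigenspace k h (jointEigenspace_le_symmEigenspace k χ r r' hv))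

end TranspositionStability


/-! ### The residue-content classes `k[S_n]_α = ⊕_{cont 𝐢 = α} M_𝐢` are two-sided ideals

With `cont 𝐢 : k → ℕ` the content (number of occurrences of each scalar) of a sequence `𝐢`, the
sum `k[S_n]_α` of the `M_𝐢` of content `α` is a right ideal (each `M_𝐢` is), stable under left
multiplication by the `L_t` and — by `s_r M_𝐢 ⊆ M_𝐢 ⊕ M_{s_r 𝐢}` and `cont (s_r 𝐢) = cont 𝐢` — by
the simple transpositions, which generate `S_n`: so it is a two-sided ideal, and distinct classes
are orthogonal (`k[S_n]_α k[S_n]_{α'} ⊆ k[S_n]_α ∩ k[S_n]_{α'} = 0`). These are the algebras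
`e_α k[S_n]` of content `α` (Hu–Mathas 2010, §3.1–3.2: `R_n^Λ = ⊕_α R_α^Λ`, `e_α = ∑_{𝐢 ∈ I^α} e(𝐢)`;
for `k = 𝔽_p` the `p`-blocks by Nakayama's conjecture, which is NOT proved or used here). -/

section SeqContent

open Equiv

variable (k : Type*) [DecidableEq k] {n : ℕ}

/-- The content of a sequence `𝐢 : Fin n → k`: `x ↦ #{r | i_r = x}`. For the residue sequence of a
standard tableau of shape `μ` this is the residue content of `μ` (`TableauPair.content`).
[folklore] -/
def seqContent (χ : Fin n → k) : k → ℕ :=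
  fun x => (Finset.univ.filter fun r : Fin n => χ r = x).card

/-- The content is invariant under permuting the sequence. [folklore] -/
theorem seqContent_comp_perm (χ : Fin n → k) (σ : Perm (Fin n)) :
    seqContent k (χ ∘ σ) = seqContent k χ := by
  funext x
  unfold seqContent
  refine Finset.card_equiv σ fun r => ?_
  simp only [Finset.mem_filter, Finset.mem_univ, true_and, Function.comp_apply]

end SeqContent

section ContentClasses

open Equiv

variable (k : Type*) [Field k] {n : ℕ}

/-- **The residue-content class `k[S_n]_α = ⊕_{cont 𝐢 = α} M_𝐢`** (Hu–Mathas 2010, §3.1–3.2: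
`e_α R_n^Λ`, `e_α = ∑_{𝐢 ∈ I^α} e(𝐢)`). [cite: HuMathas2010, §3.2 (blocks R_α^Λ = e_α R_n^Λ)] -/
def contentSpace [DecidableEq k] (α : k → ℕ) : Submodule k (MonoidAlgebra k (Perm (Fin n))) :=
  ⨆ (χ : Fin n → k) (_ : seqContent k χ = α), jointEigenspace k χ

variable [DecidableEq k]

/-- `M_𝐢 ⊆ k[S_n]_{cont 𝐢}`. [folklore] -/
theorem jointEigenspace_le_contentSpace (χ : Fin n → k) :
    jointEigenspace k χ ≤ contentSpace k (seqContent k χ) :=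
  le_iSup₂_of_le (f := fun (χ' : Fin n → k) (_ : seqContent k χ' = seqContent k χ) =>
    jointEigenspace k χ') χ rfl le_rfl

/-- A closure property of the content classes under a left multiplication, reduced to the `M_𝐢`.
[folklore] -/
theorem mul_mem_contentSpace_of_forall {α : k → ℕ} {a : MonoidAlgebra k (Perm (Fin n))}
    (ha : ∀ χ : Fin n → k, ∀ v ∈ jointEigenspace k χ, a * v ∈ contentSpace k (seqContent k χ))
    {v : MonoidAlgebra k (Perm (Fin n))} (hv : v ∈ contentSpace k α) :
    a * v ∈ contentSpace k α := by
  refine Submodule.iSup_induction (p := fun χ' => ⨆ (_ : seqContent k χ' = α), jointEigenspace k χ')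
    (motive := fun v => a * v ∈ contentSpace k α) hv ?_ (by rw [mul_zero]; exact Submodule.zero_mem _) ?_
  · intro χ x hx
    by_cases hc : seqContent k χ = α
    · rw [iSup_pos hc] at hx
      exact hc ▸ ha χ x hx
    · rw [iSup_neg hc, Submodule.mem_bot] at hx
      rw [hx, mul_zero]
      exact Submodule.zero_mem _
  · intro x y hx hy
    rw [mul_add]
    exact Submodule.add_mem _ hx hy

/-- `k[S_n]_α` is a right ideal. [folklore] -/
theorem mul_mem_contentSpace {α : k → ℕ} {v : MonoidAlgebra k (Perm (Fin n))}
    (hv : v ∈ contentSpace k α) (a : MonoidAlgebra k (Perm (Fin n))) :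
    v * a ∈ contentSpace k α := by
  refine Submodule.iSup_induction (p := fun χ' => ⨆ (_ : seqContent k χ' = α), jointEigenspace k χ')
    (motive := fun v => v * a ∈ contentSpace k α) hv ?_ (by rw [zero_mul]; exact Submodule.zero_mem _) ?_
  · intro χ x hx
    by_cases hc : seqContent k χ = α
    · rw [iSup_pos hc] at hx
      exact hc ▸ jointEigenspace_le_contentSpace k χ (mul_mem_jointEigenspace k hx a)
    · rw [iSup_neg hc, Submodule.mem_bot] at hx
      rw [hx, zero_mul]
      exact Submodule.zero_mem _
  · intro x y hx hy
    rw [add_mul]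
    exact Submodule.add_mem _ hx hy

/-- **`s_r k[S_n]_α ⊆ k[S_n]_α`** for the simple transpositions. [folklore] -/
theorem of_swap_mul_mem_contentSpace {r r' : Fin n} (h : (r' : ℕ) = r + 1) {α : k → ℕ}
    {v : MonoidAlgebra k (Perm (Fin n))} (hv : v ∈ contentSpace k α) :
    MonoidAlgebra.of k _ (swap r r') * v ∈ contentSpace k α := by
  refine mul_mem_contentSpace_of_forall k (fun χ v hv => ?_) hv
  have hmem := of_swap_mul_mem_sup_jointEigenspace k h hv
  refine (sup_le (jointEigenspace_le_contentSpace k χ) ?_) hmem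
  have hc := seqContent_comp_perm k χ (swap r r')
  exact hc ▸ jointEigenspace_le_contentSpace k (χ ∘ swap r r')

/-- **`g k[S_n]_α ⊆ k[S_n]_α` for every permutation `g`** (the simple transpositions generate
`S_n`). [folklore] -/
theorem of_mul_mem_contentSpace (g : Perm (Fin n)) {α : k → ℕ}
    {v : MonoidAlgebra k (Perm (Fin n))} (hv : v ∈ contentSpace k α) :
    MonoidAlgebra.of k _ g * v ∈ contentSpace k α := by
  cases n with
  | zero =>
    rw [Subsingleton.elim g 1, map_one, one_mul]
    exact hv
  | succ m =>
    have hg : g ∈ Submonoid.closure (Set.range fun i : Fin m => swap i.castSucc i.succ) := by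
      rw [Perm.mclosure_swap_castSucc_succ]; exact Submonoid.mem_top g
    induction hg using Submonoid.closure_induction generalizing v with
    | mem x hx =>
      obtain ⟨i, rfl⟩ := hx
      exact of_swap_mul_mem_contentSpace k (by simp) hv
    | one => rw [map_one, one_mul]; exact hv
    | mul x y _ _ hx hy => rw [map_mul, mul_assoc]; exact hx (hy hv)

/-- **`k[S_n]_α` is a two-sided ideal**: stable under left multiplication too. [folklore] -/
theorem mul_mem_contentSpace_left (a : MonoidAlgebra k (Perm (Fin n))) {α : k → ℕ}
    {v : MonoidAlgebra k (Perm (Fin n))} (hv : v ∈ contentSpace k α) :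
    a * v ∈ contentSpace k α := by
  induction a using MonoidAlgebra.induction_on with
  | hM g => exact of_mul_mem_contentSpace k g hv
  | hadd x y hx hy => rw [add_mul]; exact Submodule.add_mem _ hx hy
  | hsmul r x hx => rw [smul_mul_assoc]; exact Submodule.smul_mem _ r hx

/-- The content classes are independent (they group the independent `M_𝐢`). [folklore] -/
theorem disjoint_contentSpace {α α' : k → ℕ} (h : α ≠ α') :
    Disjoint (contentSpace k (n := n) α) (contentSpace k α') := by
  unfold contentSpace
  have h1 : (⨆ (χ : Fin n → k) (_ : seqContent k χ = α), jointEigenspace k χ) =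
      ⨆ χ ∈ {χ : Fin n → k | seqContent k χ = α}, jointEigenspace k χ := by
    simp only [Set.mem_setOf_eq]
  have h2 : (⨆ (χ : Fin n → k) (_ : seqContent k χ = α'), jointEigenspace k χ) =
      ⨆ χ ∈ {χ : Fin n → k | seqContent k χ = α'}, jointEigenspace k χ := by
    simp only [Set.mem_setOf_eq]
  rw [h1, h2]
  refine (iSupIndep_jointEigenspace k).disjoint_biSup_biSup (Set.disjoint_left.2 ?_)
  intro χ hχ hχ'
  simp only [Set.mem_setOf_eq] at hχ hχ'
  exact h (hχ.symm.trans hχ')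

/-- **Orthogonality of the content classes: `k[S_n]_α · k[S_n]_{α'} = 0` for `α ≠ α'`** (the
product lies in both two-sided ideals). This is the "products across two different contents
vanish" clause of `KLRGradedCellularBasis` (`e_α e_{α'} = 0`).
[cite: HuMathas2010, §3.2 (blocks R_α^Λ = e_α R_n^Λ)] -/
theorem mul_eq_zero_of_mem_contentSpace {α α' : k → ℕ} (h : α ≠ α')
    {x y : MonoidAlgebra k (Perm (Fin n))} (hx : x ∈ contentSpace k α)
    (hy : y ∈ contentSpace k α') : x * y = 0 :=
  (Submodule.disjoint_def.1 (disjoint_contentSpace k h)) (x * y) (mul_mem_contentSpace k hx y)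
    (mul_mem_contentSpace_left k x hy)

/-- **`k[S_n] = ∑_α k[S_n]_α`.** [folklore] -/
theorem iSup_contentSpace_eq_top :
    ⨆ α : k → ℕ, contentSpace k (n := n) α = ⊤ := by
  rw [eq_top_iff, ← iSup_jointEigenspace_eq_top k]
  exact iSup_le fun χ => (jointEigenspace_le_contentSpace k χ).trans (le_iSup _ _)


open Classical in
/-- **The block idempotent `e_α = ∑_{𝐢 ∈ I^α} e(𝐢)`** (Hu–Mathas 2010, §3.1: `e_α`, with
`R_α^Λ = e_α R_n^Λ`), summed over the candidate residue sequences of content `α`.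
[cite: HuMathas2010, §3.2 (blocks R_α^Λ = e_α R_n^Λ)] -/
def contentIdempotent (α : k → ℕ) : MonoidAlgebra k (Perm (Fin n)) :=
  ∑ χ ∈ (residueSeqs k n).filter (fun χ => seqContent k χ = α), klrIdempotent k χ

open Classical in
/-- `e_α ∈ k[S_n]_α`. [folklore] -/
theorem contentIdempotent_mem (α : k → ℕ) : contentIdempotent k α ∈ contentSpace k (n := n) α := by
  refine Submodule.sum_mem _ fun χ hχ => ?_
  have hc : seqContent k χ = α := (Finset.mem_filter.1 hχ).2
  exact hc ▸ jointEigenspace_le_contentSpace k χ (klrIdempotent_mem k χ)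

open Classical in
/-- **`e_α v = v` for `v ∈ k[S_n]_α`.** [folklore] -/
theorem contentIdempotent_mul_of_mem {α : k → ℕ} {v : MonoidAlgebra k (Perm (Fin n))}
    (hv : v ∈ contentSpace k α) : contentIdempotent k α * v = v := by
  refine Submodule.iSup_induction (p := fun χ' => ⨆ (_ : seqContent k χ' = α), jointEigenspace k χ')
    (motive := fun v => contentIdempotent k α * v = v) hv ?_ (mul_zero _) ?_
  · intro χ x hx
    by_cases hc : seqContent k χ = α
    · rw [iSup_pos hc] at hx
      by_cases hx0 : x = 0
      · rw [hx0, mul_zero]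
      have hχ : χ ∈ (residueSeqs k n).filter (fun χ => seqContent k χ = α) := by
        refine Finset.mem_filter.2 ⟨mem_residueSeqs_of_ne_bot k ?_, hc⟩
        exact (Submodule.ne_bot_iff _).2 ⟨x, hx, hx0⟩
      rw [contentIdempotent, Finset.sum_mul,
        Finset.sum_eq_single_of_mem χ hχ fun χ' _ hne => klrIdempotent_mul_of_mem_ne k hne.symm hx]
      exact klrIdempotent_mul_of_mem k hx
    · rw [iSup_neg hc, Submodule.mem_bot] at hx
      rw [hx, mul_zero]
  · intro x y hx hy
    rw [mul_add, hx, hy]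

open Classical in
/-- **`e_α v = 0` for `v ∈ k[S_n]_{α'}`, `α' ≠ α`.** [folklore] -/
theorem contentIdempotent_mul_of_mem_ne {α α' : k → ℕ} (h : α ≠ α')
    {v : MonoidAlgebra k (Perm (Fin n))} (hv : v ∈ contentSpace k α') :
    contentIdempotent k α * v = 0 :=
  mul_eq_zero_of_mem_contentSpace k h (contentIdempotent_mem k α) hv

open Classical in
/-- **`∑_α e_α = 1`**, summed over the contents of the candidate residue sequences.
[cite: HuMathas2010, §3.2 (blocks R_α^Λ = e_α R_n^Λ)] -/
theorem sum_contentIdempotent :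
    ∑ α ∈ (residueSeqs k n).image (seqContent k), contentIdempotent k (n := n) α = 1 := by
  rw [← sum_residueSeqs_klrIdempotent k]
  exact Finset.sum_fiberwise_of_maps_to (fun χ hχ => Finset.mem_image_of_mem _ hχ) _

open Classical in
/-- **`e_α` is central**: `e_α a = a e_α` for every `a ∈ k[S_n]` (write `a = ∑_{α'} a e_{α'}` with
`a e_{α'} ∈ k[S_n]_{α'}`, a two-sided ideal). [cite: HuMathas2010, §3.2 (blocks R_α^Λ = e_α R_n^Λ)] -/
theorem contentIdempotent_comm (α : k → ℕ) (a : MonoidAlgebra k (Perm (Fin n))) :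
    contentIdempotent k α * a = a * contentIdempotent k α := by
  have ha : a = ∑ α' ∈ (residueSeqs k n).image (seqContent k), a * contentIdempotent k α' := by
    rw [← Finset.mul_sum, sum_contentIdempotent, mul_one]
  conv_lhs => rw [ha]
  rw [Finset.mul_sum]
  have hterm : ∀ α' ∈ (residueSeqs k n).image (seqContent k),
      contentIdempotent k α * (a * contentIdempotent k α') =
        if α' = α then a * contentIdempotent k α else 0 := by
    intro α' _
    split_ifs with h
    · subst h
      exact contentIdempotent_mul_of_mem k
        (mul_mem_contentSpace_left k a (contentIdempotent_mem k α'))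
    · exact contentIdempotent_mul_of_mem_ne k (Ne.symm h)
        (mul_mem_contentSpace_left k a (contentIdempotent_mem k α'))
  rw [Finset.sum_congr rfl hterm, Finset.sum_ite_eq']
  split_ifs with h
  · rfl
  · -- `α` is not a content of any candidate sequence: `e_α = 0`
    have h0 : contentIdempotent k (n := n) α = 0 := by
      apply Finset.sum_eq_zero
      intro χ hχ
      exfalso
      exact h (Finset.mem_image.2 ⟨χ, (Finset.mem_filter.1 hχ).1, (Finset.mem_filter.1 hχ).2⟩)
    rw [h0, mul_zero]

open Classical in
/-- `e_α² = e_α`. [folklore] -/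
theorem contentIdempotent_mul_self (α : k → ℕ) :
    contentIdempotent k α * contentIdempotent k α = contentIdempotent k (n := n) α :=
  contentIdempotent_mul_of_mem k (contentIdempotent_mem k α)

open Classical in
/-- `e_α e_{α'} = 0` for `α ≠ α'`. [folklore] -/
theorem contentIdempotent_mul_of_ne {α α' : k → ℕ} (h : α ≠ α') :
    contentIdempotent k α * contentIdempotent k α' = (0 : MonoidAlgebra k (Perm (Fin n))) :=
  contentIdempotent_mul_of_mem_ne k h (contentIdempotent_mem k α')

open Classical in
/-- **`k[S_n]_α = e_α k[S_n]`**: membership is `e_α v = v`. [folklore] -/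
theorem mem_contentSpace_iff (α : k → ℕ) (v : MonoidAlgebra k (Perm (Fin n))) :
    v ∈ contentSpace k α ↔ contentIdempotent k α * v = v :=
  ⟨contentIdempotent_mul_of_mem k, fun h => h ▸ mul_mem_contentSpace k (contentIdempotent_mem k α) v⟩

end ContentClasses


/-! ### Residue sequences of standard tableaux and the content of a `TableauPair` -/

section TableauResidues

variable (p : ℕ) {n : ℕ}

/-- The **residue sequence** `𝐢^T = (res T(0), …, res T(n-1))` of a standard tableau given by its
growth sequence (Hu–Mathas 2010, §3.3, `res(𝔱)`; `cellResidue p (r, c) = c - r`).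
[cite: HuMathas2010, §3.3 (residue sequence of a tableau)] -/
def residueSeq {Y : YoungDiagram} (T : StdFilling n Y) : Fin n → ZMod p :=
  fun r => cellResidue p (T.1 r)

/-- Unfolding `residueSeq`. [folklore] -/
theorem residueSeq_apply {Y : YoungDiagram} (T : StdFilling n Y) (r : Fin n) :
    residueSeq p T r = cellResidue p (T.1 r) := rfl

/-- **The content of the residue sequence of a standard `μ`-tableau is the residue content of `μ`**
(a standard tableau visits every cell of `μ` exactly once). [folklore] -/
theorem seqContent_residueSeq (μ : Nat.Partition n) (T : StdFilling n μ.youngDiagram) :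
    seqContent (ZMod p) (residueSeq p T) = residueContent p μ := by
  funext x
  unfold seqContent residueContent
  refine Finset.card_bij (fun r _ => T.1 r) (fun r hr => ?_) (fun r₁ _ r₂ _ h => T.injective h)
    (fun c hc => ?_)
  · simp only [Finset.mem_filter, Finset.mem_univ, true_and, residueSeq_apply] at hr
    exact Finset.mem_filter.2 ⟨(YoungDiagram.mem_cells _).2 (T.mem r), hr⟩
  · obtain ⟨hc1, hc2⟩ := Finset.mem_filter.1 hc
    obtain ⟨r, hr⟩ := T.exists_eq μ.card_cells_youngDiagram ((YoungDiagram.mem_cells _).1 hc1)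
    refine ⟨r, ?_, hr⟩
    simp only [Finset.mem_filter, Finset.mem_univ, true_and, residueSeq_apply, hr]
    exact hc2

/-- `TableauPair.content` is the content of the residue sequence of either tableau of the pair.
[folklore] -/
theorem TableauPair.content_eq_seqContent_fst (x : TableauPair n) :
    TableauPair.content p x = seqContent (ZMod p) (residueSeq p x.2.1) :=
  (seqContent_residueSeq p x.1 x.2.1).symm

/-- `TableauPair.content` is the content of the residue sequence of the second tableau too.
[folklore] -/
theorem TableauPair.content_eq_seqContent_snd (x : TableauPair n) :
    TableauPair.content p x = seqContent (ZMod p) (residueSeq p x.2.2) :=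
  (seqContent_residueSeq p x.1 x.2.2).symm

end TableauResidues


/-! ### Brundan–Kleshchev's nilpotent elements `y_r = ∑_𝐢 (L_r - i_r) e(𝐢)` (Hu–Mathas §3.2)

Hu–Mathas 2010, §3.2 (p. 10): "define `y_r = ∑_{𝐢 ∈ I^n} (L_r - i_r) e(𝐢)` (`q = 1`); by [BK],
`y_1, …, y_n` are nilpotent elements of `H`, so any power series in `y_1, …, y_n` can be
interpreted as elements of `H`" — the first of the KLR generators of `𝔽_p S_n`, of degree `2`. -/

section Nilpotents

open Equiv

variable (k : Type*) [Field k] [DecidableEq k] {n : ℕ}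

/-- **Brundan–Kleshchev's element `y_r = ∑_𝐢 (L_r - i_r) e(𝐢)`** of `k[S_n]` (degenerate case,
Hu–Mathas 2010, §3.2), summed over the candidate residue sequences.
[cite: HuMathas2010, §3.2 (definition of y_r, before Thm 24)] -/
def bkNilpotent (r : Fin n) : MonoidAlgebra k (Perm (Fin n)) :=
  ∑ χ ∈ residueSeqs k n, (jucysMurphy k r * klrIdempotent k χ - χ r • klrIdempotent k χ)

/-- **`y_r e(𝐢) = (L_r - i_r) e(𝐢)`.** [cite: HuMathas2010, §3.2 (definition of y_r, before Thm 24)] -/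
theorem bkNilpotent_mul_klrIdempotent (r : Fin n) (χ : Fin n → k) :
    bkNilpotent k r * klrIdempotent k χ =
      jucysMurphy k r * klrIdempotent k χ - χ r • klrIdempotent k χ := by
  by_cases h0 : klrIdempotent k χ = 0
  · rw [h0, mul_zero, mul_zero, smul_zero, sub_zero]
  have hχ : χ ∈ residueSeqs k n := by
    refine mem_residueSeqs_of_ne_bot k fun hbot => h0 ?_
    have hmem := klrIdempotent_mem k χ
    rwa [hbot, Submodule.mem_bot] at hmem
  rw [bkNilpotent, Finset.sum_mul, Finset.sum_eq_single_of_mem χ hχ]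
  · rw [sub_mul, mul_assoc, klrIdempotent_mul_self, smul_mul_assoc, klrIdempotent_mul_self]
  · intro χ' _ hne
    rw [sub_mul, mul_assoc, klrIdempotent_mul_klrIdempotent_of_ne k hne, mul_zero, smul_mul_assoc,
      klrIdempotent_mul_klrIdempotent_of_ne k hne, smul_zero, sub_zero]

/-- `e(𝐢) y_r = (L_r - i_r) e(𝐢)` too (`y_r` commutes with the `e(𝐢)`). [folklore] -/
theorem klrIdempotent_mul_bkNilpotent (r : Fin n) (χ : Fin n → k) :
    klrIdempotent k χ * bkNilpotent k r =
      jucysMurphy k r * klrIdempotent k χ - χ r • klrIdempotent k χ := by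
  by_cases h0 : klrIdempotent k χ = 0
  · rw [h0, zero_mul, mul_zero, smul_zero, sub_zero]
  have hχ : χ ∈ residueSeqs k n := by
    refine mem_residueSeqs_of_ne_bot k fun hbot => h0 ?_
    have hmem := klrIdempotent_mem k χ
    rwa [hbot, Submodule.mem_bot] at hmem
  rw [bkNilpotent, Finset.mul_sum, Finset.sum_eq_single_of_mem χ hχ]
  · rw [mul_sub, ← mul_assoc, ← jucysMurphy_mul_klrIdempotent, mul_assoc, klrIdempotent_mul_self,
      mul_smul_comm, klrIdempotent_mul_self]
  · intro χ' _ hne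
    rw [mul_sub, ← mul_assoc, ← jucysMurphy_mul_klrIdempotent, mul_assoc,
      klrIdempotent_mul_klrIdempotent_of_ne k hne.symm, mul_zero, mul_smul_comm,
      klrIdempotent_mul_klrIdempotent_of_ne k hne.symm, smul_zero, sub_zero]

/-- **`L_r = y_r + ∑_𝐢 i_r e(𝐢)`** (the inverse Brundan–Kleshchev map `L_r ↦ ∑_𝐢 (y_r + i_r) e(𝐢)`,
Hu–Mathas 2010, Thm 24, at `q = 1`). [cite: HuMathas2010, Thm 24 (inverse isomorphism, q = 1)] -/
theorem jucysMurphy_eq_bkNilpotent_add (r : Fin n) :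
    jucysMurphy k r = bkNilpotent k r + ∑ χ ∈ residueSeqs k n, χ r • klrIdempotent k χ := by
  rw [bkNilpotent, ← Finset.sum_add_distrib]
  simp only [sub_add_cancel]
  rw [← Finset.mul_sum, sum_residueSeqs_klrIdempotent, mul_one]

omit [DecidableEq k] in
/-- `(L_r - i_r)^{n!} e(𝐢) = 0`: `e(𝐢) ∈ M_𝐢` lies in the generalized `i_r`-eigenspace of `L_r`,
which is killed by the `(dim k[S_n])`-th power. [folklore] -/
theorem jucysMurphy_sub_pow_mul_klrIdempotent (r : Fin n) (χ : Fin n → k) :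
    (jucysMurphy k r - algebraMap k _ (χ r)) ^ n.factorial * klrIdempotent k χ = 0 := by
  have hmem : klrIdempotent k χ ∈
      Module.End.maxGenEigenspace (LinearMap.mulLeft k (jucysMurphy k r)) (χ r) :=
    (Submodule.mem_iInf _).1 (klrIdempotent_mem k χ) r
  rw [Module.End.maxGenEigenspace_eq_genEigenspace_finrank, Module.End.genEigenspace_nat,
    finrank_monoidAlgebra_perm_eq_factorial, LinearMap.mem_ker] at hmem
  have hop : LinearMap.mulLeft k (jucysMurphy k r) - χ r • (1 : Module.End k _) =
      LinearMap.mulLeft k (jucysMurphy k r - algebraMap k _ (χ r)) := by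
    symm
    change Algebra.lmul k _ (jucysMurphy k r - algebraMap k _ (χ r)) =
      Algebra.lmul k _ (jucysMurphy k r) - χ r • 1
    rw [map_sub, AlgHom.commutes, Algebra.algebraMap_eq_smul_one]
  rw [hop, LinearMap.pow_mulLeft, LinearMap.mulLeft_apply] at hmem
  exact hmem

/-- **`y_r` is nilpotent: `y_r^{n!} = 0`** ("by [BK], `y_1, …, y_n` are nilpotent elements of `H`",
Hu–Mathas 2010, §3.2). [cite: HuMathas2010, §3.2 (nilpotency of y_r, before Thm 24)] -/
theorem bkNilpotent_pow_factorial (r : Fin n) :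
    bkNilpotent k r ^ n.factorial = 0 := by
  -- `y_r^N = ∑_𝐢 (L_r - i_r)^N e(𝐢)` for `N ≥ 1`
  have hpow : ∀ N : ℕ, 0 < N → bkNilpotent k r ^ N =
      ∑ χ ∈ residueSeqs k n, (jucysMurphy k r - algebraMap k _ (χ r)) ^ N * klrIdempotent k χ := by
    intro N hN
    induction N with
    | zero => exact absurd hN (lt_irrefl 0)
    | succ N ih =>
      rcases Nat.eq_zero_or_pos N with hN0 | hN0
      · subst hN0
        rw [zero_add, pow_one, bkNilpotent]
        refine Finset.sum_congr rfl fun χ _ => ?_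
        rw [pow_one, sub_mul, Algebra.algebraMap_eq_smul_one, smul_mul_assoc, one_mul]
      · rw [pow_succ, ih hN0, Finset.sum_mul]
        refine Finset.sum_congr rfl fun χ _ => ?_
        have hstep : jucysMurphy k r * klrIdempotent k χ - χ r • klrIdempotent k χ =
            (jucysMurphy k r - algebraMap k _ (χ r)) * klrIdempotent k χ := by
          rw [sub_mul, Algebra.algebraMap_eq_smul_one, smul_mul_assoc, one_mul]
        rw [mul_assoc, klrIdempotent_mul_bkNilpotent, hstep, ← mul_assoc, ← pow_succ]
  rw [hpow _ (Nat.factorial_pos n)]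
  exact Finset.sum_eq_zero fun χ _ => jucysMurphy_sub_pow_mul_klrIdempotent k r χ

end Nilpotents


/-! ### The intertwining elements `Φ_r = s_r (L_r - L_{r+1}) + 1` (Brundan–Kleshchev)

The degenerate intertwiners: `Φ_r L_r = L_{r+1} Φ_r`, `Φ_r L_{r+1} = L_r Φ_r`, `Φ_r L_t = L_t Φ_r`
otherwise, `Φ_r² = 1 - (L_r - L_{r+1})²`; hence `Φ_r M_𝐢 ⊆ M_{s_r 𝐢}` and
`Φ_r e(𝐢) = e(s_r 𝐢) Φ_r` — the shape of the KLR relation `ψ_r e(𝐢) = e(s_r 𝐢) ψ_r`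
(Hu–Mathas 2010, §3.1; Brundan–Kleshchev's `ψ_r e(𝐢) = (T_r + P_r(𝐢)) Q_r(𝐢)⁻¹ e(𝐢)` renormalize
these by power series in the nilpotent `y`'s, §3.2). -/

section Intertwiners

open Equiv

variable (k : Type*) [CommRing k] {n : ℕ}

/-- **The intertwining element `Φ_r = s_r (L_r - L_{r+1}) + 1`** of `k[S_n]` (degenerate affine
Hecke algebra intertwiner, as used by Brundan–Kleshchev). [folklore] -/
def bkIntertwiner (r r' : Fin n) : MonoidAlgebra k (Perm (Fin n)) :=
  MonoidAlgebra.of k _ (swap r r') * (jucysMurphy k r - jucysMurphy k r') + 1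

/-- **`Φ_r L_r = L_{r+1} Φ_r`.** [folklore] -/
theorem bkIntertwiner_mul_jucysMurphy_left {r r' : Fin n} (h : (r' : ℕ) = r + 1) :
    bkIntertwiner k r r' * jucysMurphy k r = jucysMurphy k r' * bkIntertwiner k r r' := by
  have h1 : MonoidAlgebra.of k _ (swap r r') * jucysMurphy k r =
      jucysMurphy k r' * MonoidAlgebra.of k _ (swap r r') - 1 := by
    rw [jucysMurphy_succ_mul_swap k h, add_sub_cancel_right]
  have hc : (jucysMurphy k r - jucysMurphy k r') * jucysMurphy k r =
      jucysMurphy k r * (jucysMurphy k r - jucysMurphy k r') := by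
    rw [sub_mul, mul_sub, (commute_jucysMurphy k r' r).eq]
  rw [bkIntertwiner, add_mul, one_mul, mul_assoc, hc, ← mul_assoc, h1, mul_add, mul_one, sub_mul,
    one_mul, mul_assoc]
  abel

/-- **`Φ_r L_{r+1} = L_r Φ_r`.** [folklore] -/
theorem bkIntertwiner_mul_jucysMurphy_right {r r' : Fin n} (h : (r' : ℕ) = r + 1) :
    bkIntertwiner k r r' * jucysMurphy k r' = jucysMurphy k r * bkIntertwiner k r r' := by
  have h2 : MonoidAlgebra.of k _ (swap r r') * jucysMurphy k r' =
      jucysMurphy k r * MonoidAlgebra.of k _ (swap r r') + 1 := of_swap_mul_jucysMurphy_succ k h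
  have hc : (jucysMurphy k r - jucysMurphy k r') * jucysMurphy k r' =
      jucysMurphy k r' * (jucysMurphy k r - jucysMurphy k r') := by
    rw [sub_mul, mul_sub, (commute_jucysMurphy k r r').eq]
  rw [bkIntertwiner, add_mul, one_mul, mul_assoc, hc, ← mul_assoc, h2, mul_add, mul_one, add_mul,
    one_mul, mul_assoc]
  abel

/-- `Φ_r L_t = L_t Φ_r` for `t ≠ r, r+1`. [folklore] -/
theorem bkIntertwiner_mul_jucysMurphy_of_ne {r r' t : Fin n} (h : (r' : ℕ) = r + 1) (htr : t ≠ r)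
    (htr' : t ≠ r') :
    bkIntertwiner k r r' * jucysMurphy k t = jucysMurphy k t * bkIntertwiner k r r' := by
  have hc : (jucysMurphy k r - jucysMurphy k r') * jucysMurphy k t =
      jucysMurphy k t * (jucysMurphy k r - jucysMurphy k r') := by
    rw [sub_mul, mul_sub, (commute_jucysMurphy k r t).eq, (commute_jucysMurphy k r' t).eq]
  rw [bkIntertwiner, add_mul, one_mul, mul_assoc, hc, ← mul_assoc,
    of_swap_mul_jucysMurphy_of_ne k h htr htr', mul_add, mul_one, mul_assoc]

/-- **`Φ_r² = 1 - (L_r - L_{r+1})²`.** [folklore] -/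
theorem bkIntertwiner_mul_self {r r' : Fin n} (h : (r' : ℕ) = r + 1) :
    bkIntertwiner k r r' * bkIntertwiner k r r' =
      1 - (jucysMurphy k r - jucysMurphy k r') ^ 2 := by
  have hss := of_swap_mul_self k r r'
  -- `s L_r s = L_{r'} - s` and `s L_{r'} s = L_r + s`
  have h1 : MonoidAlgebra.of k _ (swap r r') * jucysMurphy k r * MonoidAlgebra.of k _ (swap r r') =
      jucysMurphy k r' - MonoidAlgebra.of k _ (swap r r') := by
    rw [jucysMurphy_succ k h, add_sub_cancel_right]
  have h2 : MonoidAlgebra.of k _ (swap r r') * jucysMurphy k r' * MonoidAlgebra.of k _ (swap r r') =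
      jucysMurphy k r + MonoidAlgebra.of k _ (swap r r') := by
    rw [jucysMurphy_succ k h, mul_add, add_mul, hss, ← mul_assoc, ← mul_assoc, hss, one_mul,
      mul_assoc, hss, mul_one, one_mul]
  have hszs : MonoidAlgebra.of k _ (swap r r') * (jucysMurphy k r - jucysMurphy k r') *
      MonoidAlgebra.of k _ (swap r r') =
      -(jucysMurphy k r - jucysMurphy k r') - 2 • MonoidAlgebra.of k _ (swap r r') := by
    rw [mul_sub, sub_mul, h1, h2]
    abel
  calc bkIntertwiner k r r' * bkIntertwiner k r r'
      = MonoidAlgebra.of k _ (swap r r') * (jucysMurphy k r - jucysMurphy k r') *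
          MonoidAlgebra.of k _ (swap r r') * (jucysMurphy k r - jucysMurphy k r') +
          2 • (MonoidAlgebra.of k _ (swap r r') * (jucysMurphy k r - jucysMurphy k r')) + 1 := by
        rw [bkIntertwiner]; noncomm_ring
    _ = (-(jucysMurphy k r - jucysMurphy k r') - 2 • MonoidAlgebra.of k _ (swap r r')) *
          (jucysMurphy k r - jucysMurphy k r') +
          2 • (MonoidAlgebra.of k _ (swap r r') * (jucysMurphy k r - jucysMurphy k r')) + 1 := by
        rw [hszs]
    _ = 1 - (jucysMurphy k r - jucysMurphy k r') ^ 2 := by noncomm_ring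

end Intertwiners

section IntertwinersField

open Equiv

variable (k : Type*) [Field k] {n : ℕ}

/-- A semiconjugating operator maps generalized eigenspaces to generalized eigenspaces:
`T f = g T`, `v ∈ ker (f - c)^N` ⇒ `T v ∈ ker (g - c)^N`. [folklore] -/
theorem apply_mem_maxGenEigenspace_of_semiconjBy {V : Type*} [AddCommGroup V] [Module k V]
    {T f g : Module.End k V} (h : SemiconjBy T f g) {c : k} {v : V}
    (hv : v ∈ f.maxGenEigenspace c) : T v ∈ g.maxGenEigenspace c := by
  rw [Module.End.mem_maxGenEigenspace] at hv ⊢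
  obtain ⟨N, hN⟩ := hv
  refine ⟨N, ?_⟩
  have hs : SemiconjBy T ((f - c • 1) ^ N) ((g - c • 1) ^ N) :=
    (h.sub_right ((SemiconjBy.one_right T).smul_right c)).pow_right N
  rw [← Module.End.mul_apply, ← hs.eq, Module.End.mul_apply, hN, map_zero]

/-- **`Φ_r M_𝐢 ⊆ M_{s_r 𝐢}`**: the intertwiner moves the joint generalized eigenspace of `𝐢` into
that of `s_r 𝐢`. [folklore] -/
theorem bkIntertwiner_mul_mem_jointEigenspace {r r' : Fin n} (h : (r' : ℕ) = r + 1)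
    {χ : Fin n → k} {v : MonoidAlgebra k (Perm (Fin n))} (hv : v ∈ jointEigenspace k χ) :
    bkIntertwiner k r r' * v ∈ jointEigenspace k (χ ∘ swap r r') := by
  have hv' : ∀ t, v ∈ Module.End.maxGenEigenspace (LinearMap.mulLeft k (jucysMurphy k t)) (χ t) :=
    fun t => (Submodule.mem_iInf _).1 hv t
  -- semiconjugations `mulLeft Φ * mulLeft a = mulLeft b * mulLeft Φ` from `Φ a = b Φ`
  have hsemi : ∀ {a b : MonoidAlgebra k (Perm (Fin n))},
      bkIntertwiner k r r' * a = b * bkIntertwiner k r r' →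
      SemiconjBy (LinearMap.mulLeft k (bkIntertwiner k r r')) (LinearMap.mulLeft k a)
        (LinearMap.mulLeft k b) := by
    intro a b hab
    change LinearMap.mulLeft k _ * LinearMap.mulLeft k _ = LinearMap.mulLeft k _ * LinearMap.mulLeft k _
    rw [Module.End.mul_eq_comp, Module.End.mul_eq_comp, ← LinearMap.mulLeft_mul,
      ← LinearMap.mulLeft_mul, hab]
  refine (Submodule.mem_iInf _).2 fun t => ?_
  change LinearMap.mulLeft k (bkIntertwiner k r r') v ∈ _
  simp only [Function.comp_apply]
  by_cases htr : t = r
  · subst htr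
    rw [swap_apply_left]
    exact apply_mem_maxGenEigenspace_of_semiconjBy k
      (hsemi (bkIntertwiner_mul_jucysMurphy_right k h)) (hv' r')
  by_cases htr' : t = r'
  · subst htr'
    rw [swap_apply_right]
    exact apply_mem_maxGenEigenspace_of_semiconjBy k
      (hsemi (bkIntertwiner_mul_jucysMurphy_left k h)) (hv' r)
  rw [swap_apply_of_ne_of_ne htr htr']
  exact apply_mem_maxGenEigenspace_of_semiconjBy k
    (hsemi (bkIntertwiner_mul_jucysMurphy_of_ne k h htr htr')) (hv' t)

/-- **`Φ_r e(𝐢) = e(s_r 𝐢) Φ_r`** — the KLR relation `ψ_r e(𝐢) = e(s_r 𝐢) ψ_r` (Hu–Mathas 2010,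
§3.1) at the level of the intertwiners. [cite: HuMathas2010, §3.1 (relation ψ_r e(𝐢) = e(s_r𝐢) ψ_r)] -/
theorem bkIntertwiner_mul_klrIdempotent [DecidableEq k] {r r' : Fin n} (h : (r' : ℕ) = r + 1)
    (χ : Fin n → k) :
    bkIntertwiner k r r' * klrIdempotent k χ =
      klrIdempotent k (χ ∘ swap r r') * bkIntertwiner k r r' := by
  -- both sides are left multiplications; compare them on `v = ∑_𝐣 e(𝐣) v`
  have key : ∀ v : MonoidAlgebra k (Perm (Fin n)),
      bkIntertwiner k r r' * (klrIdempotent k χ * v) =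
        klrIdempotent k (χ ∘ swap r r') * (bkIntertwiner k r r' * v) := by
    intro v
    conv_rhs => rw [← sum_klrIdempotent_mul k (residueSeqs k n)
      (fun _ h => mem_residueSeqs_of_ne_bot k h) v]
    rw [Finset.mul_sum, Finset.mul_sum]
    have hterm : ∀ χ' ∈ residueSeqs k n,
        klrIdempotent k (χ ∘ swap r r') * (bkIntertwiner k r r' * (klrIdempotent k χ' * v)) =
          if χ' = χ then bkIntertwiner k r r' * (klrIdempotent k χ * v) else 0 := by
      intro χ' _
      have hmem : bkIntertwiner k r r' * (klrIdempotent k χ' * v) ∈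
          jointEigenspace k (χ' ∘ swap r r') :=
        bkIntertwiner_mul_mem_jointEigenspace k h
          (mul_mem_jointEigenspace k (klrIdempotent_mem k χ') v)
      split_ifs with hc
      · subst hc
        exact klrIdempotent_mul_of_mem k hmem
      · refine klrIdempotent_mul_of_mem_ne k ?_ hmem
        intro e
        apply hc
        funext x
        have ex := congrFun e (swap r r' x)
        simpa only [Function.comp_apply, swap_apply_self] using ex
    rw [Finset.sum_congr rfl hterm, Finset.sum_ite_eq']
    split_ifs with hχ
    · rfl
    · have h0 : klrIdempotent k χ = 0 := by
        have hmem := klrIdempotent_mem k χ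
        have hbot : jointEigenspace k χ = ⊥ := by
          by_contra hne
          exact hχ (mem_residueSeqs_of_ne_bot k hne)
        rwa [hbot, Submodule.mem_bot] at hmem
      rw [h0, zero_mul, mul_zero]
  have h1 := key 1
  rwa [mul_one, mul_one] at h1

end IntertwinersField


/-! ### The easy KLR relations among the `y_r` and `e(𝐢)` (Hu–Mathas §3.1, level one)

`y_r y_t = y_t y_r`, `y_r e(𝐢) = e(𝐢) y_r` (above), and the cyclotomic relation of `R_n^{Λ₀}`:
`y_1^{(Λ₀, α_{i_1})} e(𝐢) = 0`, i.e. `e(𝐢) = 0` unless `i_1 = 0` and `y_1 e(𝐢) = 0` — here simply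
`y_1 = 0` (0-based: `y_⟨0⟩ = 0`, as `L_⟨0⟩ = 0`). -/

section EasyKLRRelations

open Equiv

variable (k : Type*) [Field k] [DecidableEq k] {n : ℕ}

/-- **The cyclotomic relation at level one: `y_1 = 0`** (0-based index `0`; `L_0 = 0` and
`e(𝐢) = 0` unless `i_0 = 0`). [cite: HuMathas2010, §3.1 (cyclotomic relation of R_n^Λ)] -/
theorem bkNilpotent_eq_zero {r : Fin n} (hr : (r : ℕ) = 0) : bkNilpotent k r = 0 := by
  rw [bkNilpotent]
  refine Finset.sum_eq_zero fun χ _ => ?_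
  rw [jucysMurphy_eq_zero k hr, zero_mul, zero_sub, neg_eq_zero]
  by_cases hχ : χ r = 0
  · rw [hχ, zero_smul]
  · have h0 : klrIdempotent k χ = 0 := by
      refine klrIdempotent_eq_zero k ⟨r, fun c hc => ?_⟩
      rw [hr, Finset.mem_Icc] at hc
      have hc0 : c = 0 := by omega
      subst hc0
      rw [Int.cast_zero]
      exact Ne.symm hχ
    rw [h0, smul_zero]

/-- The "diagonal part" `∑_𝐢 i_r e(𝐢)` of `L_r`. [folklore] -/
theorem jucysMurphy_mul_sum_smul_klrIdempotent_comm (r t : Fin n) :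
    jucysMurphy k r * (∑ χ ∈ residueSeqs k n, χ t • klrIdempotent k χ) =
      (∑ χ ∈ residueSeqs k n, χ t • klrIdempotent k χ) * jucysMurphy k r := by
  rw [Finset.mul_sum, Finset.sum_mul]
  refine Finset.sum_congr rfl fun χ _ => ?_
  rw [mul_smul_comm, smul_mul_assoc, jucysMurphy_mul_klrIdempotent]

/-- The diagonal parts commute with each other (orthogonal idempotents). [folklore] -/
theorem sum_smul_klrIdempotent_comm (r t : Fin n) :
    (∑ χ ∈ residueSeqs k n, χ r • klrIdempotent k χ) *
        (∑ χ ∈ residueSeqs k n, χ t • klrIdempotent k χ) =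
      (∑ χ ∈ residueSeqs k n, χ t • klrIdempotent k χ) *
        (∑ χ ∈ residueSeqs k n, χ r • klrIdempotent k χ) := by
  have hdiag : ∀ a b : Fin n,
      (∑ χ ∈ residueSeqs k n, χ a • klrIdempotent k χ) *
          (∑ χ ∈ residueSeqs k n, χ b • klrIdempotent k χ) =
        ∑ χ ∈ residueSeqs k n, (χ a * χ b) • klrIdempotent k χ := by
    intro a b
    rw [Finset.sum_mul]
    refine Finset.sum_congr rfl fun χ hχ => ?_
    rw [Finset.mul_sum, Finset.sum_eq_single_of_mem χ hχ]
    · rw [smul_mul_smul_comm, klrIdempotent_mul_self]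
    · intro χ' _ hne
      rw [smul_mul_smul_comm, klrIdempotent_mul_klrIdempotent_of_ne k hne.symm, smul_zero]
  rw [hdiag, hdiag]
  refine Finset.sum_congr rfl fun χ _ => ?_
  rw [mul_comm]

/-- **`y_r y_t = y_t y_r`** (KLR relation, Hu–Mathas 2010, §3.1).
[cite: HuMathas2010, §3.1 (relation y_r y_s = y_s y_r)] -/
theorem commute_bkNilpotent (r t : Fin n) : Commute (bkNilpotent k r) (bkNilpotent k t) := by
  have hr : bkNilpotent k r = jucysMurphy k r - ∑ χ ∈ residueSeqs k n, χ r • klrIdempotent k χ :=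
    eq_sub_of_add_eq (jucysMurphy_eq_bkNilpotent_add k r).symm
  have ht : bkNilpotent k t = jucysMurphy k t - ∑ χ ∈ residueSeqs k n, χ t • klrIdempotent k χ :=
    eq_sub_of_add_eq (jucysMurphy_eq_bkNilpotent_add k t).symm
  rw [hr, ht]
  refine Commute.sub_left (Commute.sub_right (commute_jucysMurphy k r t) ?_)
    (Commute.sub_right ?_ ?_)
  · exact jucysMurphy_mul_sum_smul_klrIdempotent_comm k r t
  · exact (jucysMurphy_mul_sum_smul_klrIdempotent_comm k t r).symm
  · exact sum_smul_klrIdempotent_comm k r t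

end EasyKLRRelations


/-! ### `Φ_r y_t = y_{s_r t} Φ_r`: the intertwiners permute the nilpotents

From `Φ_r e(𝐢) = e(s_r 𝐢) Φ_r` and `Φ_r L_t = L_{s_r t} Φ_r`: the "diagonal part"
`D_t = ∑_𝐢 i_t e(𝐢)` of `L_t` satisfies `Φ_r D_t = D_{s_r t} Φ_r` (reindex the sum by `𝐢 ↦ s_r 𝐢`
over a swap-closed finite index set), hence `Φ_r y_t = y_{s_r t} Φ_r` for `y_t = L_t - D_t` — the
degenerate-affine-Hecke form of the KLR relations `ψ_r y_t = y_{s_r t} ψ_r (+ corrections)`. -/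

section IntertwinerNilpotent

open Equiv

variable (k : Type*) [Field k] [DecidableEq k] {n : ℕ}

omit [DecidableEq k] in
/-- Sums `∑ f(𝐢) e(𝐢)` do not depend on the finite index set, as long as it contains every `𝐢`
with `M_𝐢 ≠ 0`. [folklore] -/
theorem sum_smul_klrIdempotent_subset {S T : Finset (Fin n → k)} (hST : S ⊆ T)
    (hS : ∀ χ, jointEigenspace k χ ≠ ⊥ → χ ∈ S) (f : (Fin n → k) → k) :
    ∑ χ ∈ S, f χ • klrIdempotent k χ = ∑ χ ∈ T, f χ • klrIdempotent k χ := by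
  refine Finset.sum_subset hST fun χ _ hχS => ?_
  have h0 : klrIdempotent k χ = 0 := by
    have hbot : jointEigenspace k χ = ⊥ := by
      by_contra hne
      exact hχS (hS χ hne)
    have hmem := klrIdempotent_mem k χ
    rwa [hbot, Submodule.mem_bot] at hmem
  rw [h0, smul_zero]

/-- A finite index set containing the candidate residue sequences and closed under `𝐢 ↦ s_r 𝐢`.
[folklore] -/
def residueSeqsSwap (r r' : Fin n) : Finset (Fin n → k) :=
  residueSeqs k n ∪ (residueSeqs k n).image fun χ => χ ∘ swap r r'

/-- `residueSeqsSwap` is closed under `𝐢 ↦ 𝐢 ∘ s_r`. [folklore] -/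
theorem comp_swap_mem_residueSeqsSwap {r r' : Fin n} {χ : Fin n → k}
    (h : χ ∈ residueSeqsSwap k r r') : χ ∘ swap r r' ∈ residueSeqsSwap k r r' := by
  rcases Finset.mem_union.1 h with h | h
  · exact Finset.mem_union_right _ (Finset.mem_image_of_mem _ h)
  · obtain ⟨χ₀, h₀, rfl⟩ := Finset.mem_image.1 h
    refine Finset.mem_union_left _ ?_
    have e : (χ₀ ∘ swap r r') ∘ swap r r' = χ₀ := by
      funext x
      simp only [Function.comp_apply, swap_apply_self]
    rw [e]
    exact h₀

/-- Precomposition with `s_r`, an involution of `Fin n → k`. [folklore] -/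
def compSwapEquiv (r r' : Fin n) : (Fin n → k) ≃ (Fin n → k) where
  toFun χ := χ ∘ swap r r'
  invFun χ := χ ∘ swap r r'
  left_inv χ := by
    funext x
    simp only [Function.comp_apply, swap_apply_self]
  right_inv χ := by
    funext x
    simp only [Function.comp_apply, swap_apply_self]

/-- **`Φ_r D_t = D_{s_r t} Φ_r`** for the diagonal parts `D_t = ∑_𝐢 i_t e(𝐢)`. [folklore] -/
theorem bkIntertwiner_mul_sum_smul_klrIdempotent {r r' : Fin n} (h : (r' : ℕ) = r + 1)
    (t : Fin n) :
    bkIntertwiner k r r' * (∑ χ ∈ residueSeqs k n, χ t • klrIdempotent k χ) =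
      (∑ χ ∈ residueSeqs k n, χ (swap r r' t) • klrIdempotent k χ) * bkIntertwiner k r r' := by
  have hsub : residueSeqs k n ⊆ residueSeqsSwap k r r' := Finset.subset_union_left
  have hlive : ∀ χ, jointEigenspace k χ ≠ ⊥ → χ ∈ residueSeqs k n :=
    fun _ hχ => mem_residueSeqs_of_ne_bot k hχ
  rw [sum_smul_klrIdempotent_subset k hsub hlive (fun χ => χ t),
    sum_smul_klrIdempotent_subset k hsub hlive (fun χ => χ (swap r r' t)),
    Finset.mul_sum, Finset.sum_mul]
  -- move `Φ` across each `e(𝐢)` and reindex by `𝐢 ↦ 𝐢 ∘ s_r`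
  have hterm : ∀ χ ∈ residueSeqsSwap k r r',
      bkIntertwiner k r r' * (χ t • klrIdempotent k χ) =
        χ t • (klrIdempotent k (χ ∘ swap r r') * bkIntertwiner k r r') := by
    intro χ _
    rw [mul_smul_comm, bkIntertwiner_mul_klrIdempotent k h]
  rw [Finset.sum_congr rfl hterm]
  refine Finset.sum_equiv (compSwapEquiv k r r') (fun χ => ?_) (fun χ _ => ?_)
  · constructor
    · exact fun hχ => comp_swap_mem_residueSeqsSwap k hχ
    · intro hχ
      have h2 := comp_swap_mem_residueSeqsSwap k hχ
      have e : (χ ∘ swap r r') ∘ swap r r' = χ := by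
        funext x
        simp only [Function.comp_apply, swap_apply_self]
      change (χ ∘ swap r r') ∘ swap r r' ∈ _ at h2
      rwa [e] at h2
  · simp only [compSwapEquiv, Equiv.coe_fn_mk, Function.comp_apply, swap_apply_self,
      smul_mul_assoc]

omit [DecidableEq k] in
/-- `Φ_r L_t = L_{s_r t} Φ_r` for every `t` (the three cases together). [folklore] -/
theorem bkIntertwiner_mul_jucysMurphy {r r' : Fin n} (h : (r' : ℕ) = r + 1) (t : Fin n) :
    bkIntertwiner k r r' * jucysMurphy k t = jucysMurphy k (swap r r' t) * bkIntertwiner k r r' := by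
  by_cases htr : t = r
  · subst htr
    rw [swap_apply_left]
    exact bkIntertwiner_mul_jucysMurphy_left k h
  by_cases htr' : t = r'
  · subst htr'
    rw [swap_apply_right]
    exact bkIntertwiner_mul_jucysMurphy_right k h
  rw [swap_apply_of_ne_of_ne htr htr']
  exact bkIntertwiner_mul_jucysMurphy_of_ne k h htr htr'

/-- **`Φ_r y_t = y_{s_r t} Φ_r`**: the intertwiners permute Brundan–Kleshchev's nilpotents
(`Φ_r y_r = y_{r+1} Φ_r`, `Φ_r y_{r+1} = y_r Φ_r`, `Φ_r y_t = y_t Φ_r` otherwise) — the intertwiner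
form of the KLR relations between `ψ_r` and the `y`'s (Hu–Mathas 2010, §3.1).
[cite: HuMathas2010, §3.1 (relations between ψ_r and y_s)] -/
theorem bkIntertwiner_mul_bkNilpotent {r r' : Fin n} (h : (r' : ℕ) = r + 1) (t : Fin n) :
    bkIntertwiner k r r' * bkNilpotent k t = bkNilpotent k (swap r r' t) * bkIntertwiner k r r' := by
  have ht : bkNilpotent k t =
      jucysMurphy k t - ∑ χ ∈ residueSeqs k n, χ t • klrIdempotent k χ :=
    eq_sub_of_add_eq (jucysMurphy_eq_bkNilpotent_add k t).symm
  have hst : bkNilpotent k (swap r r' t) =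
      jucysMurphy k (swap r r' t) - ∑ χ ∈ residueSeqs k n, χ (swap r r' t) • klrIdempotent k χ :=
    eq_sub_of_add_eq (jucysMurphy_eq_bkNilpotent_add k (swap r r' t)).symm
  rw [ht, hst, mul_sub, sub_mul, bkIntertwiner_mul_jucysMurphy k h,
    bkIntertwiner_mul_sum_smul_klrIdempotent k h]

end IntertwinerNilpotent


/-! ### `x_{r,t}^{-1} e(𝐢)` makes sense for `i_r ≠ i_t` (Brundan–Kleshchev §3.1, last paragraph)

`(L_r - L_t) e(𝐢) = ((i_r - i_t) + (y_r - y_t)) e(𝐢)` with `y_r - y_t` nilpotent, so for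
`i_r ≠ i_t` the element `(i_r - i_t) + (y_r - y_t)` is a unit of `k[S_n]` commuting with `e(𝐢)`:
the denominators `x_{r,r+1}^{-1} e(𝐢)` in Brundan–Kleshchev's `φ_r`, `p_r(𝐢)`, `q_r(𝐢)` exist. -/

section InvertibleDifferences

open Equiv

variable (k : Type*) [Field k] [DecidableEq k] {n : ℕ}

/-- `y_r - y_t` is nilpotent (commuting nilpotents). [folklore] -/
theorem isNilpotent_bkNilpotent_sub (r t : Fin n) :
    IsNilpotent (bkNilpotent k r - bkNilpotent k t) :=
  Commute.isNilpotent_sub (commute_bkNilpotent k r t) ⟨_, bkNilpotent_pow_factorial k r⟩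
    ⟨_, bkNilpotent_pow_factorial k t⟩

/-- **`(i_r - i_t) + (y_r - y_t)` is a unit for `i_r ≠ i_t`** (a nonzero scalar plus a nilpotent).
[folklore] -/
theorem isUnit_algebraMap_add_bkNilpotent_sub {c : k} (hc : c ≠ 0) (r t : Fin n) :
    IsUnit (algebraMap k (MonoidAlgebra k (Perm (Fin n))) c + (bkNilpotent k r - bkNilpotent k t)) :=
  (isNilpotent_bkNilpotent_sub k r t).isUnit_add_left_of_commute
    ((IsUnit.mk0 c hc).map (algebraMap k _)) (Algebra.commute_algebraMap_right c _)

/-- **`(L_r - L_t) e(𝐢) = ((i_r - i_t) + (y_r - y_t)) e(𝐢)`** — so `x_{r,t} e(𝐢)` is a unit times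
`e(𝐢)` whenever `i_r ≠ i_t` ("`x_{r,s}^{-1} e(𝐢)` makes sense", Brundan–Kleshchev 2009, §3.1).
[folklore] -/
theorem jucysMurphy_sub_mul_klrIdempotent (r t : Fin n) (χ : Fin n → k) :
    (jucysMurphy k r - jucysMurphy k t) * klrIdempotent k χ =
      (algebraMap k _ (χ r - χ t) + (bkNilpotent k r - bkNilpotent k t)) * klrIdempotent k χ := by
  rw [sub_mul, add_mul, sub_mul, bkNilpotent_mul_klrIdempotent, bkNilpotent_mul_klrIdempotent,
    Algebra.algebraMap_eq_smul_one, smul_mul_assoc, one_mul, sub_smul]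
  abel

/-- A left inverse on `e(𝐢)`: for `i_r ≠ i_t` there is `u` (a unit commuting with `e(𝐢)`'s
algebra of definition) with `u (L_r - L_t) e(𝐢) = e(𝐢)`. [folklore] -/
theorem exists_mul_jucysMurphy_sub_mul_klrIdempotent {r t : Fin n} {χ : Fin n → k}
    (h : χ r ≠ χ t) :
    ∃ u : MonoidAlgebra k (Perm (Fin n)),
      u * ((jucysMurphy k r - jucysMurphy k t) * klrIdempotent k χ) = klrIdempotent k χ := by
  obtain ⟨u, hu⟩ := isUnit_algebraMap_add_bkNilpotent_sub k (sub_ne_zero.2 h) r t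
  refine ⟨↑u⁻¹, ?_⟩
  rw [jucysMurphy_sub_mul_klrIdempotent, ← mul_assoc, ← hu, Units.inv_mul, one_mul]

end InvertibleDifferences


/-! ### Brundan–Kleshchev's intertwiners `φ_r` (BK §3.2) and Lemma 3.1 (EI0), (EI3)

`φ_r = s_r + ∑_{i_r ≠ i_{r+1}} x_{r,r+1}^{-1} e(𝐢) + ∑_{i_r = i_{r+1}} e(𝐢)` (Brundan–Kleshchev 2009,
(3.3)); equivalently `φ_r e(𝐢) = θ_r x_{r,r+1}^{-1} e(𝐢)` if `i_r ≠ i_{r+1}` and `= (s_r + 1) e(𝐢)` if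
`i_r = i_{r+1}`, where `θ_r = s_r x_{r,r+1} + 1` is `bkIntertwiner` and `x_{r,r+1}^{-1} e(𝐢)` is
`Ring.inverse ((i_r - i_{r+1}) + (y_r - y_{r+1})) e(𝐢)`. We prove (EI0) `φ_r e(𝐢) = e(s_r 𝐢) φ_r`
and (EI3) `φ_r x_{r+1} e(𝐢) = x_r φ_r e(𝐢)` (`i_r ≠ i_{r+1}`), `= (x_r φ_r + 1 - x_{r,r+1}) e(𝐢)`
(`i_r = i_{r+1}`) of Brundan–Kleshchev's Lemma 3.1. -/

section BKPhi

open Equiv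

variable (k : Type*) [Field k] [DecidableEq k] {n : ℕ}

/-- `(c) + (y_r - y_{r'})`: the element whose product with `e(𝐢)` is `x_{r,r'} e(𝐢)` when
`c = i_r - i_{r'}` (`jucysMurphy_sub_mul_klrIdempotent`); a unit for `c ≠ 0`. [folklore] -/
def bkDiffUnit (r r' : Fin n) (c : k) : MonoidAlgebra k (Perm (Fin n)) :=
  algebraMap k _ c + (bkNilpotent k r - bkNilpotent k r')

/-- **Brundan–Kleshchev's intertwiner `φ_r`** (Brundan–Kleshchev 2009, (3.3)):
`φ_r = ∑_𝐢 φ_r e(𝐢)` with `φ_r e(𝐢) = (s_r + 1) e(𝐢)` if `i_r = i_{r+1}` and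
`φ_r e(𝐢) = θ_r x_{r,r+1}^{-1} e(𝐢)` otherwise. [folklore] -/
def bkPhi (r r' : Fin n) : MonoidAlgebra k (Perm (Fin n)) :=
  ∑ χ ∈ residueSeqs k n,
    if χ r = χ r' then (MonoidAlgebra.of k _ (swap r r') + 1) * klrIdempotent k χ
    else bkIntertwiner k r r' * Ring.inverse (bkDiffUnit k r r' (χ r - χ r')) * klrIdempotent k χ

/-- The `L_t` commute with the `y_r`. [folklore] -/
theorem commute_jucysMurphy_bkNilpotent (t r : Fin n) :
    Commute (jucysMurphy k t) (bkNilpotent k r) := by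
  have hr : bkNilpotent k r = jucysMurphy k r - ∑ χ ∈ residueSeqs k n, χ r • klrIdempotent k χ :=
    eq_sub_of_add_eq (jucysMurphy_eq_bkNilpotent_add k r).symm
  rw [hr]
  exact (commute_jucysMurphy k t r).sub_right (jucysMurphy_mul_sum_smul_klrIdempotent_comm k t r)

/-- The `e(𝐣)` commute with the `y_r`. [folklore] -/
theorem commute_klrIdempotent_bkNilpotent (χ : Fin n → k) (r : Fin n) :
    Commute (klrIdempotent k χ) (bkNilpotent k r) := by
  change klrIdempotent k χ * bkNilpotent k r = bkNilpotent k r * klrIdempotent k χ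
  rw [klrIdempotent_mul_bkNilpotent, bkNilpotent_mul_klrIdempotent]

/-- `e(𝐣)` commutes with `bkDiffUnit`. [folklore] -/
theorem commute_klrIdempotent_bkDiffUnit (χ : Fin n → k) (r r' : Fin n) (c : k) :
    Commute (klrIdempotent k χ) (bkDiffUnit k r r' c) :=
  (Algebra.commute_algebraMap_right c _).add_right
    ((commute_klrIdempotent_bkNilpotent k χ r).sub_right (commute_klrIdempotent_bkNilpotent k χ r'))

/-- `L_t` commutes with `bkDiffUnit`. [folklore] -/
theorem commute_jucysMurphy_bkDiffUnit (t r r' : Fin n) (c : k) :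
    Commute (jucysMurphy k t) (bkDiffUnit k r r' c) :=
  (Algebra.commute_algebraMap_right c _).add_right
    ((commute_jucysMurphy_bkNilpotent k t r).sub_right (commute_jucysMurphy_bkNilpotent k t r'))

/-- Commuting with a unit implies commuting with its `Ring.inverse`. [folklore] -/
theorem commute_ringInverse_of_commute {A : Type*} [Ring A] {a u : A} (h : Commute a u)
    (hu : IsUnit u) : Commute a (Ring.inverse u) := by
  obtain ⟨v, rfl⟩ := hu
  rw [Ring.inverse_unit]
  exact h.units_inv_right

/-- A semiconjugation of units passes to `Ring.inverse`s: `θ u' = u'' θ ⇒ θ u'⁻¹ = u''⁻¹ θ`.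
[folklore] -/
theorem mul_ringInverse_of_semiconj {A : Type*} [Ring A] {θ u' u'' : A} (h : θ * u' = u'' * θ)
    (hu' : IsUnit u') (hu'' : IsUnit u'') : θ * Ring.inverse u' = Ring.inverse u'' * θ := by
  calc θ * Ring.inverse u'
      = Ring.inverse u'' * u'' * θ * Ring.inverse u' := by rw [Ring.inverse_mul_cancel _ hu'', one_mul]
    _ = Ring.inverse u'' * (θ * u') * Ring.inverse u' := by rw [mul_assoc (Ring.inverse u''), ← h]
    _ = Ring.inverse u'' * θ := by rw [mul_assoc, mul_assoc, Ring.mul_inverse_cancel _ hu', mul_one]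

/-- `bkDiffUnit r r' c` is a unit for `c ≠ 0`. [folklore] -/
theorem isUnit_bkDiffUnit (r r' : Fin n) {c : k} (hc : c ≠ 0) : IsUnit (bkDiffUnit k r r' c) :=
  isUnit_algebraMap_add_bkNilpotent_sub k hc r r'

/-- `θ_r (c + y_r - y_{r'}) = (c + y_{r'} - y_r) θ_r`. [folklore] -/
theorem bkIntertwiner_mul_bkDiffUnit {r r' : Fin n} (h : (r' : ℕ) = r + 1) (c : k) :
    bkIntertwiner k r r' * bkDiffUnit k r r' c = bkDiffUnit k r' r c * bkIntertwiner k r r' := by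
  have hrr' : r ≠ r' := by
    intro e; rw [Fin.ext_iff] at e; omega
  rw [bkDiffUnit, bkDiffUnit, mul_add, add_mul, mul_sub, sub_mul,
    bkIntertwiner_mul_bkNilpotent k h r, bkIntertwiner_mul_bkNilpotent k h r', swap_apply_left,
    swap_apply_right, (Algebra.commute_algebraMap_right c (bkIntertwiner k r r')).eq]

/-- **`φ_r e(𝐢)`, explicitly** (the defining cases of Brundan–Kleshchev's `φ_r`). [folklore] -/
theorem bkPhi_mul_klrIdempotent (r r' : Fin n) (χ : Fin n → k) :
    bkPhi k r r' * klrIdempotent k χ =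
      if χ r = χ r' then (MonoidAlgebra.of k _ (swap r r') + 1) * klrIdempotent k χ
      else bkIntertwiner k r r' * Ring.inverse (bkDiffUnit k r r' (χ r - χ r')) * klrIdempotent k χ := by
  by_cases h0 : klrIdempotent k χ = 0
  · rw [h0]; simp
  have hχ : χ ∈ residueSeqs k n := by
    refine mem_residueSeqs_of_ne_bot k fun hbot => h0 ?_
    have hmem := klrIdempotent_mem k χ
    rwa [hbot, Submodule.mem_bot] at hmem
  rw [bkPhi, Finset.sum_mul, Finset.sum_eq_single_of_mem χ hχ]
  · split_ifs <;> rw [mul_assoc, klrIdempotent_mul_self]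
  · intro χ' _ hne
    split_ifs <;> rw [mul_assoc, klrIdempotent_mul_klrIdempotent_of_ne k hne, mul_zero]

omit [DecidableEq k] in
/-- For `i_r = i_{r'}`: `(s_r + 1) e(𝐢) ∈ M_𝐢` (as `s_r M_𝐢 ⊆ M_𝐢 + M_{s_r𝐢} = M_𝐢`). [folklore] -/
theorem of_swap_add_one_mul_klrIdempotent_mem {r r' : Fin n} (h : (r' : ℕ) = r + 1)
    {χ : Fin n → k} (hχ : χ r = χ r') :
    (MonoidAlgebra.of k _ (swap r r') + 1) * klrIdempotent k χ ∈ jointEigenspace k χ := by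
  have hfix : χ ∘ swap r r' = χ := by
    funext x
    simp only [Function.comp_apply]
    by_cases h1 : x = r
    · subst h1; rw [swap_apply_left, hχ]
    by_cases h2 : x = r'
    · subst h2; rw [swap_apply_right, hχ]
    rw [swap_apply_of_ne_of_ne h1 h2]
  rw [add_mul, one_mul]
  refine Submodule.add_mem _ ?_ (klrIdempotent_mem k χ)
  have hmem := of_swap_mul_mem_sup_jointEigenspace k h (klrIdempotent_mem k χ)
  rwa [hfix, sup_idem] at hmem

/-- **(EI0) `φ_r e(𝐢) = e(s_r 𝐢) φ_r`** (Brundan–Kleshchev 2009, Lemma 3.1 (3.6)). [folklore] -/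
theorem bkPhi_mul_klrIdempotent_eq {r r' : Fin n} (h : (r' : ℕ) = r + 1) (χ : Fin n → k) :
    bkPhi k r r' * klrIdempotent k χ = klrIdempotent k (χ ∘ swap r r') * bkPhi k r r' := by
  have hss : ∀ ψ : Fin n → k, (ψ ∘ swap r r') ∘ swap r r' = ψ := fun ψ => by
    funext x; simp only [Function.comp_apply, swap_apply_self]
  rw [bkPhi_mul_klrIdempotent, bkPhi, Finset.mul_sum]
  -- each term of `e(s_r𝐢) φ_r`
  have hterm : ∀ χ' ∈ residueSeqs k n,
      klrIdempotent k (χ ∘ swap r r') *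
          (if χ' r = χ' r' then (MonoidAlgebra.of k _ (swap r r') + 1) * klrIdempotent k χ'
           else bkIntertwiner k r r' * Ring.inverse (bkDiffUnit k r r' (χ' r - χ' r')) *
             klrIdempotent k χ') =
        if χ' = χ then
          (if χ r = χ r' then (MonoidAlgebra.of k _ (swap r r') + 1) * klrIdempotent k χ
           else bkIntertwiner k r r' * Ring.inverse (bkDiffUnit k r r' (χ r - χ r')) *
             klrIdempotent k χ)
        else 0 := by
    intro χ' _
    by_cases hc' : χ' r = χ' r'
    · rw [if_pos hc']
      have hmem := of_swap_add_one_mul_klrIdempotent_mem k h hc'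
      by_cases he : χ' = χ
      · subst he
        rw [if_pos rfl, if_pos hc']
        have hfix : χ' ∘ swap r r' = χ' := by
          funext x
          simp only [Function.comp_apply]
          by_cases h1 : x = r
          · subst h1; rw [swap_apply_left, hc']
          by_cases h2 : x = r'
          · subst h2; rw [swap_apply_right, hc']
          rw [swap_apply_of_ne_of_ne h1 h2]
        rw [hfix]
        exact klrIdempotent_mul_of_mem k hmem
      · rw [if_neg he]
        refine klrIdempotent_mul_of_mem_ne k (fun e => he ?_) hmem
        -- `χ' = χ ∘ s` with `χ'` `s`-fixed forces `χ' = χ`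
        have e2 := congrArg (fun f => f ∘ swap r r') e
        simp only [hss] at e2
        have hfix : χ' ∘ swap r r' = χ' := by
          funext x
          simp only [Function.comp_apply]
          by_cases h1 : x = r
          · subst h1; rw [swap_apply_left, hc']
          by_cases h2 : x = r'
          · subst h2; rw [swap_apply_right, hc']
          rw [swap_apply_of_ne_of_ne h1 h2]
        rw [hfix] at e2
        exact e2
    · rw [if_neg hc']
      -- `e(s𝐢) θ u⁻¹ e(𝐢') = θ e(𝐢) u⁻¹ e(𝐢') = θ u⁻¹ e(𝐢) e(𝐢')`
      have hcomm : Commute (klrIdempotent k χ) (Ring.inverse (bkDiffUnit k r r' (χ' r - χ' r'))) :=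
        commute_ringInverse_of_commute (commute_klrIdempotent_bkDiffUnit k χ r r' _)
          (isUnit_bkDiffUnit k r r' (sub_ne_zero.2 hc'))
      rw [← mul_assoc, ← mul_assoc, ← bkIntertwiner_mul_klrIdempotent k h, mul_assoc _ (klrIdempotent k χ),
        hcomm.eq, ← mul_assoc, mul_assoc _ _ (klrIdempotent k χ')]
      by_cases he : χ' = χ
      · subst he
        rw [if_pos rfl, if_neg hc', klrIdempotent_mul_self]
      · rw [if_neg he, klrIdempotent_mul_klrIdempotent_of_ne k (Ne.symm he), mul_zero]
  rw [Finset.sum_congr rfl hterm, Finset.sum_ite_eq']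
  by_cases hmemS : χ ∈ residueSeqs k n
  · rw [if_pos hmemS]
  · rw [if_neg hmemS]
    have h0 : klrIdempotent k χ = 0 := by
      have hbot : jointEigenspace k χ = ⊥ := by
        by_contra hne
        exact hmemS (mem_residueSeqs_of_ne_bot k hne)
      have hmem := klrIdempotent_mem k χ
      rwa [hbot, Submodule.mem_bot] at hmem
    simp [h0]

/-- **(EI3) `φ_r x_{r+1} e(𝐢) = x_r φ_r e(𝐢)` for `i_r ≠ i_{r+1}`, and
`φ_r x_{r+1} e(𝐢) = (x_r φ_r + 1 - x_{r,r+1}) e(𝐢)` for `i_r = i_{r+1}`**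
(Brundan–Kleshchev 2009, Lemma 3.1 (3.9)). [folklore] -/
theorem bkPhi_mul_jucysMurphy_succ_mul_klrIdempotent {r r' : Fin n} (h : (r' : ℕ) = r + 1)
    (χ : Fin n → k) :
    bkPhi k r r' * jucysMurphy k r' * klrIdempotent k χ =
      if χ r = χ r' then
        (jucysMurphy k r * bkPhi k r r' + 1 - (jucysMurphy k r - jucysMurphy k r')) * klrIdempotent k χ
      else jucysMurphy k r * bkPhi k r r' * klrIdempotent k χ := by
  -- move `x_{r'}` past `e(𝐢)` and use the explicit form of `φ_r e(𝐢)`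
  rw [mul_assoc, (jucysMurphy_mul_klrIdempotent k r' χ), ← mul_assoc, bkPhi_mul_klrIdempotent]
  split_ifs with hc
  · -- `(s + 1) e x_{r'} = (s + 1) x_{r'} e = (x_r s + 1 + x_{r'}) e = (x_r (s + 1) + 1 - x_{r,r'}) e`
    have key : (MonoidAlgebra.of k _ (swap r r') + 1) * jucysMurphy k r' =
        jucysMurphy k r * (MonoidAlgebra.of k _ (swap r r') + 1) + 1 -
          (jucysMurphy k r - jucysMurphy k r') := by
      rw [add_mul, one_mul, of_swap_mul_jucysMurphy_succ k h, mul_add, mul_one]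
      abel
    have hL : (MonoidAlgebra.of k _ (swap r r') + 1) * klrIdempotent k χ * jucysMurphy k r' =
        ((MonoidAlgebra.of k _ (swap r r') + 1) * jucysMurphy k r') * klrIdempotent k χ := by
      rw [mul_assoc, ← jucysMurphy_mul_klrIdempotent, ← mul_assoc]
    have hR : (jucysMurphy k r * bkPhi k r r' + 1 - (jucysMurphy k r - jucysMurphy k r')) *
          klrIdempotent k χ =
        (jucysMurphy k r * (MonoidAlgebra.of k _ (swap r r') + 1) + 1 -
          (jucysMurphy k r - jucysMurphy k r')) * klrIdempotent k χ := by
      conv_lhs => rw [sub_mul, add_mul, mul_assoc (jucysMurphy k r) (bkPhi k r r'),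
        bkPhi_mul_klrIdempotent k r r' χ, if_pos hc, ← mul_assoc]
      conv_rhs => rw [sub_mul, add_mul]
    rw [hL, hR, key]
  · have hu := isUnit_bkDiffUnit k r r' (sub_ne_zero.2 hc)
    have hcomm : Commute (jucysMurphy k r') (Ring.inverse (bkDiffUnit k r r' (χ r - χ r'))) :=
      commute_ringInverse_of_commute (commute_jucysMurphy_bkDiffUnit k r' r r' _) hu
    rw [mul_assoc (jucysMurphy k r), bkPhi_mul_klrIdempotent, if_neg hc, mul_assoc,
      ← jucysMurphy_mul_klrIdempotent, ← mul_assoc, mul_assoc (bkIntertwiner k r r'), ← hcomm.eq,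
      ← mul_assoc, bkIntertwiner_mul_jucysMurphy_right k h, mul_assoc, mul_assoc, mul_assoc]

end BKPhi


/-! ### Brundan–Kleshchev Lemma 3.1, continued: (EI1) and (EI4) -/

section BKPhi2

open Equiv

variable (k : Type*) [Field k] [DecidableEq k] {n : ℕ}

/-- **(EI1) `φ_r x_t = x_t φ_r` for `t ≠ r, r+1`** (Brundan–Kleshchev 2009, Lemma 3.1 (3.7)).
[folklore] -/
theorem bkPhi_mul_jucysMurphy_of_ne {r r' t : Fin n} (h : (r' : ℕ) = r + 1) (htr : t ≠ r)
    (htr' : t ≠ r') : bkPhi k r r' * jucysMurphy k t = jucysMurphy k t * bkPhi k r r' := by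
  rw [bkPhi, Finset.sum_mul, Finset.mul_sum]
  refine Finset.sum_congr rfl fun χ _ => ?_
  split_ifs with hc
  · rw [mul_assoc, ← jucysMurphy_mul_klrIdempotent, ← mul_assoc, ← mul_assoc (jucysMurphy k t),
      add_mul, one_mul, mul_add, mul_one, of_swap_mul_jucysMurphy_of_ne k h htr htr']
  · have hu := isUnit_bkDiffUnit k r r' (sub_ne_zero.2 hc)
    have hcomm : Commute (jucysMurphy k t) (Ring.inverse (bkDiffUnit k r r' (χ r - χ r'))) :=
      commute_ringInverse_of_commute (commute_jucysMurphy_bkDiffUnit k t r r' _) hu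
    rw [mul_assoc, ← jucysMurphy_mul_klrIdempotent, ← mul_assoc, ← mul_assoc (jucysMurphy k t),
      ← mul_assoc (jucysMurphy k t), ← bkIntertwiner_mul_jucysMurphy_of_ne k h htr htr',
      mul_assoc (bkIntertwiner k r r') (Ring.inverse _) (jucysMurphy k t), ← hcomm.eq, ← mul_assoc]

/-- **(EI4) `x_{r+1} φ_r e(𝐢) = φ_r x_r e(𝐢)` for `i_r ≠ i_{r+1}`, and
`x_{r+1} φ_r e(𝐢) = (φ_r x_r + 1 - x_{r,r+1}) e(𝐢)` for `i_r = i_{r+1}`**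
(Brundan–Kleshchev 2009, Lemma 3.1 (3.10)). [folklore] -/
theorem jucysMurphy_succ_mul_bkPhi_mul_klrIdempotent {r r' : Fin n} (h : (r' : ℕ) = r + 1)
    (χ : Fin n → k) :
    jucysMurphy k r' * bkPhi k r r' * klrIdempotent k χ =
      if χ r = χ r' then
        (bkPhi k r r' * jucysMurphy k r + 1 - (jucysMurphy k r - jucysMurphy k r')) * klrIdempotent k χ
      else bkPhi k r r' * jucysMurphy k r * klrIdempotent k χ := by
  rw [mul_assoc, bkPhi_mul_klrIdempotent]
  split_ifs with hc
  · have key : jucysMurphy k r' * (MonoidAlgebra.of k _ (swap r r') + 1) =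
        (MonoidAlgebra.of k _ (swap r r') + 1) * jucysMurphy k r + 1 -
          (jucysMurphy k r - jucysMurphy k r') := by
      rw [mul_add, mul_one, jucysMurphy_succ_mul_swap k h, add_mul, one_mul]
      abel
    have hR : (bkPhi k r r' * jucysMurphy k r + 1 - (jucysMurphy k r - jucysMurphy k r')) *
          klrIdempotent k χ =
        ((MonoidAlgebra.of k _ (swap r r') + 1) * jucysMurphy k r + 1 -
          (jucysMurphy k r - jucysMurphy k r')) * klrIdempotent k χ := by
      conv_lhs => rw [sub_mul, add_mul, mul_assoc (bkPhi k r r') (jucysMurphy k r),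
        jucysMurphy_mul_klrIdempotent, ← mul_assoc, bkPhi_mul_klrIdempotent k r r' χ, if_pos hc,
        mul_assoc, ← jucysMurphy_mul_klrIdempotent, ← mul_assoc]
      conv_rhs => rw [sub_mul, add_mul]
    rw [hR, ← mul_assoc, key]
  · have hu := isUnit_bkDiffUnit k r r' (sub_ne_zero.2 hc)
    have hcomm : Commute (jucysMurphy k r) (Ring.inverse (bkDiffUnit k r r' (χ r - χ r'))) :=
      commute_ringInverse_of_commute (commute_jucysMurphy_bkDiffUnit k r r r' _) hu
    -- RHS: `φ x_r e = φ e x_r = θ u⁻¹ e x_r = θ u⁻¹ x_r e = θ x_r u⁻¹ e = x_{r'} θ u⁻¹ e`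
    conv_rhs => rw [mul_assoc, jucysMurphy_mul_klrIdempotent, ← mul_assoc,
      bkPhi_mul_klrIdempotent k r r' χ, if_neg hc, mul_assoc _ (klrIdempotent k χ) (jucysMurphy k r),
      ← jucysMurphy_mul_klrIdempotent, ← mul_assoc,
      mul_assoc (bkIntertwiner k r r') (Ring.inverse _) (jucysMurphy k r), ← hcomm.eq, ← mul_assoc,
      bkIntertwiner_mul_jucysMurphy_left k h]
    conv_lhs => rw [← mul_assoc, ← mul_assoc]


/-- `Ring.inverse (-u) = -Ring.inverse u` for a unit `u`. [folklore] -/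
theorem ringInverse_neg {A : Type*} [Ring A] {u : A} (hu : IsUnit u) :
    Ring.inverse (-u) = -Ring.inverse u := by
  calc Ring.inverse (-u) = Ring.inverse (-u) * ((-u) * -Ring.inverse u) := by
        rw [neg_mul_neg, Ring.mul_inverse_cancel _ hu, mul_one]
    _ = -Ring.inverse u := by rw [← mul_assoc, Ring.inverse_mul_cancel _ hu.neg, one_mul]

/-- `bkDiffUnit r' r c = -bkDiffUnit r r' (-c)`. [folklore] -/
theorem bkDiffUnit_swap (r r' : Fin n) (c : k) :
    bkDiffUnit k r' r c = -bkDiffUnit k r r' (-c) := by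
  rw [bkDiffUnit, bkDiffUnit, map_neg]
  abel

/-- `θ_r u⁻¹ = -(u')⁻¹ θ_r` for `u = (c) + y_r - y_{r'}`, `u' = (-c) + y_r - y_{r'}`, `c ≠ 0`.
[folklore] -/
theorem bkIntertwiner_mul_ringInverse_bkDiffUnit {r r' : Fin n} (h : (r' : ℕ) = r + 1) {c : k}
    (hc : c ≠ 0) :
    bkIntertwiner k r r' * Ring.inverse (bkDiffUnit k r r' c) =
      -Ring.inverse (bkDiffUnit k r r' (-c)) * bkIntertwiner k r r' := by
  have hsemi : bkIntertwiner k r r' * bkDiffUnit k r r' c =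
      -bkDiffUnit k r r' (-c) * bkIntertwiner k r r' := by
    rw [bkIntertwiner_mul_bkDiffUnit k h, bkDiffUnit_swap]
  rw [mul_ringInverse_of_semiconj hsemi (isUnit_bkDiffUnit k r r' hc)
    ((isUnit_bkDiffUnit k r r' (neg_ne_zero.2 hc)).neg),
    ringInverse_neg (isUnit_bkDiffUnit k r r' (neg_ne_zero.2 hc))]

/-- **(EI5) `φ_r² e(𝐢) = (1 - x_{r,r+1}^{-2}) e(𝐢)` for `i_r ≠ i_{r+1}` and `φ_r² e(𝐢) = 2 φ_r e(𝐢)`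
for `i_r = i_{r+1}`** (Brundan–Kleshchev 2009, Lemma 3.1 (3.11); here `x_{r,r+1}^{-1} e(𝐢)` is
`Ring.inverse ((i_r - i_{r+1}) + y_r - y_{r+1}) e(𝐢)`). [folklore] -/
theorem bkPhi_mul_bkPhi_mul_klrIdempotent {r r' : Fin n} (h : (r' : ℕ) = r + 1) (χ : Fin n → k) :
    bkPhi k r r' * bkPhi k r r' * klrIdempotent k χ =
      if χ r = χ r' then 2 • (bkPhi k r r' * klrIdempotent k χ)
      else (1 - Ring.inverse (bkDiffUnit k r r' (χ r - χ r')) ^ 2) * klrIdempotent k χ := by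
  have hss : ∀ ψ : Fin n → k, (ψ ∘ swap r r') ∘ swap r r' = ψ := fun ψ => by
    funext x; simp only [Function.comp_apply, swap_apply_self]
  -- `φ φ e = φ e' φ = (φ e') φ` with `e' = e(s_r 𝐢)`, and `e' φ = φ e`
  have hstep : bkPhi k r r' * bkPhi k r r' * klrIdempotent k χ =
      bkPhi k r r' * klrIdempotent k (χ ∘ swap r r') * bkPhi k r r' := by
    rw [mul_assoc, bkPhi_mul_klrIdempotent_eq k h, ← mul_assoc]
  split_ifs with hc
  · -- equal case: `s_r 𝐢 = 𝐢`, `φ e = (s+1) e`, `(s+1)² = 2(s+1)`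
    have hfix : χ ∘ swap r r' = χ := by
      funext x
      simp only [Function.comp_apply]
      by_cases h1 : x = r
      · subst h1; rw [swap_apply_left, hc]
      by_cases h2 : x = r'
      · subst h2; rw [swap_apply_right, hc]
      rw [swap_apply_of_ne_of_ne h1 h2]
    have hφe : bkPhi k r r' * klrIdempotent k χ =
        (MonoidAlgebra.of k _ (swap r r') + 1) * klrIdempotent k χ := by
      rw [bkPhi_mul_klrIdempotent, if_pos hc]
    have heφ : klrIdempotent k χ * bkPhi k r r' = bkPhi k r r' * klrIdempotent k χ := by
      rw [bkPhi_mul_klrIdempotent_eq k h, hfix]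
    rw [hstep, hfix, hφe, mul_assoc, heφ, hφe, ← mul_assoc]
    have hsq : (MonoidAlgebra.of k (Perm (Fin n)) (swap r r') + 1) *
        (MonoidAlgebra.of k _ (swap r r') + 1) = 2 • (MonoidAlgebra.of k _ (swap r r') + 1) := by
      have hss1 := of_swap_mul_self k r r'
      rw [add_mul, one_mul, mul_add, mul_one, hss1, two_smul]
      abel
    rw [hsq, smul_mul_assoc]
  · -- unequal case
    have hc' : (χ ∘ swap r r') r ≠ (χ ∘ swap r r') r' := by
      simp only [Function.comp_apply, swap_apply_left, swap_apply_right]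
      exact Ne.symm hc
    have hcs : (χ ∘ swap r r') r - (χ ∘ swap r r') r' = -(χ r - χ r') := by
      simp only [Function.comp_apply, swap_apply_left, swap_apply_right]
      ring
    set u := bkDiffUnit k r r' (χ r - χ r') with hu_def
    have hu : IsUnit u := isUnit_bkDiffUnit k r r' (sub_ne_zero.2 hc)
    have hu' : IsUnit (bkDiffUnit k r r' (-(χ r - χ r'))) :=
      isUnit_bkDiffUnit k r r' (neg_ne_zero.2 (sub_ne_zero.2 hc))
    -- `φ e' = θ (u')⁻¹ e'`
    have hφe' : bkPhi k r r' * klrIdempotent k (χ ∘ swap r r') =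
        bkIntertwiner k r r' * Ring.inverse (bkDiffUnit k r r' (-(χ r - χ r'))) *
          klrIdempotent k (χ ∘ swap r r') := by
      rw [bkPhi_mul_klrIdempotent, if_neg hc', hcs]
    -- `e' φ = φ e = θ u⁻¹ e`
    have he'φ : klrIdempotent k (χ ∘ swap r r') * bkPhi k r r' =
        bkIntertwiner k r r' * Ring.inverse u * klrIdempotent k χ := by
      rw [← bkPhi_mul_klrIdempotent_eq k h, bkPhi_mul_klrIdempotent, if_neg hc]
    -- `θ (u')⁻¹ = -u⁻¹ θ`
    have hmove : bkIntertwiner k r r' * Ring.inverse (bkDiffUnit k r r' (-(χ r - χ r'))) =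
        -Ring.inverse u * bkIntertwiner k r r' := by
      rw [bkIntertwiner_mul_ringInverse_bkDiffUnit k h (neg_ne_zero.2 (sub_ne_zero.2 hc)), neg_neg]
    -- commuting facts
    have hcomm_xu : Commute (jucysMurphy k r - jucysMurphy k r') u :=
      (commute_jucysMurphy_bkDiffUnit k r r r' _).sub_left (commute_jucysMurphy_bkDiffUnit k r' r r' _)
    have hcomm_xinv : Commute (jucysMurphy k r - jucysMurphy k r') (Ring.inverse u) :=
      commute_ringInverse_of_commute hcomm_xu hu
    have hcomm_einv : Commute (klrIdempotent k χ) (Ring.inverse u) :=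
      commute_ringInverse_of_commute (commute_klrIdempotent_bkDiffUnit k χ r r' _) hu
    have hcomm_eu : Commute (klrIdempotent k χ) u := commute_klrIdempotent_bkDiffUnit k χ r r' _
    have hxe : (jucysMurphy k r - jucysMurphy k r') * klrIdempotent k χ = u * klrIdempotent k χ :=
      jucysMurphy_sub_mul_klrIdempotent k r r' χ
    -- `u⁻¹ x² u⁻¹ e = e`
    have hkey : Ring.inverse u * (jucysMurphy k r - jucysMurphy k r') ^ 2 * Ring.inverse u *
        klrIdempotent k χ = klrIdempotent k χ := by
      calc Ring.inverse u * (jucysMurphy k r - jucysMurphy k r') ^ 2 * Ring.inverse u *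
            klrIdempotent k χ
          = Ring.inverse u * (jucysMurphy k r - jucysMurphy k r') *
              ((jucysMurphy k r - jucysMurphy k r') * klrIdempotent k χ) * Ring.inverse u := by
            rw [sq, mul_assoc _ (Ring.inverse u) (klrIdempotent k χ), ← hcomm_einv.eq]
            noncomm_ring
        _ = Ring.inverse u * (jucysMurphy k r - jucysMurphy k r') *
              (u * klrIdempotent k χ) * Ring.inverse u := by rw [hxe]
        _ = Ring.inverse u * u * ((jucysMurphy k r - jucysMurphy k r') * klrIdempotent k χ) *
              Ring.inverse u := by
            rw [← mul_assoc, mul_assoc (Ring.inverse u) _ u, hcomm_xu.eq, ← mul_assoc,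
              mul_assoc _ (jucysMurphy k r - jucysMurphy k r') (klrIdempotent k χ)]
        _ = klrIdempotent k χ := by
            rw [Ring.inverse_mul_cancel _ hu, one_mul, hxe, mul_assoc, hcomm_einv.eq, ← mul_assoc,
              Ring.mul_inverse_cancel _ hu, one_mul]
    rw [hstep, hφe', mul_assoc _ (klrIdempotent k (χ ∘ swap r r')), he'φ, hmove]
    -- `-u⁻¹ θ θ u⁻¹ e = -u⁻¹ (1 - x²) u⁻¹ e = (1 - u⁻²) e`
    calc -Ring.inverse u * bkIntertwiner k r r' * (bkIntertwiner k r r' * Ring.inverse u * klrIdempotent k χ)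
        = -(Ring.inverse u * (bkIntertwiner k r r' * bkIntertwiner k r r') * Ring.inverse u *
            klrIdempotent k χ) := by noncomm_ring
      _ = -(Ring.inverse u * Ring.inverse u * klrIdempotent k χ -
            Ring.inverse u * (jucysMurphy k r - jucysMurphy k r') ^ 2 * Ring.inverse u *
              klrIdempotent k χ) := by
          rw [bkIntertwiner_mul_self k h]; noncomm_ring
      _ = (1 - Ring.inverse u ^ 2) * klrIdempotent k χ := by
          rw [hkey, sq]; noncomm_ring

end BKPhi2


/-! ### Brundan–Kleshchev Lemma 3.1 (EI2): `φ_r φ_t = φ_t φ_r` for `|r - t| > 1`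

On the way: `s_r` commutes with the diagonal parts `D_t` and hence with the nilpotents `y_t` for
`t ∉ {r, r+1}` (deduced from `θ_r D_t = D_t θ_r`, `θ_r = s_r x_{r,r+1} + 1`, by cancelling the unit
`x_{r,r+1} e(𝐢)` for `i_r ≠ i_{r+1}` and using `s_r e(𝐢) ∈ M_𝐢` for `i_r = i_{r+1}`). -/

section BKPhiFar

open Equiv

variable (k : Type*) [Field k] [DecidableEq k] {n : ℕ}

omit [DecidableEq k] in
/-- Disjoint transpositions commute in `k[S_n]`. [folklore] -/
theorem of_swap_mul_of_swap_comm {r r' t t' : Fin n} (h1 : t ≠ r) (h2 : t ≠ r') (h3 : t' ≠ r)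
    (h4 : t' ≠ r') :
    MonoidAlgebra.of k _ (swap r r') * MonoidAlgebra.of k _ (swap t t') =
      MonoidAlgebra.of k _ (swap t t') * MonoidAlgebra.of k _ (swap r r') := by
  rw [← map_mul, ← map_mul]
  congr 1
  refine (Perm.Disjoint.commute (fun x => ?_)).eq
  by_cases hx : x = r
  · subst hx; exact Or.inr (swap_apply_of_ne_of_ne h1.symm h3.symm)
  by_cases hx' : x = r'
  · subst hx'; exact Or.inr (swap_apply_of_ne_of_ne h2.symm h4.symm)
  exact Or.inl (swap_apply_of_ne_of_ne hx hx')

/-- `D_t w = i_t w` for `w ∈ M_𝐢` (`D_t = ∑_𝐣 j_t e(𝐣)`). [folklore] -/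
theorem sum_smul_klrIdempotent_mul_of_mem (t : Fin n) {χ : Fin n → k}
    {w : MonoidAlgebra k (Perm (Fin n))} (hw : w ∈ jointEigenspace k χ) :
    (∑ ψ ∈ residueSeqs k n, ψ t • klrIdempotent k ψ) * w = χ t • w := by
  by_cases h0 : w = 0
  · rw [h0, mul_zero, smul_zero]
  have hχ : χ ∈ residueSeqs k n := by
    refine mem_residueSeqs_of_ne_bot k fun hbot => h0 ?_
    rw [hbot, Submodule.mem_bot] at hw
    exact hw
  rw [Finset.sum_mul, Finset.sum_eq_single_of_mem χ hχ]
  · rw [smul_mul_assoc, klrIdempotent_mul_of_mem k hw]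
  · intro ψ _ hne
    rw [smul_mul_assoc, klrIdempotent_mul_of_mem_ne k (Ne.symm hne) hw, smul_zero]

omit [DecidableEq k] in
/-- For `i_r = i_{r+1}`: `s_r e(𝐢) ∈ M_𝐢`. [folklore] -/
theorem of_swap_mul_klrIdempotent_mem {r r' : Fin n} (h : (r' : ℕ) = r + 1) {χ : Fin n → k}
    (hχ : χ r = χ r') :
    MonoidAlgebra.of k _ (swap r r') * klrIdempotent k χ ∈ jointEigenspace k χ := by
  have hfix : χ ∘ swap r r' = χ := by
    funext x
    simp only [Function.comp_apply]
    by_cases h1 : x = r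
    · subst h1; rw [swap_apply_left, hχ]
    by_cases h2 : x = r'
    · subst h2; rw [swap_apply_right, hχ]
    rw [swap_apply_of_ne_of_ne h1 h2]
  have hmem := of_swap_mul_mem_sup_jointEigenspace k h (klrIdempotent_mem k χ)
  rwa [hfix, sup_idem] at hmem

/-- **`s_r D_t = D_t s_r` for `t ∉ {r, r+1}`.** [folklore] -/
theorem of_swap_mul_sum_smul_klrIdempotent_comm {r r' t : Fin n} (h : (r' : ℕ) = r + 1)
    (htr : t ≠ r) (htr' : t ≠ r') :
    MonoidAlgebra.of k _ (swap r r') * (∑ χ ∈ residueSeqs k n, χ t • klrIdempotent k χ) =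
      (∑ χ ∈ residueSeqs k n, χ t • klrIdempotent k χ) * MonoidAlgebra.of k _ (swap r r') := by
  set D := ∑ χ ∈ residueSeqs k n, χ t • klrIdempotent k χ with hD
  set C := MonoidAlgebra.of k _ (swap r r') * D - D * MonoidAlgebra.of k _ (swap r r') with hC
  rw [← sub_eq_zero, ← hC]
  have hθ : bkIntertwiner k r r' * D = D * bkIntertwiner k r r' := by
    have := bkIntertwiner_mul_sum_smul_klrIdempotent k h t
    rwa [swap_apply_of_ne_of_ne htr htr'] at this
  have hxD : (jucysMurphy k r - jucysMurphy k r') * D = D * (jucysMurphy k r - jucysMurphy k r') := by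
    rw [sub_mul, mul_sub, hD, jucysMurphy_mul_sum_smul_klrIdempotent_comm,
      jucysMurphy_mul_sum_smul_klrIdempotent_comm]
  -- `C x_{r,r'} = 0`
  have hCx : C * (jucysMurphy k r - jucysMurphy k r') = 0 := by
    have h2 : MonoidAlgebra.of k _ (swap r r') * (jucysMurphy k r - jucysMurphy k r') * D =
        D * (MonoidAlgebra.of k _ (swap r r') * (jucysMurphy k r - jucysMurphy k r')) := by
      have := hθ
      rw [bkIntertwiner, add_mul, one_mul, mul_add, mul_one] at this
      exact add_right_cancel this
    rw [mul_assoc, hxD, ← mul_assoc, ← mul_assoc] at h2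
    rw [hC, sub_mul, h2, sub_self]
  -- `e`-wise
  rw [← mul_one C, ← sum_residueSeqs_klrIdempotent k (n := n), Finset.mul_sum]
  refine Finset.sum_eq_zero fun χ _ => ?_
  by_cases hc : χ r = χ r'
  · have hmem := of_swap_mul_klrIdempotent_mem k h hc
    rw [hC, sub_mul, mul_assoc, sum_smul_klrIdempotent_mul_of_mem k t (klrIdempotent_mem k χ),
      mul_assoc, sum_smul_klrIdempotent_mul_of_mem k t hmem, mul_smul_comm, sub_self]
  · have hu := isUnit_bkDiffUnit k r r' (sub_ne_zero.2 hc)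
    rw [← hu.mul_left_eq_zero, mul_assoc, (commute_klrIdempotent_bkDiffUnit k χ r r' _).eq,
      bkDiffUnit, ← jucysMurphy_sub_mul_klrIdempotent, ← mul_assoc, hCx, zero_mul]

/-- `s_r y_t = y_t s_r` for `t ∉ {r, r+1}`. [folklore] -/
theorem commute_of_swap_bkNilpotent {r r' t : Fin n} (h : (r' : ℕ) = r + 1) (htr : t ≠ r)
    (htr' : t ≠ r') : Commute (MonoidAlgebra.of k _ (swap r r')) (bkNilpotent k t) := by
  have ht : bkNilpotent k t = jucysMurphy k t - ∑ χ ∈ residueSeqs k n, χ t • klrIdempotent k χ :=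
    eq_sub_of_add_eq (jucysMurphy_eq_bkNilpotent_add k t).symm
  rw [ht]
  exact Commute.sub_right (of_swap_mul_jucysMurphy_of_ne k h htr htr')
    (of_swap_mul_sum_smul_klrIdempotent_comm k h htr htr')

/-- `s_r` commutes with `bkDiffUnit t t'' c` for `t, t'' ∉ {r, r+1}`. [folklore] -/
theorem commute_of_swap_bkDiffUnit {r r' t t'' : Fin n} (h : (r' : ℕ) = r + 1) (h1 : t ≠ r)
    (h2 : t ≠ r') (h3 : t'' ≠ r) (h4 : t'' ≠ r') (c : k) :
    Commute (MonoidAlgebra.of k _ (swap r r')) (bkDiffUnit k t t'' c) :=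
  (Algebra.commute_algebraMap_right c _).add_right
    ((commute_of_swap_bkNilpotent k h h1 h2).sub_right (commute_of_swap_bkNilpotent k h h3 h4))

/-- `θ_r` commutes with `bkDiffUnit t t'' c` for `t, t'' ∉ {r, r+1}`. [folklore] -/
theorem commute_bkIntertwiner_bkDiffUnit {r r' t t'' : Fin n} (h : (r' : ℕ) = r + 1) (h1 : t ≠ r)
    (h2 : t ≠ r') (h3 : t'' ≠ r) (h4 : t'' ≠ r') (c : k) :
    Commute (bkIntertwiner k r r') (bkDiffUnit k t t'' c) := by
  refine (Algebra.commute_algebraMap_right c _).add_right (Commute.sub_right ?_ ?_)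
  · have := bkIntertwiner_mul_bkNilpotent k h t
    rwa [swap_apply_of_ne_of_ne h1 h2] at this
  · have := bkIntertwiner_mul_bkNilpotent k h t''
    rwa [swap_apply_of_ne_of_ne h3 h4] at this

/-- The `bkDiffUnit`s commute with each other. [folklore] -/
theorem commute_bkDiffUnit (r r' t t' : Fin n) (c d : k) :
    Commute (bkDiffUnit k r r' c) (bkDiffUnit k t t' d) := by
  have hy : ∀ a b : Fin n, Commute (bkNilpotent k a) (bkNilpotent k b) := commute_bkNilpotent k
  refine Commute.add_left (Algebra.commute_algebraMap_left c _) (Commute.add_right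
    (Algebra.commute_algebraMap_right d _) ?_)
  exact ((hy r t).sub_right (hy r t')).sub_left ((hy r' t).sub_right (hy r' t'))

omit [DecidableEq k] in
/-- `s_r` commutes with `θ_t` for `t, t' ∉ {r, r+1}`. [folklore] -/
theorem commute_of_swap_bkIntertwiner {r r' t t' : Fin n} (hr : (r' : ℕ) = r + 1)
    (h1 : t ≠ r) (h2 : t ≠ r') (h3 : t' ≠ r) (h4 : t' ≠ r') :
    Commute (MonoidAlgebra.of k _ (swap r r')) (bkIntertwiner k t t') := by
  have hs : Commute (MonoidAlgebra.of k _ (swap r r')) (MonoidAlgebra.of k _ (swap t t')) :=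
    of_swap_mul_of_swap_comm k h1 h2 h3 h4
  have hx : Commute (MonoidAlgebra.of k _ (swap r r')) (jucysMurphy k t - jucysMurphy k t') :=
    Commute.sub_right (of_swap_mul_jucysMurphy_of_ne k hr h1 h2)
      (of_swap_mul_jucysMurphy_of_ne k hr h3 h4)
  exact (hs.mul_right hx).add_right (Commute.one_right _)

omit [DecidableEq k] in
/-- **`θ_r θ_t = θ_t θ_r` for `|r - t| > 1`.** [folklore] -/
theorem commute_bkIntertwiner_of_far {r r' t t' : Fin n} (hr : (r' : ℕ) = r + 1)
    (ht : (t' : ℕ) = t + 1) (h1 : t ≠ r) (h2 : t ≠ r') (h3 : t' ≠ r) (h4 : t' ≠ r') :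
    Commute (bkIntertwiner k r r') (bkIntertwiner k t t') := by
  have hsθ := commute_of_swap_bkIntertwiner k hr h1 h2 h3 h4
  have hxθ : Commute (jucysMurphy k r - jucysMurphy k r') (bkIntertwiner k t t') :=
    Commute.sub_left (bkIntertwiner_mul_jucysMurphy_of_ne k ht h1.symm h3.symm).symm
      (bkIntertwiner_mul_jucysMurphy_of_ne k ht h2.symm h4.symm).symm
  exact (hsθ.mul_left hxθ).add_left (Commute.one_left _)

/-- The coefficient `X_r(𝐢)` with `φ_r e(𝐢) = X_r(𝐢) e(𝐢)`: `s_r + 1` if `i_r = i_{r+1}`,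
`θ_r x_{r,r+1}^{-1}` (realised with `Ring.inverse (bkDiffUnit …)`) otherwise. [folklore] -/
def bkPhiCoeff (r r' : Fin n) (χ : Fin n → k) : MonoidAlgebra k (Perm (Fin n)) :=
  if χ r = χ r' then MonoidAlgebra.of k _ (swap r r') + 1
  else bkIntertwiner k r r' * Ring.inverse (bkDiffUnit k r r' (χ r - χ r'))

/-- `φ_r e(𝐢) = X_r(𝐢) e(𝐢)`. [folklore] -/
theorem bkPhi_mul_klrIdempotent' (r r' : Fin n) (χ : Fin n → k) :
    bkPhi k r r' * klrIdempotent k χ = bkPhiCoeff k r r' χ * klrIdempotent k χ := by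
  rw [bkPhi_mul_klrIdempotent, bkPhiCoeff]
  split_ifs <;> rfl

/-- `X_r(s_t 𝐢) = X_r(𝐢)` for `|r - t| > 1`. [folklore] -/
theorem bkPhiCoeff_comp_swap {r r' t t' : Fin n} (h1 : t ≠ r) (h2 : t ≠ r') (h3 : t' ≠ r)
    (h4 : t' ≠ r') (χ : Fin n → k) :
    bkPhiCoeff k r r' (χ ∘ swap t t') = bkPhiCoeff k r r' χ := by
  simp only [bkPhiCoeff, Function.comp_apply, swap_apply_of_ne_of_ne h1.symm h3.symm,
    swap_apply_of_ne_of_ne h2.symm h4.symm]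

/-- `X_r(𝐢) X_t(𝐢) = X_t(𝐢) X_r(𝐢)` for `|r - t| > 1`. [folklore] -/
theorem commute_bkPhiCoeff_of_far {r r' t t' : Fin n} (hr : (r' : ℕ) = r + 1)
    (ht : (t' : ℕ) = t + 1) (h1 : t ≠ r) (h2 : t ≠ r') (h3 : t' ≠ r) (h4 : t' ≠ r')
    (χ : Fin n → k) : Commute (bkPhiCoeff k r r' χ) (bkPhiCoeff k t t' χ) := by
  -- the four building blocks on the `r` side commute with the two on the `t` side
  have hss : Commute (MonoidAlgebra.of k _ (swap r r') + 1) (MonoidAlgebra.of k _ (swap t t') + 1) :=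
    (Commute.add_right (of_swap_mul_of_swap_comm k h1 h2 h3 h4) (Commute.one_right _)).add_left
      (Commute.one_left _)
  by_cases hcr : χ r = χ r' <;> by_cases hct : χ t = χ t' <;>
    simp only [bkPhiCoeff, hcr, hct, if_true, if_false]
  · exact hss
  · -- `(s_r + 1)` vs `θ_t u_t⁻¹`
    have hu := isUnit_bkDiffUnit k t t' (sub_ne_zero.2 hct)
    have h₁ : Commute (MonoidAlgebra.of k _ (swap r r') + 1) (bkIntertwiner k t t') :=
      (commute_of_swap_bkIntertwiner k hr h1 h2 h3 h4).add_left (Commute.one_left _)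
    have h₂ : Commute (MonoidAlgebra.of k _ (swap r r') + 1)
        (Ring.inverse (bkDiffUnit k t t' (χ t - χ t'))) :=
      commute_ringInverse_of_commute
        ((commute_of_swap_bkDiffUnit k hr h1 h2 h3 h4 _).add_left (Commute.one_left _)) hu
    exact h₁.mul_right h₂
  · -- `θ_r u_r⁻¹` vs `(s_t + 1)`
    have hu := isUnit_bkDiffUnit k r r' (sub_ne_zero.2 hcr)
    have h₁ : Commute (MonoidAlgebra.of k _ (swap t t') + 1) (bkIntertwiner k r r') :=
      (commute_of_swap_bkIntertwiner k ht h1.symm h3.symm h2.symm h4.symm).add_left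
        (Commute.one_left _)
    have h₂ : Commute (MonoidAlgebra.of k _ (swap t t') + 1)
        (Ring.inverse (bkDiffUnit k r r' (χ r - χ r'))) :=
      commute_ringInverse_of_commute
        ((commute_of_swap_bkDiffUnit k ht h1.symm h3.symm h2.symm h4.symm _).add_left
          (Commute.one_left _)) hu
    exact (h₁.mul_right h₂).symm
  · -- `θ_r u_r⁻¹` vs `θ_t u_t⁻¹`
    have hur := isUnit_bkDiffUnit k r r' (sub_ne_zero.2 hcr)
    have hut := isUnit_bkDiffUnit k t t' (sub_ne_zero.2 hct)
    have hθθ := commute_bkIntertwiner_of_far k hr ht h1 h2 h3 h4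
    have hθu : Commute (bkIntertwiner k r r') (Ring.inverse (bkDiffUnit k t t' (χ t - χ t'))) :=
      commute_ringInverse_of_commute (commute_bkIntertwiner_bkDiffUnit k hr h1 h2 h3 h4 _) hut
    have huθ : Commute (Ring.inverse (bkDiffUnit k r r' (χ r - χ r'))) (bkIntertwiner k t t') :=
      (commute_ringInverse_of_commute
        (commute_bkIntertwiner_bkDiffUnit k ht h1.symm h3.symm h2.symm h4.symm _) hur).symm
    have huu : Commute (Ring.inverse (bkDiffUnit k r r' (χ r - χ r')))
        (Ring.inverse (bkDiffUnit k t t' (χ t - χ t'))) :=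
      (commute_bkDiffUnit k r r' t t' _ _).ringInverse_ringInverse
    exact (hθθ.mul_right hθu).mul_left (huθ.mul_right huu)

/-- **(EI2) `φ_r φ_t e(𝐢) = φ_t φ_r e(𝐢)`, indeed `= X_r(𝐢) X_t(𝐢) e(𝐢)`, for `|r - t| > 1`.**
[folklore] -/
theorem bkPhi_mul_bkPhi_mul_klrIdempotent_of_far {r r' t t' : Fin n}
    (ht : (t' : ℕ) = t + 1) (h1 : t ≠ r) (h2 : t ≠ r') (h3 : t' ≠ r) (h4 : t' ≠ r')
    (χ : Fin n → k) :
    bkPhi k r r' * bkPhi k t t' * klrIdempotent k χ =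
      bkPhiCoeff k r r' χ * bkPhiCoeff k t t' χ * klrIdempotent k χ := by
  rw [mul_assoc, bkPhi_mul_klrIdempotent_eq k ht, ← mul_assoc, bkPhi_mul_klrIdempotent',
    bkPhiCoeff_comp_swap k h1 h2 h3 h4, mul_assoc, ← bkPhi_mul_klrIdempotent_eq k ht,
    bkPhi_mul_klrIdempotent', ← mul_assoc]

/-- **(EI2) `φ_r φ_t = φ_t φ_r` for `|r - t| > 1`** (Brundan–Kleshchev 2009, Lemma 3.1 (3.8)).
[folklore] -/
theorem bkPhi_comm_of_far {r r' t t' : Fin n} (hr : (r' : ℕ) = r + 1) (ht : (t' : ℕ) = t + 1)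
    (h1 : t ≠ r) (h2 : t ≠ r') (h3 : t' ≠ r) (h4 : t' ≠ r') :
    bkPhi k r r' * bkPhi k t t' = bkPhi k t t' * bkPhi k r r' := by
  rw [← mul_one (bkPhi k r r' * bkPhi k t t'), ← mul_one (bkPhi k t t' * bkPhi k r r'),
    ← sum_residueSeqs_klrIdempotent k (n := n), Finset.mul_sum, Finset.mul_sum]
  refine Finset.sum_congr rfl fun χ _ => ?_
  rw [bkPhi_mul_bkPhi_mul_klrIdempotent_of_far k ht h1 h2 h3 h4,
    bkPhi_mul_bkPhi_mul_klrIdempotent_of_far k hr h1.symm h3.symm h2.symm h4.symm,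
    (commute_bkPhiCoeff_of_far k hr ht h1 h2 h3 h4 χ).eq]

end BKPhiFar


/-! ### The braid relation `θ_r θ_{r+1} θ_r = θ_{r+1} θ_r θ_{r+1}` (Brundan–Kleshchev (3.5), [Kbook]) -/

section ThetaBraid

open Equiv

/-- Abstract form of the braid computation: in any ring, if `a² = b² = 1`, `aba = bab`,
`U b = b W + 1`, `V a = a W + 1`, `W a = a V - 1`, `W b = b U - 1` with `W = U + V` and
`U, V, W` pairwise commuting, then `(aU + 1)(bV + 1)(aU + 1) = (bV + 1)(aU + 1)(bV + 1)`.
(Here `a = s_r`, `b = s_{r+1}`, `U = x_r - x_{r+1}`, `V = x_{r+1} - x_{r+2}`.) [folklore] -/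
theorem braid_of_degenerateHecke_relations {A : Type*} [Ring A] {a b U V W : A}
    (hW : U + V = W) (haa : a * a = 1) (hbb : b * b = 1) (haba : a * b * a = b * a * b)
    (hUb : U * b = b * W + 1) (hVa : V * a = a * W + 1) (hWa : W * a = a * V - 1)
    (hWb : W * b = b * U - 1) (hUV : U * V = V * U) (hUW : U * W = W * U)
    (hVW : V * W = W * V) :
    (a * U + 1) * (b * V + 1) * (a * U + 1) = (b * V + 1) * (a * U + 1) * (b * V + 1) := by
  have h12 : (a * U + 1) * (b * V + 1) = a * b * (W * V) + a * W + b * V + 1 := by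
    calc (a * U + 1) * (b * V + 1) = a * (U * b) * V + a * U + b * V + 1 := by noncomm_ring
      _ = a * b * (W * V) + a * (U + V) + b * V + 1 := by rw [hUb]; noncomm_ring
      _ = _ := by rw [hW]
  have h21 : (b * V + 1) * (a * U + 1) = b * a * (W * U) + b * W + a * U + 1 := by
    calc (b * V + 1) * (a * U + 1) = b * (V * a) * U + b * V + a * U + 1 := by noncomm_ring
      _ = b * a * (W * U) + b * (U + V) + a * U + 1 := by rw [hVa]; noncomm_ring
      _ = _ := by rw [hW]
  have hWVa : W * V * a = a * (V * W) := by
    rw [mul_assoc, hVa, mul_add, mul_one, ← mul_assoc, hWa]; noncomm_ring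
  have hWUb : W * U * b = b * (U * W) := by
    rw [mul_assoc, hUb, mul_add, mul_one, ← mul_assoc, hWb]; noncomm_ring
  have lhs : (a * U + 1) * (b * V + 1) * (a * U + 1) =
      a * b * a * (V * W * U) + a * b * (W * V) + b * a * (W * U) + a * W + b * W + V * U + 1 := by
    rw [h12]
    calc (a * b * (W * V) + a * W + b * V + 1) * (a * U + 1)
        = a * b * (W * V * a) * U + a * (W * a) * U + b * (V * a) * U + a * U +
            (a * b * (W * V) + a * W + b * V + 1) := by noncomm_ring
      _ = a * b * (a * (V * W)) * U + a * (a * V - 1) * U + b * (a * W + 1) * U + a * U +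
            (a * b * (W * V) + a * W + b * V + 1) := by rw [hWVa, hWa, hVa]
      _ = a * b * a * (V * W * U) + (a * a) * (V * U) + b * a * (W * U) + b * (U + V) +
            a * b * (W * V) + a * W + 1 := by noncomm_ring
      _ = _ := by rw [haa, hW]; noncomm_ring
  have rhs : (b * V + 1) * (a * U + 1) * (b * V + 1) =
      b * a * b * (U * W * V) + a * b * (W * V) + b * a * (W * U) + a * W + b * W + U * V + 1 := by
    rw [h21]
    calc (b * a * (W * U) + b * W + a * U + 1) * (b * V + 1)
        = b * a * (W * U * b) * V + b * (W * b) * V + a * (U * b) * V + b * V +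
            (b * a * (W * U) + b * W + a * U + 1) := by noncomm_ring
      _ = b * a * (b * (U * W)) * V + b * (b * U - 1) * V + a * (b * W + 1) * V + b * V +
            (b * a * (W * U) + b * W + a * U + 1) := by rw [hWUb, hWb, hUb]
      _ = b * a * b * (U * W * V) + (b * b) * (U * V) + a * b * (W * V) + a * (U + V) +
            b * a * (W * U) + b * W + 1 := by noncomm_ring
      _ = _ := by rw [hbb, hW]; noncomm_ring
  have hpoly : V * W * U = U * W * V := by
    rw [mul_assoc, ← hUW, ← mul_assoc, ← hUV, mul_assoc, hVW, ← mul_assoc]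
  rw [lhs, rhs, haba, hpoly, hUV]

variable (k : Type*) [CommRing k] {n : ℕ}

/-- **The braid relation for the intertwiners: `θ_r θ_{r+1} θ_r = θ_{r+1} θ_r θ_{r+1}`**
(Brundan–Kleshchev 2009, (3.5); Kleshchev's book). [folklore] -/
theorem bkIntertwiner_braid {r r' r'' : Fin n} (h : (r' : ℕ) = r + 1) (h' : (r'' : ℕ) = r' + 1) :
    bkIntertwiner k r r' * bkIntertwiner k r' r'' * bkIntertwiner k r r' =
      bkIntertwiner k r' r'' * bkIntertwiner k r r' * bkIntertwiner k r' r'' := by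
  have hrr' : r ≠ r' := by intro e; rw [Fin.ext_iff] at e; omega
  have hr'r'' : r' ≠ r'' := by intro e; rw [Fin.ext_iff] at e; omega
  have hrr'' : r ≠ r'' := by intro e; rw [Fin.ext_iff] at e; omega
  have hbraidS : MonoidAlgebra.of k (Perm (Fin n)) (swap r r') * MonoidAlgebra.of k _ (swap r' r'') *
      MonoidAlgebra.of k _ (swap r r') =
      MonoidAlgebra.of k _ (swap r' r'') * MonoidAlgebra.of k _ (swap r r') *
        MonoidAlgebra.of k _ (swap r' r'') := by
    rw [← map_mul, ← map_mul, ← map_mul, ← map_mul]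
    congr 1
    rw [swap_mul_swap_mul_swap hrr' hrr'', swap_comm r r', swap_comm r' r'',
      swap_mul_swap_mul_swap (Ne.symm hr'r'') (Ne.symm hrr''), swap_comm]
  have hL := fun a b : Fin n => commute_jucysMurphy k a b
  refine braid_of_degenerateHecke_relations (W := jucysMurphy k r - jucysMurphy k r'')
    (sub_add_sub_cancel _ _ _) (of_swap_mul_self k r r') (of_swap_mul_self k r' r'') hbraidS
    ?_ ?_ ?_ ?_ ?_ ?_ ?_
  · -- `(L_r - L_{r'}) s' = s' (L_r - L_{r''}) + 1`
    have h1 := of_swap_mul_jucysMurphy_of_ne k h' hrr' hrr''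
    have h2 := of_swap_mul_jucysMurphy_succ k h'
    rw [sub_mul, ← h1, mul_sub]
    -- `L_{r'} s' = s' L_{r''} - 1`
    have h3 : jucysMurphy k r' * MonoidAlgebra.of k _ (swap r' r'') =
        MonoidAlgebra.of k _ (swap r' r'') * jucysMurphy k r'' - 1 := eq_sub_of_add_eq h2.symm
    rw [h3]; abel
  · -- `(L_{r'} - L_{r''}) s = s (L_r - L_{r''}) + 1`
    have h1 := jucysMurphy_succ_mul_swap k h
    have h2 := of_swap_mul_jucysMurphy_of_ne k h (Ne.symm hrr'') (Ne.symm hr'r'')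
    rw [sub_mul, h1, ← h2, mul_sub]; abel
  · -- `(L_r - L_{r''}) s = s (L_{r'} - L_{r''}) - 1`
    have h1 := of_swap_mul_jucysMurphy_succ k h
    have h2 := of_swap_mul_jucysMurphy_of_ne k h (Ne.symm hrr'') (Ne.symm hr'r'')
    have h3 : jucysMurphy k r * MonoidAlgebra.of k _ (swap r r') =
        MonoidAlgebra.of k _ (swap r r') * jucysMurphy k r' - 1 := eq_sub_of_add_eq h1.symm
    rw [sub_mul, h3, ← h2, mul_sub]; abel
  · -- `(L_r - L_{r''}) s' = s' (L_r - L_{r'}) - 1`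
    have h1 := of_swap_mul_jucysMurphy_of_ne k h' hrr' hrr''
    have h2 := jucysMurphy_succ_mul_swap k h'
    rw [sub_mul, ← h1, h2, mul_sub]; abel
  · exact (((hL r r').sub_left (hL r' r')).sub_right ((hL r r'').sub_left (hL r' r''))).eq
  · exact (((hL r r).sub_left (hL r' r)).sub_right ((hL r r'').sub_left (hL r' r''))).eq
  · exact (((hL r' r).sub_left (hL r'' r)).sub_right ((hL r' r'').sub_left (hL r'' r''))).eq

end ThetaBraid


/-! ### Products of `φ`'s on `e(𝐢)` in terms of the coefficients `X_r(𝐢)` (entry point of (EI6)) -/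

section BKPhiProducts

open Equiv

variable (k : Type*) [Field k] [DecidableEq k] {n : ℕ}

/-- `φ_b φ_c e(𝐢) = X_b(s_c 𝐢) X_c(𝐢) e(𝐢)`. [folklore] -/
theorem bkPhi_mul_bkPhi_mul_klrIdempotent_eq {b b' c c' : Fin n} (hc : (c' : ℕ) = c + 1)
    (χ : Fin n → k) :
    bkPhi k b b' * bkPhi k c c' * klrIdempotent k χ =
      bkPhiCoeff k b b' (χ ∘ swap c c') * bkPhiCoeff k c c' χ * klrIdempotent k χ := by
  rw [mul_assoc, bkPhi_mul_klrIdempotent_eq k hc, ← mul_assoc, bkPhi_mul_klrIdempotent',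
    mul_assoc, ← bkPhi_mul_klrIdempotent_eq k hc, bkPhi_mul_klrIdempotent', ← mul_assoc]

/-- `φ_b φ_c e(𝐢) = e(s_b s_c 𝐢) φ_b φ_c`. [folklore] -/
theorem bkPhi_mul_bkPhi_mul_klrIdempotent_eq' {b b' c c' : Fin n} (hb : (b' : ℕ) = b + 1)
    (hc : (c' : ℕ) = c + 1) (χ : Fin n → k) :
    bkPhi k b b' * bkPhi k c c' * klrIdempotent k χ =
      klrIdempotent k ((χ ∘ swap c c') ∘ swap b b') * (bkPhi k b b' * bkPhi k c c') := by
  rw [mul_assoc, bkPhi_mul_klrIdempotent_eq k hc, ← mul_assoc, bkPhi_mul_klrIdempotent_eq k hb,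
    mul_assoc]

/-- **`φ_a φ_b φ_c e(𝐢) = X_a(s_b s_c 𝐢) X_b(s_c 𝐢) X_c(𝐢) e(𝐢)`** — the form in which the braid
relation (EI6) of Brundan–Kleshchev's Lemma 3.1 is checked case by case. [folklore] -/
theorem bkPhi_triple_mul_klrIdempotent_eq {a a' b b' c c' : Fin n} (hb : (b' : ℕ) = b + 1)
    (hc : (c' : ℕ) = c + 1) (χ : Fin n → k) :
    bkPhi k a a' * bkPhi k b b' * bkPhi k c c' * klrIdempotent k χ =
      bkPhiCoeff k a a' ((χ ∘ swap c c') ∘ swap b b') * bkPhiCoeff k b b' (χ ∘ swap c c') *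
        bkPhiCoeff k c c' χ * klrIdempotent k χ := by
  rw [mul_assoc (bkPhi k a a'), mul_assoc (bkPhi k a a'),
    bkPhi_mul_bkPhi_mul_klrIdempotent_eq' k hb hc, ← mul_assoc (bkPhi k a a'),
    bkPhi_mul_klrIdempotent', mul_assoc (bkPhiCoeff k a a' _),
    ← bkPhi_mul_bkPhi_mul_klrIdempotent_eq' k hb hc, bkPhi_mul_bkPhi_mul_klrIdempotent_eq k hc,
    ← mul_assoc, ← mul_assoc]

/-- **(EI6), case `i_r = i_{r+1} = i_{r+2}`:
`φ_r φ_{r+1} φ_r e(𝐢) = (φ_{r+1} φ_r φ_{r+1} + φ_r - φ_{r+1}) e(𝐢)`** (Brundan–Kleshchev 2009,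
Lemma 3.1 (3.12), first case; Case 5 of the proof: `(s_1+1)(s_2+1)(s_1+1) + s_2 =
(s_2+1)(s_1+1)(s_2+1) + s_1`). [folklore] -/
theorem bkPhi_braid_of_eq_eq {r r' r'' : Fin n} (h : (r' : ℕ) = r + 1) (h' : (r'' : ℕ) = r' + 1)
    {χ : Fin n → k} (h1 : χ r = χ r') (h2 : χ r' = χ r'') :
    bkPhi k r r' * bkPhi k r' r'' * bkPhi k r r' * klrIdempotent k χ =
      (bkPhi k r' r'' * bkPhi k r r' * bkPhi k r' r'' + bkPhi k r r' - bkPhi k r' r'') *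
        klrIdempotent k χ := by
  have hrr' : r ≠ r' := by intro e; rw [Fin.ext_iff] at e; omega
  have hr'r'' : r' ≠ r'' := by intro e; rw [Fin.ext_iff] at e; omega
  have hrr'' : r ≠ r'' := by intro e; rw [Fin.ext_iff] at e; omega
  -- all the residue sequences met are `𝐢` itself
  have hfix1 : χ ∘ swap r r' = χ := by
    funext x; simp only [Function.comp_apply]
    by_cases hx : x = r
    · subst hx; rw [swap_apply_left, h1]
    by_cases hx' : x = r'
    · subst hx'; rw [swap_apply_right, h1]
    rw [swap_apply_of_ne_of_ne hx hx']
  have hfix2 : χ ∘ swap r' r'' = χ := by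
    funext x; simp only [Function.comp_apply]
    by_cases hx : x = r'
    · subst hx; rw [swap_apply_left, h2]
    by_cases hx' : x = r''
    · subst hx'; rw [swap_apply_right, h2]
    rw [swap_apply_of_ne_of_ne hx hx']
  have hX1 : bkPhiCoeff k r r' χ = MonoidAlgebra.of k _ (swap r r') + 1 := by
    rw [bkPhiCoeff, if_pos h1]
  have hX2 : bkPhiCoeff k r' r'' χ = MonoidAlgebra.of k _ (swap r' r'') + 1 := by
    rw [bkPhiCoeff, if_pos h2]
  have hbraidS : MonoidAlgebra.of k (Perm (Fin n)) (swap r r') * MonoidAlgebra.of k _ (swap r' r'') *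
      MonoidAlgebra.of k _ (swap r r') =
      MonoidAlgebra.of k _ (swap r' r'') * MonoidAlgebra.of k _ (swap r r') *
        MonoidAlgebra.of k _ (swap r' r'') := by
    rw [← map_mul, ← map_mul, ← map_mul, ← map_mul]
    congr 1
    rw [swap_mul_swap_mul_swap hrr' hrr'', swap_comm r r', swap_comm r' r'',
      swap_mul_swap_mul_swap (Ne.symm hr'r'') (Ne.symm hrr''), swap_comm]
  rw [bkPhi_triple_mul_klrIdempotent_eq k h' h, sub_mul, add_mul,
    bkPhi_triple_mul_klrIdempotent_eq k h h', bkPhi_mul_klrIdempotent', bkPhi_mul_klrIdempotent']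
  simp only [hfix1, hfix2]
  rw [hX1, hX2, ← add_mul, ← sub_mul]
  congr 1
  have hss := of_swap_mul_self k r r'
  have htt := of_swap_mul_self k r' r''
  -- `(s+1)(t+1)(s+1) = (t+1)(s+1)(t+1) + (s+1) - (t+1)` given `sts = tst`, `s² = t² = 1`
  calc (MonoidAlgebra.of k _ (swap r r') + 1) * (MonoidAlgebra.of k _ (swap r' r'') + 1) *
        (MonoidAlgebra.of k _ (swap r r') + 1)
      = MonoidAlgebra.of k _ (swap r r') * MonoidAlgebra.of k _ (swap r' r'') *
          MonoidAlgebra.of k _ (swap r r') +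
        MonoidAlgebra.of k _ (swap r r') * MonoidAlgebra.of k _ (swap r' r'') +
        MonoidAlgebra.of k _ (swap r' r'') * MonoidAlgebra.of k _ (swap r r') +
        MonoidAlgebra.of k _ (swap r r') * MonoidAlgebra.of k _ (swap r r') +
        2 • MonoidAlgebra.of k _ (swap r r') + MonoidAlgebra.of k _ (swap r' r'') + 1 := by
          noncomm_ring
    _ = MonoidAlgebra.of k _ (swap r' r'') * MonoidAlgebra.of k _ (swap r r') *
          MonoidAlgebra.of k _ (swap r' r'') +
        MonoidAlgebra.of k _ (swap r r') * MonoidAlgebra.of k _ (swap r' r'') +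
        MonoidAlgebra.of k _ (swap r' r'') * MonoidAlgebra.of k _ (swap r r') +
        MonoidAlgebra.of k _ (swap r' r'') * MonoidAlgebra.of k _ (swap r' r'') +
        2 • MonoidAlgebra.of k _ (swap r r') + MonoidAlgebra.of k _ (swap r' r'') + 1 := by
          rw [hbraidS, hss, htt]
    _ = _ := by noncomm_ring


/-- `θ_p (c + y_a - y_b) = (c + y_{s_p a} - y_{s_p b}) θ_p`. [folklore] -/
theorem bkIntertwiner_mul_bkDiffUnit_gen {p p' : Fin n} (h : (p' : ℕ) = p + 1) (a b : Fin n)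
    (c : k) :
    bkIntertwiner k p p' * bkDiffUnit k a b c =
      bkDiffUnit k (swap p p' a) (swap p p' b) c * bkIntertwiner k p p' := by
  rw [bkDiffUnit, bkDiffUnit, mul_add, add_mul, mul_sub, sub_mul, bkIntertwiner_mul_bkNilpotent k h a,
    bkIntertwiner_mul_bkNilpotent k h b, (Algebra.commute_algebraMap_right c (bkIntertwiner k p p')).eq]

/-- Moving an inverse difference past `θ_p`:
`(c + y_a - y_b)⁻¹ θ_p = θ_p (c + y_{s_p a} - y_{s_p b})⁻¹` (`c ≠ 0`). [folklore] -/
theorem ringInverse_bkDiffUnit_mul_bkIntertwiner {p p' : Fin n} (h : (p' : ℕ) = p + 1)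
    (a b : Fin n) {c : k} (hc : c ≠ 0) :
    Ring.inverse (bkDiffUnit k a b c) * bkIntertwiner k p p' =
      bkIntertwiner k p p' * Ring.inverse (bkDiffUnit k (swap p p' a) (swap p p' b) c) := by
  have hsemi : bkIntertwiner k p p' * bkDiffUnit k (swap p p' a) (swap p p' b) c =
      bkDiffUnit k a b c * bkIntertwiner k p p' := by
    rw [bkIntertwiner_mul_bkDiffUnit_gen k h, swap_apply_self, swap_apply_self]
  exact (mul_ringInverse_of_semiconj hsemi (isUnit_bkDiffUnit k _ _ hc)
    (isUnit_bkDiffUnit k _ _ hc)).symm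

/-- **(EI6), case `i_r, i_{r+1}, i_{r+2}` pairwise distinct:
`φ_r φ_{r+1} φ_r e(𝐢) = φ_{r+1} φ_r φ_{r+1} e(𝐢)`** (Brundan–Kleshchev 2009, Lemma 3.1 (3.12),
third case; Case 1 of the proof: move all the inverses to the right of `θ_r θ_{r+1} θ_r =
θ_{r+1} θ_r θ_{r+1}`). [folklore] -/
theorem bkPhi_braid_of_ne {r r' r'' : Fin n} (h : (r' : ℕ) = r + 1) (h' : (r'' : ℕ) = r' + 1)
    {χ : Fin n → k} (hij : χ r ≠ χ r') (hjk : χ r' ≠ χ r'') (hik : χ r ≠ χ r'') :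
    bkPhi k r r' * bkPhi k r' r'' * bkPhi k r r' * klrIdempotent k χ =
      bkPhi k r' r'' * bkPhi k r r' * bkPhi k r' r'' * klrIdempotent k χ := by
  have hrr' : r ≠ r' := by intro e; rw [Fin.ext_iff] at e; omega
  have hr'r'' : r' ≠ r'' := by intro e; rw [Fin.ext_iff] at e; omega
  have hrr'' : r ≠ r'' := by intro e; rw [Fin.ext_iff] at e; omega
  -- the six coefficients
  have hA1 : bkPhiCoeff k r r' χ =
      bkIntertwiner k r r' * Ring.inverse (bkDiffUnit k r r' (χ r - χ r')) := by
    rw [bkPhiCoeff, if_neg hij]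
  have hA2 : bkPhiCoeff k r' r'' (χ ∘ swap r r') =
      bkIntertwiner k r' r'' * Ring.inverse (bkDiffUnit k r' r'' (χ r - χ r'')) := by
    have e1 : (χ ∘ swap r r') r' = χ r := by simp [swap_apply_right]
    have e2 : (χ ∘ swap r r') r'' = χ r'' := by
      simp [swap_apply_of_ne_of_ne (Ne.symm hrr'') (Ne.symm hr'r'')]
    rw [bkPhiCoeff, e1, e2, if_neg hik]
  have hA3 : bkPhiCoeff k r r' ((χ ∘ swap r r') ∘ swap r' r'') =
      bkIntertwiner k r r' * Ring.inverse (bkDiffUnit k r r' (χ r' - χ r'')) := by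
    have e1 : ((χ ∘ swap r r') ∘ swap r' r'') r = χ r' := by
      simp [swap_apply_of_ne_of_ne hrr' hrr'', swap_apply_left]
    have e2 : ((χ ∘ swap r r') ∘ swap r' r'') r' = χ r'' := by
      simp [swap_apply_left, swap_apply_of_ne_of_ne (Ne.symm hrr'') (Ne.symm hr'r'')]
    rw [bkPhiCoeff, e1, e2, if_neg hjk]
  have hB1 : bkPhiCoeff k r' r'' χ =
      bkIntertwiner k r' r'' * Ring.inverse (bkDiffUnit k r' r'' (χ r' - χ r'')) := by
    rw [bkPhiCoeff, if_neg hjk]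
  have hB2 : bkPhiCoeff k r r' (χ ∘ swap r' r'') =
      bkIntertwiner k r r' * Ring.inverse (bkDiffUnit k r r' (χ r - χ r'')) := by
    have e1 : (χ ∘ swap r' r'') r = χ r := by simp [swap_apply_of_ne_of_ne hrr' hrr'']
    have e2 : (χ ∘ swap r' r'') r' = χ r'' := by simp [swap_apply_left]
    rw [bkPhiCoeff, e1, e2, if_neg hik]
  have hB3 : bkPhiCoeff k r' r'' ((χ ∘ swap r' r'') ∘ swap r r') =
      bkIntertwiner k r' r'' * Ring.inverse (bkDiffUnit k r' r'' (χ r - χ r')) := by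
    have e1 : ((χ ∘ swap r' r'') ∘ swap r r') r' = χ r := by
      simp [swap_apply_right, swap_apply_of_ne_of_ne hrr' hrr'']
    have e2 : ((χ ∘ swap r' r'') ∘ swap r r') r'' = χ r' := by
      simp [swap_apply_of_ne_of_ne (Ne.symm hrr'') (Ne.symm hr'r''), swap_apply_right]
    rw [bkPhiCoeff, e1, e2, if_neg hij]
  rw [bkPhi_triple_mul_klrIdempotent_eq k h' h, bkPhi_triple_mul_klrIdempotent_eq k h h',
    hA1, hA2, hA3, hB1, hB2, hB3]
  -- moves `Z ι θ = Z θ ι'` and swaps `Z ι₁ ι₂ = Z ι₂ ι₁`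
  have M1 : ∀ (Z : MonoidAlgebra k (Perm (Fin n))) (a b : Fin n) {c : k}, c ≠ 0 →
      Z * Ring.inverse (bkDiffUnit k a b c) * bkIntertwiner k r r' =
        Z * bkIntertwiner k r r' * Ring.inverse (bkDiffUnit k (swap r r' a) (swap r r' b) c) := by
    intro Z a b c hc
    rw [mul_assoc, ringInverse_bkDiffUnit_mul_bkIntertwiner k h a b hc, ← mul_assoc]
  have M2 : ∀ (Z : MonoidAlgebra k (Perm (Fin n))) (a b : Fin n) {c : k}, c ≠ 0 →
      Z * Ring.inverse (bkDiffUnit k a b c) * bkIntertwiner k r' r'' =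
        Z * bkIntertwiner k r' r'' *
          Ring.inverse (bkDiffUnit k (swap r' r'' a) (swap r' r'' b) c) := by
    intro Z a b c hc
    rw [mul_assoc, ringInverse_bkDiffUnit_mul_bkIntertwiner k h' a b hc, ← mul_assoc]
  have SW : ∀ (Z : MonoidAlgebra k (Perm (Fin n))) (a b a' b' : Fin n) (c c' : k),
      Z * Ring.inverse (bkDiffUnit k a b c) * Ring.inverse (bkDiffUnit k a' b' c') =
        Z * Ring.inverse (bkDiffUnit k a' b' c') * Ring.inverse (bkDiffUnit k a b c) := by
    intro Z a b a' b' c c'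
    rw [mul_assoc, ((commute_bkDiffUnit k a b a' b' c c').ringInverse_ringInverse).eq, ← mul_assoc]
  have hc1 : χ r' - χ r'' ≠ 0 := sub_ne_zero.2 hjk
  have hc2 : χ r - χ r'' ≠ 0 := sub_ne_zero.2 hik
  have hc3 : χ r - χ r' ≠ 0 := sub_ne_zero.2 hij
  simp only [← mul_assoc]
  -- LHS: `θ₁ ι(r,r',c1) θ₂ ι(r',r'',c2) θ₁ ι(r,r',c3) e`
  rw [M2 _ r r' hc1, swap_apply_of_ne_of_ne hrr' hrr'', swap_apply_left,
    M1 _ r' r'' hc2, swap_apply_right, swap_apply_of_ne_of_ne (Ne.symm hrr'') (Ne.symm hr'r''),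
    M1 _ r r'' hc1, swap_apply_left, swap_apply_of_ne_of_ne (Ne.symm hrr'') (Ne.symm hr'r'')]
  -- RHS: `θ₂ ι(r',r'',c3) θ₁ ι(r,r',c2) θ₂ ι(r',r'',c1) e`
  rw [M1 _ r' r'' hc3, swap_apply_right, swap_apply_of_ne_of_ne (Ne.symm hrr'') (Ne.symm hr'r''),
    M2 _ r r' hc2, swap_apply_of_ne_of_ne hrr' hrr'', swap_apply_left,
    M2 _ r r'' hc3, swap_apply_of_ne_of_ne hrr' hrr'', swap_apply_right,
    bkIntertwiner_braid k h h']
  -- now both sides are `θ₂θ₁θ₂` times the same three commuting inverses times `e`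
  rw [SW _ r' r'' r r'' (χ r' - χ r'') (χ r - χ r''),
    SW (bkIntertwiner k r' r'' * bkIntertwiner k r r' * bkIntertwiner k r' r'' *
      Ring.inverse (bkDiffUnit k r r'' (χ r - χ r''))) r' r'' r r' (χ r' - χ r'') (χ r - χ r'),
    SW (bkIntertwiner k r' r'' * bkIntertwiner k r r' * bkIntertwiner k r' r'') r r'' r r'
      (χ r - χ r'') (χ r - χ r')]

end BKPhiProducts

end Literature.RepresentationTheory.FiniteGroups
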